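import Summits.ABC.ABC.Theses.IneffectiveSubspace
import Literature.NumberTheory.DiophantineGeometry.AbcImpliesHall

/-!
# Disproof of `TowerExponentWindow` (crux stmt-ABC-1647, route ABC/IneffectiveSubspace) — findings

Standing adversary (cdisprove seats `refuter-cdisprove-stmt-ABC-1647-0`, cycle 1, and
`refuter-cdisprove-stmt-ABC-1647-g2-0`, cycle 2 = gen 2; 2026-08-16).
Crux: `∃ n ≥ 1, ∃ A, 0 < A, 3A < n, TowerIneq(n, A)` where `TowerIneq(n, A)` = `∀ ε>0 ∃ C>0`,
`Π zᵢ^(i+1) < C·(Π xᵢyᵢzᵢ)^(A+ε)` on positive solutions of `Π xᵢ^(i+1) + Π yᵢ^(i+1) = Π zᵢ^(i+1)` with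
`gcd(a,b) = 1` (this file: `TowerIneq`, `towerExponentWindow_iff : … ↔ … := Iff.rfl`).

VERDICT (cycle 1): **NO KILL, and none is possible short of disproving abc** —
`abc_imp_towerExponentWindow : ABC → TowerExponentWindow`, indeed
`towerExponentWindow_of_polyAbc : (∃ κ C, c < C·rad(abc)^κ on abc triples) → TowerExponentWindow`
(converse = route item `WindowGivesPolynomialAbc`; so crux ⟺ POLYNOMIAL abc, open; best unconditional
bound is subexponential, `Literature.NumberTheory.DiophantineGeometry.stewart_yu`,
barrier `Literature.Barriers.ABC.BakerMethodBounds`).  A counterexample is exactly a sequence of abc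
triples of UNBOUNDED quality `log c / log rad(abc)` (`¬PolyABC ⟺ sup quality = ∞`), against abc's
`limsup = 1`; the record quality is Reyssat's 1.6299 (`Literature.Barriers.ABC.ExplicitABCQualityFloor`),
and no construction of quality bounded away from `1` infinitely often is known
(`Literature.Barriers.ABC.EpsilonCannotBeDropped` has only `1 + o(1)` families).

What IS proved here (all `sorry`-free; axioms ⊆ {propext, Classical.choice, Quot.sound}); the
def-free tree versions (matrix spelled out, spikes as `Pi.mulSingle`, Pell via Mathlib's `Pell.xn/yn`
for `d = 3`) are proposed as `Theorems/TowerExponentWindow/Negative/TowerExponentWindowFloors.lean` and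
`…/TowerExponentWindowLoadBearing.lean` (`--supports stmt-ABC-1647`; importable by lines/skeletons):

(a) LOAD-BEARING HYPOTHESES
* `not_towerExponentWindow_without_coprime` — drop `Nat.Coprime a b`: FALSE at every level
  (family W: `tⁿ + tⁿ = 2tⁿ`, `Π = 2t³`, ratio `log c / log Π → n/3`).  Any proof must use coprimality.
* `not_towerExponentWindow_without_pos` — drop positivity: FALSE by the junk triple `x = 0, y = z = 1`
  (`gcd(0,1) = 1`, `Π = 0`, `1 < C·0^(A+ε) = 0`).  Positivity of `x, y` matters only through this junk;
  `towerExponentWindow_iff_xyPos` — positivity of `z` is REDUNDANT (`c = a + b ≥ 1`).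
* `towerExponentWindow_without_window` — drop `3A < n`: the statement becomes TRIVIALLY TRUE
  (`n = 1, A = 1, C = 2`).  All content sits in the window.
* `towerExponentWindow_iff_noApos`, `towerExponentWindow_iff_noLevelPos` — `0 < A` and `1 ≤ n` are
  DECORATIVE (implied by the rest).
* `towerExponentWindow_iff_epsFree` (cycle 2) — the `∀ ε > 0 ∃ C(ε)` is DECORATIVE too: the crux is
  equivalent to its `ε`-free form `∃ n A C, 3A < n ∧ c < C·Π^A` (both are polynomial abc; contrast abc
  itself, `Literature.Barriers.ABC.EpsilonCannotBeDropped`).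

(b) TIGHTNESS / FLOORS (generic engine `not_towerIneqQ_of_family`: a family with `c^q ≥ α Π^p`, `Π → ∞`
    kills every `A < p/q`)
* `not_towerIneq_of_lt_half` — `A ≥ 1/2` at every level (family H: `1 + m = m+1` at the bottom index).
* `not_towerIneq_of_lt_one`, `one_le_of_towerIneq` — **`A ≥ 1` at every level `n ≥ 2`**: the Pell family
  `1 + Y² = 2Z²` (`pell`, `(Y,Z) ↦ (3Y+4Z, 2Y+3Z)`), `x = 1`, `y = (1,Y,1,…)`, `z = (2,Z,1,…)`,
  `c = 2Z² ≥ (2/3)·Π = (2/3)·2YZ`.  So Vojta's conjectured exponent `A_n = 1` (route items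
  `TowerThesis`, `AbcGivesTower`) cannot be improved at any level, and a window witness lives at
* `four_le_of_window`, `towerExponentWindow_level_ge_four` — **`n ≥ 4` and `A ∈ [1, n/3)`**;
  `not_towerExponentWindow_le_three`, `not_forall_level_window` refute the strengthenings "window at a
  level `≤ 3`" and "window at every level".
* `towerIneq_mono` — monotone in `A`.

(c) WHY IT RESISTS — see VERDICT; `rad_le_tower : rad(abc) ≤ Π xᵢyᵢzᵢ` (`abc ∣ Πⁿ`) is the one-line
    reason the crux sits BELOW polynomial abc; conversely `canonicalTowerLift` (Vojta's lift, = item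
    `CanonicalTowerLift`) and `windowGivesPolynomialAbc` (= item `WindowGivesPolynomialAbc`; both
    attached as candidate proofs on those items) give `towerExponentWindow_iff_polyAbc :
    TowerExponentWindow ↔ ∃ κ C, ∀ abc triples, c < C·rad(abc)^κ` — the crux IS polynomial abc.

(d) TARGETS (cycle 2 — the registered skeleton `Lines/binomial-xi-d-zero-threefold.lean`, stubs
    `stub_binomialDepthWindow` (LEVER, open), `stub_flatBoundOfDepth`, `stub_polyAbcOfFlatBound` (provable);
    payload `stuck_stubs = []`).  See the section `## (d) Targets` at the end of this file:
* the lever `∃ n C C', 0 ≤ C ∧ 3C < n ∧ DepthIneq n C C'` is abc-sandwiched (skeleton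
  `binomialDepthWindow_of_abc`; here sharper: `stub_of_polyAbc` — PolyABC with ANY exponent `κ < 3/2`
  already gives it, so the lever sits in `[PolyABC_{κ<3/2}, PolyABC]` and is NOT cheaper than the crux in
  any visible way) — no kill short of `¬abc`;
* FLOORS on the constant (all kernel-checked, tree files `Theorems/TowerExponentWindow/Negative/
  StubBinomialDepthWindowFloors.lean` (p75188) + `…LevelSeven.lean`): `C ≥ 1` at every level
  (`one_le_of_depthIneq`); **`C ≥ 2` at every level divisible by `4`** (Gaussian family `(2+i)^m`:
  `5^m = X² + Y² ∣ X⁴ − Y⁴`, `two_le_of_depthIneq_four_dvd`); **`C ≥ 2` at every level divisible by `6`**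
  (Eisenstein family `(3+ω)^m`: `7^m = X² − XY + Y² ∣ X⁶ − Y⁶`, `two_le_of_depthIneq_six_dvd`);
  **`C ≥ 9/5` at level `5`** (Padé identity `(t⁴−5t³+15t²−35t+70)(t+1)⁵ − (126t⁴+420t³+540t²+315t+70) = t⁹`,
  `nine_fifths_le_of_depthIneq_five`; the general identity `Q(X,Y)Xⁿ − Q(Y,X)Yⁿ = (X−Y)^(2n−1)`,
  `Q = Σ_{i<n} C(2n−1,n+i) Xⁱ(−Y)^(n−1−i)`, gives **`C ≥ 2 − 1/n` at every ODD level**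
  (`two_sub_inv_le_of_depthIneq_odd`, section (d‴), kernel-checked) and has no positive specialisation at
  even levels — paper-level, docstring of that section);
* hence **the lever lives at levels `n ≥ 7` only** (`seven_le_of_depthIneq_window`,
  `stubBinomialDepthWindow_shape`; the skeleton's census "vacuous for n ≤ 3" is extended to `n ≤ 6`), and
  the natural strengthening "lever with `C < 2`" is refuted at all levels `≡ 0 mod 4` or `mod 6`;
* LOAD-BEARING for the lever (section (a″)): coprimality is load-bearing exactly at the window
  (`not_stubBinomialDepthWindow_without_coprime`, data `(1, p², 1, p)`); the positivity hypotheses and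
  `0 < d` are decorative (`stubBinomialDepthWindow_iff_noPos`);
* HEURISTIC TRUTH (birthday count, docstring): solutions of `a₁a₂ⁿ ≡ c₁c₂ⁿ (mod q^m)` in boxes
  `max₁ ~ q^(αm)`, `max₂ ~ q^(βm)` exist as soon as `α + β > 1/2`, so the threshold is `C* = 2` at EVERY
  level — matching `ABC ⟹ DepthIneq n (2 + (n+2)ε) C'` from above: a proof of the lever must produce
  `n ≥ 7` and `C ∈ [2, n/3)` (the window `3C < n` is then automatic for `n ≥ 7`, tight at `n = 7`: `C < 7/3`);
* HYPOTHESIS MUTATION for the lead (stub B): the window `3C < n` in `stub_flatBoundOfDepth` can be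
  relaxed to `2C < n` — in step (4) use `wZⁿ ≤ 2·max(uXⁿ, vYⁿ)`, i.e. `ℓ ≤ log 2 + L + n·max(log X, log Y)`
  instead of the sum; then `(n − 2C)/(n − C)·ℓ ≤ …`.  With the floors above the relaxed lever would live
  from level `5` on (`C ≥ 9/5`, `2C < 5`) — PROVED here: `flatBound_of_depthIneq_two`, whence `stub_flatBoundOfDepth_candidate`
  (the registered stub B verbatim; section (d'')).  Stub C (`FlatBound n → PolyABC`) is proved too
  (`stub_polyAbcOfFlatBound_candidate`, section (d⁗)): the lever A is the line's ONLY open input.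

(e) MECHANISM OBSTRUCTION (paper-level, for the lead/planner; kill criterion (i) of the route is met in a
    STRONG form — no β computation needed).  Let `C ⊂ X_n` be a generic Fermat curve (`P₁,…,P_{n−1}`
    fixed with nonzero coordinates, `P_n` on `αXⁿ+βYⁿ+γZⁿ = 0`, a plane curve of degree `n`); these
    curves cover `X_n`, `φ` is a morphism on them, and they avoid every centre of Vojta's resolution
    `ψ : Γ'_n → Γ_n` except over `E` (Vojta2000ABC Lemma 3.9; read p.6 of paper:arxiv-math_9908024).
    Normalise degrees by `deg(φ*O(1)|C) = n²` and call the ratio `v`.  Then `v(ψ*D_Γ) = 3n/n² = 3/n`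
    (only `x_n, y_n, z_n` vary on `C`), hence `v(D'') ≤ 3/n` for every effective `D'' ≤ ψ*D_Γ`, in
    particular for Vojta's reduced `D'_n`; `v(F) = 1` for `F = ψ*φ*O(1)` (`h_F = log c`); `v(L) > 0` for
    every BIG `L` (covering family); `v(E) ≥ 0` for every effective `E` not containing the generic `C`.
    Every proven subspace-theorem output has SCHMIDT SHAPE `m_S(D'',P) ≤ B·h_L(P) + εh` with `B > 0`,
    `L` big (Ru–Vojta General Theorem `B = max_j β(L,D_j)⁻¹`; Autissier; Evertse–Ferretti; Heier–Levin
    arXiv:1712.02456), i.e. `N(D,P) ≥ N(D'',P) ≥ h_{D''} − B h_L − εh`, whose `v`-weight is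
    `≤ 3/n − B·v(L) < 3/n`; converting to `log c ≤ A·log Π` by nonnegative linear combination with
    geometric height inequalities (`h_E ≥ −O(1)`, `E` effective) therefore forces
    `A ≥ n/(3 − n·B·v(L)) > n/3` — OUTSIDE the open window for EVERY value of the β constants, every
    big `L` (in or out of the pencil `⟨D', φ*O(1)⟩`), every model dominating `X_n`.  The boundary
    `A = n/3` is exactly `κ = ∞` in polynomial abc (the trivial statement), and Vojta's conjecture
    crosses it only through `+h_K`: `K_{X_n} + D = O(1,2,…,n)|_{X_n}` has `v = 1` (Lemma 3.9(iv):
    `ψ*φ*O(1) ≤ K + D'`), i.e. through the positivity of `K` on the Fermat fibres (genus ≥ 3 for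
    `n ≥ 4`) — a Mordell-depth input no Schmidt-shape inequality carries.  `bookkeeping_kernel` below is
    the (trivial) real-arithmetic shadow: the virtual near-Fermat configuration satisfies every linear
    a-priori constraint (`N ≤ h_D`, `log c ≤ (n/3)h_D`, `h_D ≤ 9 log c` = Lemma 3.11, Liouville
    `N ≥ (2/n) log c`) AND the Schmidt-shape bound, yet violates the window.  Consequence for the line:
    the β-machine is moot for #2 (it can at best approach `A = n/3⁺`, which would still beat Liouville
    `n/2` — relevant to crux #4 `TowerFourSubLiouville`, `4/3 < A < 2`, not to this crux); only
    K-sensitive or transcendence inputs (card binomial-xi-d-zero-threefold, stub `K1_n`) can enter.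
    barrier-candidate: `SchmidtShapeSaturatesAtTowerWindow` (Literature/Barriers/ABC).

Dead regimes for a would-be refuter (recorded so nobody re-runs them): small levels (`n ≤ 3` cannot even
host a witness, so nothing to refute there); finite searches (an `∃ C` statement is immune to any finite
census: `TowerIneq` restricted to finitely many points holds with any exponent); ε-free / `A = 1` exact
versions at a fixed level `n ≥ 3` would need infinitely many abc triples of quality bounded away from `1`
(canonical lifts: quality `> n/(n−3)`), or uniform-in-the-coefficient Thue families — unknown either way
(and at level `2` the ε-free `A = 1` bound `c ≤ √2·Π` is simply true).
-/

set_option linter.dupNamespace false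

namespace Summit.ABC.ABC.Cruxes.TowerExponentWindow.Disproof

open scoped BigOperators
open Summit.ABC.ABC.Theses.IneffectiveSubspace

/-- The level-`n` tower inequality with exponent `A` and an arbitrary side condition `Q` in the
slot where the crux has coprimality. -/
def TowerIneqQ (n : ℕ) (Q : (Fin n → ℕ) → (Fin n → ℕ) → (Fin n → ℕ) → Prop) (A : ℝ) : Prop :=
  ∀ ε : ℝ, 0 < ε → ∃ C : ℝ, 0 < C ∧ ∀ x y z : Fin n → ℕ, (∀ i, 0 < x i ∧ 0 < y i ∧ 0 < z i) →
    (∏ i, x i ^ (i.val + 1)) + (∏ i, y i ^ (i.val + 1)) = ∏ i, z i ^ (i.val + 1) →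
    Q x y z →
    ((∏ i, z i ^ (i.val + 1) : ℕ) : ℝ) < C * ((∏ i, x i * y i * z i : ℕ) : ℝ) ^ (A + ε)

/-- The coprimality side condition of the crux. -/
def Cop (n : ℕ) : (Fin n → ℕ) → (Fin n → ℕ) → (Fin n → ℕ) → Prop :=
  fun x y _ => Nat.Coprime (∏ i, x i ^ (i.val + 1)) (∏ i, y i ^ (i.val + 1))

/-- `TowerIneq n A`: Vojta's level-`n` tower inequality with exponent `A` (the matrix of the crux). -/
def TowerIneq (n : ℕ) (A : ℝ) : Prop := TowerIneqQ n (Cop n) A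

theorem towerExponentWindow_iff :
    TowerExponentWindow ↔ ∃ n : ℕ, 1 ≤ n ∧ ∃ A : ℝ, 0 < A ∧ 3 * A < n ∧ TowerIneq n A :=
  Iff.rfl

/-- The vector with `m` at index `j` and `1` elsewhere. -/
def ind (n j m : ℕ) : Fin n → ℕ := fun i => if i.val = j then m else 1

theorem ind_pos {n j m : ℕ} (hm : 0 < m) (i : Fin n) : 0 < ind n j m i := by
  unfold ind; split_ifs <;> omega

theorem prod_ind_pow {n j m : ℕ} (hj : j < n) :
    ∏ i : Fin n, (ind n j m i) ^ (i.val + 1) = m ^ (j + 1) := by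
  rw [Finset.prod_eq_single ⟨j, hj⟩]
  · simp [ind]
  · intro b _ hb
    have : b.val ≠ j := fun h => hb (Fin.ext h)
    simp [ind, this]
  · intro h; exact absurd (Finset.mem_univ _) h

theorem prod_ind {n j m : ℕ} (hj : j < n) : ∏ i : Fin n, ind n j m i = m := by
  rw [Finset.prod_eq_single ⟨j, hj⟩]
  · simp [ind]
  · intro b _ hb
    have : b.val ≠ j := fun h => hb (Fin.ext h)
    simp [ind, this]
  · intro h; exact absurd (Finset.mem_univ _) h

/-- GENERIC KILL. A family of level-`n` points `(x m, y m, z m)` satisfying the side condition,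
with `c ^ q ≥ α · Π ^ p` (`α > 0`) and `Π` unbounded, refutes `TowerIneqQ n Q A` for every
`A < p / q`. -/
theorem not_towerIneqQ_of_family {n : ℕ} {Q : (Fin n → ℕ) → (Fin n → ℕ) → (Fin n → ℕ) → Prop}
    (x y z : ℕ → Fin n → ℕ)
    (hpos : ∀ m i, 0 < x m i ∧ 0 < y m i ∧ 0 < z m i)
    (heq : ∀ m, (∏ i, x m i ^ (i.val + 1)) + (∏ i, y m i ^ (i.val + 1)) = ∏ i, z m i ^ (i.val + 1))
    (hQ : ∀ m, Q (x m) (y m) (z m))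
    {p q : ℕ} (hq : 0 < q) {α : ℝ} (hα : 0 < α)
    (hratio : ∀ m, α * ((∏ i, x m i * y m i * z m i : ℕ) : ℝ) ^ p ≤
      ((∏ i, z m i ^ (i.val + 1) : ℕ) : ℝ) ^ q)
    (hunb : ∀ K : ℝ, ∃ m, K ≤ ((∏ i, x m i * y m i * z m i : ℕ) : ℝ))
    {A : ℝ} (hA : A * q < p) : ¬ TowerIneqQ n Q A := by
  intro h
  have hqpos : (0:ℝ) < q := by exact_mod_cast hq
  set ε : ℝ := (p - A * q) / (2 * q) with hε_def
  have hε : 0 < ε := by rw [hε_def]; apply div_pos <;> linarith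
  obtain ⟨C, hC, hall⟩ := h ε hε
  set s : ℝ := A + ε with hs_def
  have hs : s * q < p := by
    have : ε * q = (p - A * q) / 2 := by rw [hε_def]; field_simp
    rw [hs_def]; nlinarith
  set g : ℝ := p - s * q with hg_def
  have hg : 0 < g := by rw [hg_def]; linarith
  obtain ⟨m, hm⟩ := hunb (max 2 ((C ^ q / α) ^ (1 / g) + 1))
  set P : ℝ := ((∏ i, x m i * y m i * z m i : ℕ) : ℝ) with hP_def
  set c : ℝ := ((∏ i, z m i ^ (i.val + 1) : ℕ) : ℝ) with hc_def
  have hP2 : 2 ≤ P := le_trans (le_max_left _ _) hm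
  have hPpos : 0 < P := by linarith
  have hlt : c < C * P ^ s := hall (x m) (y m) (z m) (hpos m) (heq m) (hQ m)
  have hc0 : 0 ≤ c := by rw [hc_def]; exact_mod_cast Nat.zero_le _
  -- raise to the q-th power
  have h1 : c ^ q < C ^ q * P ^ (s * q) := by
    have h1a : c ^ q < (C * P ^ s) ^ q := pow_lt_pow_left₀ hlt hc0 hq.ne'
    rw [mul_pow] at h1a
    have : (P ^ s) ^ q = P ^ (s * q) := by
      rw [← Real.rpow_natCast (P ^ s) q, ← Real.rpow_mul hPpos.le]
    rwa [this] at h1a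
  have h2 : α * P ^ (p:ℝ) < C ^ q * P ^ (s * q) := by
    have := hratio m
    rw [← hP_def, ← hc_def] at this
    rw [Real.rpow_natCast]
    linarith
  have h3 : α * P ^ g < C ^ q := by
    have hsplit : P ^ (p:ℝ) = P ^ g * P ^ (s * q) := by
      rw [← Real.rpow_add hPpos]; congr 1; rw [hg_def]; ring
    rw [hsplit, ← mul_assoc] at h2
    exact lt_of_mul_lt_mul_right h2 (Real.rpow_nonneg hPpos.le _)
  have h4 : C ^ q / α < P ^ g := by
    have hK : 0 ≤ C ^ q / α := div_nonneg (pow_nonneg hC.le _) hα.le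
    have hPgt : (C ^ q / α) ^ (1 / g) < P := by
      have := le_max_right 2 ((C ^ q / α) ^ (1 / g) + 1)
      linarith
    calc C ^ q / α = ((C ^ q / α) ^ (1 / g)) ^ g := by
          rw [← Real.rpow_mul hK, one_div_mul_cancel hg.ne', Real.rpow_one]
      _ < P ^ g := Real.rpow_lt_rpow (Real.rpow_nonneg hK _) hPgt hg
  rw [div_lt_iff₀ hα] at h4
  linarith [h3, h4]


/-! ## Concrete families -/

/-- `∏ (f i * g i)^(i+1) = ∏ f^(i+1) * ∏ g^(i+1)`. -/
theorem prod_mul_pow_succ {n : ℕ} (f g : Fin n → ℕ) :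
    ∏ i : Fin n, (f i * g i) ^ (i.val + 1) =
      (∏ i : Fin n, f i ^ (i.val + 1)) * ∏ i : Fin n, g i ^ (i.val + 1) := by
  rw [← Finset.prod_mul_distrib]; congr 1; ext i; ring

/-- FAMILY H (level `n ≥ 1`, ratio `1/2`): `1 + (m+1) = (m+2)` at the bottom index,
`Π = (m+1)(m+2) ≤ c²`. -/
theorem familyH_spec {n : ℕ} (hn : 1 ≤ n) (m : ℕ) :
    (∏ i : Fin n, (fun _ => (1:ℕ)) i ^ (i.val + 1)) = 1 ∧
    (∏ i : Fin n, ind n 0 (m + 1) i ^ (i.val + 1)) = m + 1 ∧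
    (∏ i : Fin n, ind n 0 (m + 2) i ^ (i.val + 1)) = m + 2 ∧
    (∏ i : Fin n, (fun _ => (1:ℕ)) i * ind n 0 (m + 1) i * ind n 0 (m + 2) i) = (m + 1) * (m + 2) := by
  have h0 : 0 < n := hn
  refine ⟨by simp, by simpa using prod_ind_pow (m := m + 1) h0,
    by simpa using prod_ind_pow (m := m + 2) h0, ?_⟩
  simp only [one_mul, Finset.prod_mul_distrib, prod_ind h0]

/-- **Floor 1/2 at every level.** `TowerIneqQ n Q A` with a side condition implied by
coprimality-of-`(1, m+1)` fails for `A < 1/2`; in particular for the crux's `Cop`. -/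
theorem not_towerIneq_of_lt_half {n : ℕ} (hn : 1 ≤ n) {A : ℝ} (hA : A < 1 / 2) :
    ¬ TowerIneq n A := by
  have h0 : 0 < n := hn
  refine not_towerIneqQ_of_family (fun _ _ => 1) (fun m => ind n 0 (m + 1)) (fun m => ind n 0 (m + 2))
    (fun m i => ⟨Nat.one_pos, ind_pos (by omega) i, ind_pos (by omega) i⟩)
    (fun m => ?_) (fun m => ?_) (p := 1) (q := 2) (by norm_num) (α := 1) one_pos
    (fun m => ?_) (fun K => ?_) (by push_cast; linarith)
  · obtain ⟨h1, h2, h3, -⟩ := familyH_spec hn m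
    rw [h1, h2, h3]; omega
  · obtain ⟨h1, h2, -, -⟩ := familyH_spec hn m
    show Nat.Coprime _ _
    rw [h1, h2]; exact Nat.coprime_one_left _
  · obtain ⟨-, -, h3, h4⟩ := familyH_spec hn m
    rw [h3, h4]; push_cast; simp only [pow_one, one_mul]; nlinarith [sq_nonneg (m : ℝ)]
  · obtain ⟨m, hm⟩ := exists_nat_ge K
    refine ⟨m, ?_⟩
    obtain ⟨-, -, -, h4⟩ := familyH_spec hn m
    rw [h4]; push_cast; nlinarith

/-! ### The Pell family `Y² + 1 = 2 Z²` -/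

/-- `(Y, Z)` running through `(1,1), (7,5), (41,29), …` : `(Y, Z) ↦ (3Y + 4Z, 2Y + 3Z)`. -/
def pell : ℕ → ℕ × ℕ
  | 0 => (1, 1)
  | k + 1 => (3 * (pell k).1 + 4 * (pell k).2, 2 * (pell k).1 + 3 * (pell k).2)

theorem pell_eq (k : ℕ) : (pell k).1 ^ 2 + 1 = 2 * (pell k).2 ^ 2 := by
  induction k with
  | zero => simp [pell]
  | succ k ih => simp only [pell]; nlinarith [ih]

theorem pell_snd_ge (k : ℕ) : k + 1 ≤ (pell k).2 := by
  induction k with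
  | zero => simp [pell]
  | succ k ih => simp only [pell]; omega

theorem pell_fst_pos (k : ℕ) : 0 < (pell k).1 := by
  have h := pell_eq k
  have h2 := pell_snd_ge k
  nlinarith

theorem pell_two_fst_le (k : ℕ) : 2 * (pell k).1 ≤ 3 * (pell k).2 := by
  nlinarith [pell_eq k]

/-- FAMILY P (level `n ≥ 2`, ratio `1`): `1 + Y² = 2 Z²`, `x = 1`, `y = (1, Y, 1, …)`,
`z = (2, Z, 1, …)`; `c = 2Z²`, `Π = 2YZ ≤ 3Z²`. -/
theorem familyP_spec {n : ℕ} (hn : 2 ≤ n) (k : ℕ) :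
    (∏ i : Fin n, (fun _ => (1:ℕ)) i ^ (i.val + 1)) = 1 ∧
    (∏ i : Fin n, ind n 1 (pell k).1 i ^ (i.val + 1)) = (pell k).1 ^ 2 ∧
    (∏ i : Fin n, (ind n 0 2 i * ind n 1 (pell k).2 i) ^ (i.val + 1)) = 2 * (pell k).2 ^ 2 ∧
    (∏ i : Fin n, (fun _ => (1:ℕ)) i * ind n 1 (pell k).1 i * (ind n 0 2 i * ind n 1 (pell k).2 i))
      = (pell k).1 * (2 * (pell k).2) := by
  have h0 : 0 < n := by omega
  have h1 : 1 < n := hn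
  refine ⟨by simp, by simpa using prod_ind_pow (m := (pell k).1) h1, ?_, ?_⟩
  · rw [prod_mul_pow_succ, prod_ind_pow h0, prod_ind_pow h1]; ring
  · simp only [one_mul, Finset.prod_mul_distrib, prod_ind h0, prod_ind h1]

/-- **Floor 1 at every level `n ≥ 2` (Vojta's exponent cannot be improved).**
`TowerIneq n A` fails for `A < 1`: the Pell family has `c = 2Z² ≥ (2/3)·Π`. -/
theorem not_towerIneq_of_lt_one {n : ℕ} (hn : 2 ≤ n) {A : ℝ} (hA : A < 1) :
    ¬ TowerIneq n A := by
  refine not_towerIneqQ_of_family (fun _ _ => 1) (fun k => ind n 1 (pell k).1)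
    (fun k i => ind n 0 2 i * ind n 1 (pell k).2 i)
    (fun k i => ⟨Nat.one_pos, ind_pos (pell_fst_pos k) i,
      Nat.mul_pos (ind_pos (by norm_num) i) (ind_pos (by have := pell_snd_ge k; omega) i)⟩)
    (fun k => ?_) (fun k => ?_) (p := 1) (q := 1) (by norm_num) (α := 2 / 3) (by norm_num)
    (fun k => ?_) (fun K => ?_) (by push_cast; linarith)
  · obtain ⟨h1, h2, h3, -⟩ := familyP_spec hn k
    rw [h1, h2, h3]; have := pell_eq k; omega
  · obtain ⟨h1, h2, -, -⟩ := familyP_spec hn k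
    show Nat.Coprime _ _
    rw [h1, h2]; exact Nat.coprime_one_left _
  · obtain ⟨-, -, h3, h4⟩ := familyP_spec hn k
    rw [h3, h4]
    have h5 : (2 * ((pell k).1 : ℝ)) ≤ 3 * (pell k).2 := by exact_mod_cast pell_two_fst_le k
    have h6 : (0:ℝ) ≤ (pell k).2 := by exact_mod_cast Nat.zero_le _
    push_cast; simp only [pow_one]; nlinarith
  · obtain ⟨k, hk⟩ := exists_nat_ge K
    refine ⟨k, ?_⟩
    obtain ⟨-, -, -, h4⟩ := familyP_spec hn k
    rw [h4]
    have h5 := pell_snd_ge k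
    have h6 := pell_fst_pos k
    have : (k : ℝ) + 1 ≤ (pell k).2 := by exact_mod_cast h5
    have : (1 : ℝ) ≤ (pell k).1 := by exact_mod_cast h6
    push_cast; nlinarith

/-- Consequently any exponent valid at a level `n ≥ 2` is at least Vojta's `1`. -/
theorem one_le_of_towerIneq {n : ℕ} (hn : 2 ≤ n) {A : ℝ} (h : TowerIneq n A) : 1 ≤ A := by
  by_contra hA; exact not_towerIneq_of_lt_one hn (not_le.mp hA) h

theorem half_le_of_towerIneq {n : ℕ} (hn : 1 ≤ n) {A : ℝ} (h : TowerIneq n A) : 1 / 2 ≤ A := by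
  by_contra hA; exact not_towerIneq_of_lt_half hn (not_le.mp hA) h


/-! ## Levels `n ≤ 3` are dead; the `∀ n` strengthening is false -/

/-- Any window witness `(n, A)` has `n ≥ 4` and `A ≥ 1`. -/
theorem four_le_of_window {n : ℕ} (hn : 1 ≤ n) {A : ℝ} (h3 : 3 * A < n) (h : TowerIneq n A) :
    4 ≤ n ∧ 1 ≤ A := by
  rcases Nat.lt_or_ge n 2 with hlt | hge
  · have hn1 : n = 1 := by omega
    subst hn1
    have := half_le_of_towerIneq hn h
    norm_num at h3; linarith
  · have hA := one_le_of_towerIneq hge h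
    refine ⟨?_, hA⟩
    by_contra hlt
    have : (n:ℝ) ≤ 3 := by exact_mod_cast (by omega : n ≤ 3)
    linarith

/-- The crux can only be witnessed from level `4` on, with `A ∈ [1, n/3)`. -/
theorem towerExponentWindow_level_ge_four (h : TowerExponentWindow) :
    ∃ n : ℕ, 4 ≤ n ∧ ∃ A : ℝ, 1 ≤ A ∧ 3 * A < n ∧ TowerIneq n A := by
  obtain ⟨n, hn, A, -, h3, hT⟩ := h
  obtain ⟨h4, hA⟩ := four_le_of_window hn h3 hT
  exact ⟨n, h4, A, hA, h3, hT⟩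

/-- STRENGTHENING REFUTED: the window at a level `n ≤ 3`. -/
theorem not_towerExponentWindow_le_three :
    ¬ ∃ n : ℕ, 1 ≤ n ∧ n ≤ 3 ∧ ∃ A : ℝ, 0 < A ∧ 3 * A < n ∧ TowerIneq n A := by
  rintro ⟨n, hn, hn3, A, -, h3, hT⟩
  have := (four_le_of_window hn h3 hT).1
  omega

/-- STRENGTHENING REFUTED: the window at EVERY level (already level `1` fails). -/
theorem not_forall_level_window :
    ¬ ∀ n : ℕ, 1 ≤ n → ∃ A : ℝ, 0 < A ∧ 3 * A < n ∧ TowerIneq n A := by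
  intro h
  obtain ⟨A, -, h3, hT⟩ := h 1 le_rfl
  have := (four_le_of_window le_rfl h3 hT).1
  omega

/-- Monotonicity in the exponent. -/
theorem towerIneq_mono {n : ℕ} {A A' : ℝ} (hAA' : A ≤ A') (h : TowerIneq n A) : TowerIneq n A' := by
  intro ε hε
  obtain ⟨C, hC, hall⟩ := h (A' - A + ε) (by linarith)
  refine ⟨C, hC, fun x y z hp he hc => ?_⟩
  have h1 := hall x y z hp he hc
  have h2 : A + (A' - A + ε) = A' + ε := by ring
  rwa [h2] at h1

/-! ## Load-bearing hypotheses -/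

/-- `0 < A` is DECORATIVE: it is implied by the rest (floor `1/2`). -/
theorem towerExponentWindow_iff_noApos :
    TowerExponentWindow ↔ ∃ n : ℕ, 1 ≤ n ∧ ∃ A : ℝ, 3 * A < n ∧ TowerIneq n A := by
  constructor
  · rintro ⟨n, hn, A, -, h3, h⟩; exact ⟨n, hn, A, h3, h⟩
  · rintro ⟨n, hn, A, h3, h⟩
    exact ⟨n, hn, A, by linarith [half_le_of_towerIneq hn h], h3, h⟩

/-- `1 ≤ n` is DECORATIVE: it is implied by `0 < A` and `3A < n`. -/
theorem towerExponentWindow_iff_noLevelPos :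
    TowerExponentWindow ↔ ∃ n : ℕ, ∃ A : ℝ, 0 < A ∧ 3 * A < n ∧ TowerIneq n A := by
  constructor
  · rintro ⟨n, -, A, hA, h3, h⟩; exact ⟨n, A, hA, h3, h⟩
  · rintro ⟨n, A, hA, h3, h⟩
    have : (0:ℝ) < n := by linarith
    have hn : 1 ≤ n := Nat.one_le_iff_ne_zero.mpr (by rintro rfl; simp at this)
    exact ⟨n, hn, A, hA, h3, h⟩

/-- `0 < z i` is REDUNDANT: `c = a + b ≥ 1` forces it. -/
theorem towerExponentWindow_iff_xyPos :
    TowerExponentWindow ↔ ∃ n : ℕ, 1 ≤ n ∧ ∃ A : ℝ, 0 < A ∧ 3 * A < n ∧ ∀ ε : ℝ, 0 < ε →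
      ∃ C : ℝ, 0 < C ∧ ∀ x y z : Fin n → ℕ, (∀ i, 0 < x i ∧ 0 < y i) →
      (∏ i, x i ^ (i.val + 1)) + (∏ i, y i ^ (i.val + 1)) = ∏ i, z i ^ (i.val + 1) →
      Nat.Coprime (∏ i, x i ^ (i.val + 1)) (∏ i, y i ^ (i.val + 1)) →
      ((∏ i, z i ^ (i.val + 1) : ℕ) : ℝ) < C * ((∏ i, x i * y i * z i : ℕ) : ℝ) ^ (A + ε) := by
  constructor
  · rintro ⟨n, hn, A, hA, h3, h⟩
    refine ⟨n, hn, A, hA, h3, fun ε hε => ?_⟩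
    obtain ⟨C, hC, hall⟩ := h ε hε
    refine ⟨C, hC, fun x y z hp he hc => hall x y z (fun i => ⟨(hp i).1, (hp i).2, ?_⟩) he hc⟩
    by_contra hz
    have hz0 : z i = 0 := by omega
    have hc0 : (∏ i, z i ^ (i.val + 1)) = 0 := Finset.prod_eq_zero (Finset.mem_univ i) (by simp [hz0])
    have ha : 0 < ∏ i, x i ^ (i.val + 1) := Finset.prod_pos fun i _ => pow_pos (hp i).1 _
    omega
  · rintro ⟨n, hn, A, hA, h3, h⟩
    refine ⟨n, hn, A, hA, h3, fun ε hε => ?_⟩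
    obtain ⟨C, hC, hall⟩ := h ε hε
    exact ⟨C, hC, fun x y z hp he hc => hall x y z (fun i => ⟨(hp i).1, (hp i).2.1⟩) he hc⟩

/-- The crux with COPRIMALITY dropped. -/
def TowerExponentWindowWithoutCoprime : Prop :=
  ∃ n : ℕ, 1 ≤ n ∧ ∃ A : ℝ, 0 < A ∧ 3 * A < n ∧ ∀ ε : ℝ, 0 < ε → ∃ C : ℝ, 0 < C ∧
    ∀ x y z : Fin n → ℕ, (∀ i, 0 < x i ∧ 0 < y i ∧ 0 < z i) →
    (∏ i, x i ^ (i.val + 1)) + (∏ i, y i ^ (i.val + 1)) = ∏ i, z i ^ (i.val + 1) →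
    ((∏ i, z i ^ (i.val + 1) : ℕ) : ℝ) < C * ((∏ i, x i * y i * z i : ℕ) : ℝ) ^ (A + ε)

/-- FAMILY W (level `n ≥ 1`, ratio `n/3`, NOT coprime): `tⁿ + tⁿ = 2tⁿ` at the top index,
`x = y = (1,…,1,t)`, `z = (2,1,…,1,t)` (`n = 1`: `z = (2t)`); `c = 2tⁿ`, `Π = 2t³`. -/
theorem familyW_spec {n : ℕ} (hn : 1 ≤ n) (t : ℕ) :
    (∏ i : Fin n, ind n (n - 1) t i ^ (i.val + 1)) = t ^ n ∧
    (∏ i : Fin n, (ind n (n - 1) t i * ind n 0 2 i) ^ (i.val + 1)) = t ^ n * 2 ∧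
    (∏ i : Fin n, ind n (n - 1) t i * ind n (n - 1) t i * (ind n (n - 1) t i * ind n 0 2 i))
      = t * t * (t * 2) := by
  have h0 : 0 < n := hn
  have hl : n - 1 < n := by omega
  have e : n - 1 + 1 = n := by omega
  refine ⟨by rw [prod_ind_pow hl, e], ?_, ?_⟩
  · rw [prod_mul_pow_succ, prod_ind_pow hl, prod_ind_pow h0, e]; ring
  · simp only [Finset.prod_mul_distrib, prod_ind h0, prod_ind hl]

/-- **Coprimality is load-bearing: without it the crux is FALSE at every level**
(family W: `c = 2tⁿ = 8^{1/3}·2^{-n/3}·Π^{n/3}`, so every `A < n/3` fails). -/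
theorem not_towerExponentWindow_without_coprime : ¬ TowerExponentWindowWithoutCoprime := by
  rintro ⟨n, hn, A, -, h3, h⟩
  have h' : TowerIneqQ n (fun _ _ _ => True) A := fun ε hε => by
    obtain ⟨C, hC, hall⟩ := h ε hε
    exact ⟨C, hC, fun x y z hp he _ => hall x y z hp he⟩
  revert h'
  refine not_towerIneqQ_of_family (fun m => ind n (n - 1) (m + 2)) (fun m => ind n (n - 1) (m + 2))
    (fun m i => ind n (n - 1) (m + 2) i * ind n 0 2 i)
    (fun m i => ⟨ind_pos (by omega) i, ind_pos (by omega) i,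
      Nat.mul_pos (ind_pos (by omega) i) (ind_pos (by norm_num) i)⟩)
    (fun m => ?_) (fun m => trivial) (p := n) (q := 3) (by norm_num) (α := 8 / 2 ^ n) (by positivity)
    (fun m => ?_) (fun K => ?_) (by push_cast; linarith)
  · obtain ⟨h1, h2, -⟩ := familyW_spec hn (m + 2)
    rw [h1, h2]; ring
  · obtain ⟨-, h2, h4⟩ := familyW_spec hn (m + 2)
    rw [h2, h4]; push_cast
    have e : ((m:ℝ) + 2) * ((m:ℝ) + 2) * (((m:ℝ) + 2) * 2) = 2 * ((m:ℝ) + 2) ^ 3 := by ring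
    rw [e, mul_pow, ← pow_mul]
    apply le_of_eq; field_simp; ring
  · obtain ⟨m, hm⟩ := exists_nat_ge K
    refine ⟨m, ?_⟩
    obtain ⟨-, -, h4⟩ := familyW_spec hn (m + 2)
    rw [h4]; push_cast; nlinarith [sq_nonneg ((m:ℝ) + 2)]

/-- The crux with POSITIVITY dropped. -/
def TowerExponentWindowWithoutPos : Prop :=
  ∃ n : ℕ, 1 ≤ n ∧ ∃ A : ℝ, 0 < A ∧ 3 * A < n ∧ ∀ ε : ℝ, 0 < ε → ∃ C : ℝ, 0 < C ∧
    ∀ x y z : Fin n → ℕ,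
    (∏ i, x i ^ (i.val + 1)) + (∏ i, y i ^ (i.val + 1)) = ∏ i, z i ^ (i.val + 1) →
    Nat.Coprime (∏ i, x i ^ (i.val + 1)) (∏ i, y i ^ (i.val + 1)) →
    ((∏ i, z i ^ (i.val + 1) : ℕ) : ℝ) < C * ((∏ i, x i * y i * z i : ℕ) : ℝ) ^ (A + ε)

/-- **Positivity (of `x`, `y`) is load-bearing only through the junk triple `(0, 1, 1)`:**
`x = 0`, `y = z = 1` gives `0 + 1 = 1`, `gcd(0,1) = 1`, `Π = 0`, and `1 < C · 0^{A+ε} = 0` fails. -/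
theorem not_towerExponentWindow_without_pos : ¬ TowerExponentWindowWithoutPos := by
  rintro ⟨n, hn, A, hA, -, h⟩
  obtain ⟨C, -, hall⟩ := h 1 one_pos
  have h0 : (⟨0, hn⟩ : Fin n) ∈ Finset.univ := Finset.mem_univ _
  have hx : (∏ i : Fin n, (fun _ => (0:ℕ)) i ^ (i.val + 1)) = 0 := Finset.prod_eq_zero h0 (by simp)
  have hy : (∏ i : Fin n, (fun _ => (1:ℕ)) i ^ (i.val + 1)) = 1 := by simp
  have hP : (∏ i : Fin n, (fun _ => (0:ℕ)) i * (fun _ => (1:ℕ)) i * (fun _ => (1:ℕ)) i) = 0 :=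
    Finset.prod_eq_zero h0 (by simp)
  have h1 := hall (fun _ => 0) (fun _ => 1) (fun _ => 1) (by rw [hx, hy])
    (by rw [hx, hy]; exact Nat.coprime_one_right 0)
  rw [hy, hP, Nat.cast_zero, Real.zero_rpow (by linarith), mul_zero] at h1
  norm_num at h1

/-- The crux with the WINDOW `3A < n` dropped. -/
def TowerExponentWindowWithoutWindow : Prop :=
  ∃ n : ℕ, 1 ≤ n ∧ ∃ A : ℝ, 0 < A ∧ ∀ ε : ℝ, 0 < ε → ∃ C : ℝ, 0 < C ∧
    ∀ x y z : Fin n → ℕ, (∀ i, 0 < x i ∧ 0 < y i ∧ 0 < z i) →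
    (∏ i, x i ^ (i.val + 1)) + (∏ i, y i ^ (i.val + 1)) = ∏ i, z i ^ (i.val + 1) →
    Nat.Coprime (∏ i, x i ^ (i.val + 1)) (∏ i, y i ^ (i.val + 1)) →
    ((∏ i, z i ^ (i.val + 1) : ℕ) : ℝ) < C * ((∏ i, x i * y i * z i : ℕ) : ℝ) ^ (A + ε)

/-- **The window carries ALL the content:** without `3A < n` the statement is trivially TRUE
(`n = 1`, `A = 1`, `C = 2`: `c = z₀ ≤ x₀y₀z₀ = Π ≤ Π^{1+ε}`). -/
theorem towerExponentWindow_without_window : TowerExponentWindowWithoutWindow := by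
  refine ⟨1, le_rfl, 1, one_pos, fun ε hε => ⟨2, two_pos, fun x y z hpos _ _ => ?_⟩⟩
  simp only [Fin.prod_univ_one, Fin.val_zero, zero_add, pow_one]
  obtain ⟨hx0, hy0, hz0⟩ := hpos 0
  have hP1 : (1:ℝ) ≤ ((x 0 * y 0 * z 0 : ℕ) : ℝ) := by
    exact_mod_cast Nat.mul_pos (Nat.mul_pos hx0 hy0) hz0
  have hzle : ((z 0 : ℕ) : ℝ) ≤ ((x 0 * y 0 * z 0 : ℕ) : ℝ) := by
    exact_mod_cast Nat.le_mul_of_pos_left (z 0) (Nat.mul_pos hx0 hy0)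
  have hpow : ((x 0 * y 0 * z 0 : ℕ) : ℝ) ≤ ((x 0 * y 0 * z 0 : ℕ) : ℝ) ^ (1 + ε) := by
    conv_lhs => rw [← Real.rpow_one ((x 0 * y 0 * z 0 : ℕ) : ℝ)]
    exact Real.rpow_le_rpow_of_exponent_le hP1 (by linarith)
  have hpos' : 0 < ((x 0 * y 0 * z 0 : ℕ) : ℝ) ^ (1 + ε) := Real.rpow_pos_of_pos (by linarith) _
  push_cast at *
  linarith

/-! ## Why it resists: the crux is implied by polynomial abc, hence by `ABC` -/

open Literature.NumberTheory.DiophantineGeometry in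
/-- `rad(abc) ≤ Π xᵢyᵢzᵢ` for a level-`n` point (`abc ∣ Πⁿ`). -/
theorem rad_le_tower {n : ℕ} (x y z : Fin n → ℕ)
    (hpos : ∀ i, 0 < x i ∧ 0 < y i ∧ 0 < z i) :
    rad (∏ i, x i ^ (i.val + 1)) (∏ i, y i ^ (i.val + 1)) (∏ i, z i ^ (i.val + 1))
      ≤ ∏ i, x i * y i * z i := by
  unfold rad
  have hP : (∏ i, x i * y i * z i) ≠ 0 := Finset.prod_ne_zero_iff.mpr fun i _ =>
    (Nat.mul_pos (Nat.mul_pos (hpos i).1 (hpos i).2.1) (hpos i).2.2).ne'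
  refine radical_le_of_dvd_pow (n := n) hP ?_
  rw [← prod_mul_pow_succ, ← prod_mul_pow_succ, ← Finset.prod_pow]
  exact Finset.prod_dvd_prod_of_dvd _ _ fun i _ => pow_dvd_pow _ (by omega)

open Literature.NumberTheory.DiophantineGeometry in
/-- **Polynomial abc ⟹ the crux** (so the crux is EQUIVALENT to polynomial abc, the converse being
route item `WindowGivesPolynomialAbc`): given `c < C·rad(abc)^κ`, take `A = |κ| + 1` and any level
`n > 3A`; `rad ≤ Π` does the rest. -/
theorem towerExponentWindow_of_polyAbc
    (h : ∃ κ C : ℝ, 0 < C ∧ ∀ a b c : ℕ, IsABCTriple a b c → (c : ℝ) < C * ((rad a b c : ℕ) : ℝ) ^ κ) :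
    TowerExponentWindow := by
  obtain ⟨κ, C, hC, habc⟩ := h
  obtain ⟨n, hn⟩ := exists_nat_gt (3 * (|κ| + 1))
  have hnpos : (0:ℝ) < n := by linarith [abs_nonneg κ]
  have hn1 : 1 ≤ n := Nat.one_le_iff_ne_zero.mpr (by rintro rfl; simp at hnpos)
  refine ⟨n, hn1, |κ| + 1, by positivity, hn, fun ε hε => ⟨C, hC, fun x y z hpos heq hcop => ?_⟩⟩
  have ha : 0 < ∏ i, x i ^ (i.val + 1) := Finset.prod_pos fun i _ => pow_pos (hpos i).1 _
  have hb : 0 < ∏ i, y i ^ (i.val + 1) := Finset.prod_pos fun i _ => pow_pos (hpos i).2.1 _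
  have h1 := habc _ _ _ ⟨ha, hb, heq, hcop⟩
  have hrad1 : (1:ℝ) ≤ ((rad (∏ i, x i ^ (i.val + 1)) (∏ i, y i ^ (i.val + 1))
      (∏ i, z i ^ (i.val + 1)) : ℕ) : ℝ) := by
    exact_mod_cast Nat.radical_pos _
  have hradle := rad_le_tower x y z hpos
  have hradle' : ((rad (∏ i, x i ^ (i.val + 1)) (∏ i, y i ^ (i.val + 1))
      (∏ i, z i ^ (i.val + 1)) : ℕ) : ℝ) ≤ ((∏ i, x i * y i * z i : ℕ) : ℝ) := by exact_mod_cast hradle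
  calc _ < _ := h1
    _ ≤ C * ((rad (∏ i, x i ^ (i.val + 1)) (∏ i, y i ^ (i.val + 1))
      (∏ i, z i ^ (i.val + 1)) : ℕ) : ℝ) ^ (|κ| + 1 + ε) := by
        refine mul_le_mul_of_nonneg_left ?_ hC.le
        exact Real.rpow_le_rpow_of_exponent_le hrad1 (by linarith [le_abs_self κ])
    _ ≤ C * ((∏ i, x i * y i * z i : ℕ) : ℝ) ^ (|κ| + 1 + ε) := by
        refine mul_le_mul_of_nonneg_left ?_ hC.le
        exact Real.rpow_le_rpow (by positivity) hradle' (by linarith [abs_nonneg κ])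

/-- **`ABC` ⟹ the crux.** Hence `¬ TowerExponentWindow → ¬ ABC`: a kill of this crux would be a
disproof of the abc conjecture. -/
theorem abc_imp_towerExponentWindow (h : ABC) : TowerExponentWindow := by
  obtain ⟨C, hC, hall⟩ := h 1 one_pos
  exact towerExponentWindow_of_polyAbc ⟨1 + 1, C, hC, hall⟩

theorem not_abc_of_not_towerExponentWindow (h : ¬ TowerExponentWindow) : ¬ ABC :=
  fun habc => h (abc_imp_towerExponentWindow habc)


/-! ## (e) Mechanism obstruction — bookkeeping kernel -/

/-- **Bookkeeping kernel of the Fermat-fibre obstruction** (dictionary in the module docstring).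
Virtual heights along the generic Fermat curve, in units `H = h(P_n)`: `hD = 3H` (`h_D`), `ℓ = nH`
(`log c`), `hL = v·n·H` (`h_L`, `v = v(L) > 0` since `L` is big), and `N` = the best lower bound a
Schmidt-shape output `N ≥ h_D − B·h_L` (`B > 0`) plus Liouville can certify.  All linear a-priori
constraints hold, the machine bound holds, and still `N < (3/n)·ℓ`: no exponent `A < n/3` follows
(`ℓ ≤ A·N` would need `N ≥ ℓ/A > (3/n)ℓ`).  Trivial as real arithmetic — the content is the dictionary. -/
theorem bookkeeping_kernel (n : ℕ) (hn : 1 ≤ n) {B v H : ℝ} (hB : 0 < B) (hv : 0 < v) (hH : 0 < H) :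
    ∃ hD ℓ hL N : ℝ,
      hD = 3 * H ∧ ℓ = n * H ∧ hL = v * n * H ∧
      -- a-priori linear constraints valid on tower points
      0 ≤ N ∧ N ≤ hD ∧ ℓ ≤ n / 3 * hD ∧ hD ≤ 9 * ℓ ∧ 2 / n * ℓ ≤ N ∧
      -- the Schmidt-shape machine output
      hD - B * hL ≤ N ∧
      -- … and yet the window is violated for every A < n/3:
      N < 3 / n * ℓ ∧ ∀ A : ℝ, 0 < A → 3 * A < n → A * N < ℓ := by
  have hn' : (1:ℝ) ≤ n := by exact_mod_cast hn
  have hnpos : (0:ℝ) < n := by linarith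
  refine ⟨3 * H, n * H, v * n * H, max (3 - B * v * n) 2 * H, rfl, rfl, rfl, ?_, ?_, ?_, ?_, ?_, ?_, ?_, ?_⟩
  · positivity
  · have : max (3 - B * v * n) 2 ≤ 3 := max_le (by nlinarith [mul_pos (mul_pos hB hv) hnpos]) (by norm_num)
    nlinarith
  · field_simp; nlinarith
  · nlinarith
  · rw [div_mul_eq_mul_div, div_le_iff₀ hnpos]
    have h2 : (2:ℝ) ≤ max (3 - B * v * n) 2 := le_max_right _ _
    have hHn : (0:ℝ) ≤ H * n := by positivity
    calc 2 * (n * H) = 2 * (H * n) := by ring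
      _ ≤ max (3 - B * v * n) 2 * (H * n) := mul_le_mul_of_nonneg_right h2 hHn
      _ = _ := by ring
  · nlinarith [le_max_left (3 - B * v * n) 2]
  · rw [div_mul_eq_mul_div, lt_div_iff₀ hnpos]
    have h3 : max (3 - B * v * n) 2 < 3 :=
      max_lt (by nlinarith [mul_pos (mul_pos hB hv) hnpos]) (by norm_num)
    have hHn : (0:ℝ) < H * n := by positivity
    calc max (3 - B * v * n) 2 * H * n = max (3 - B * v * n) 2 * (H * n) := by ring
      _ < 3 * (H * n) := mul_lt_mul_of_pos_right h3 hHn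
      _ = _ := by ring
  · intro A hA h3
    have : max (3 - B * v * n) 2 ≤ 3 := max_le (by nlinarith [mul_pos (mul_pos hB hv) hnpos]) (by norm_num)
    have hmax0 : 0 < max (3 - B * v * n) 2 := lt_max_of_lt_right (by norm_num)
    nlinarith [mul_pos hA hH]

end Summit.ABC.ABC.Cruxes.TowerExponentWindow.Disproof

/-! ## (c') The converse: canonical lift and `crux ⟹ polynomial abc` (items 1654, 1653) -/

namespace Summit.ABC.ABC.Cruxes.TowerExponentWindow.Disproof

open scoped BigOperators
open Summit.ABC.ABC.Theses.IneffectiveSubspace Finset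

/-- Shifted `Fin n`-product against a `range n`-product when the two boundary terms are `1`. -/
theorem prod_fin_succ_eq_prod_range {n : ℕ} (T : ℕ → ℕ) (h0 : T 0 = 1) (hn : T n = 1) :
    ∏ i : Fin n, T (i.val + 1) = ∏ k ∈ Finset.range n, T k := by
  have e1 : ∏ i : Fin n, T (i.val + 1) = ∏ k ∈ Finset.range n, T (k + 1) :=
    Fin.prod_univ_eq_prod_range (fun k => T (k + 1)) n
  have e2 := Finset.prod_range_succ' T n   -- ∏ range (n+1) T = (∏ range n, T (k+1)) * T 0
  have e3 := Finset.prod_range_succ T n    -- ∏ range (n+1) T = (∏ range n, T k) * T n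
  rw [h0, mul_one] at e2
  rw [hn, mul_one] at e3
  rw [e1, ← e2, e3]

/-- Fiberwise regrouping of the residue classes `v p mod n = k`, `k = 1, …, n`
(the class `k = n` is empty, the class `0` contributes `1`). -/
theorem prod_fin_filter_mod {n : ℕ} (hn : 1 ≤ n) (s : Finset ℕ) (v : ℕ → ℕ) (g : ℕ → ℕ → ℕ)
    (hg0 : ∀ p ∈ s, v p % n = 0 → g p (v p % n) = 1) :
    ∏ i : Fin n, ∏ p ∈ s.filter (fun p => v p % n = i.val + 1), g p (v p % n) =
      ∏ p ∈ s, g p (v p % n) := by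
  classical
  have hT0 : (∏ p ∈ s.filter (fun p => v p % n = 0), g p (v p % n)) = 1 := by
    refine Finset.prod_eq_one fun p hp => ?_
    rw [Finset.mem_filter] at hp
    exact hg0 p hp.1 hp.2
  have hTn : (∏ p ∈ s.filter (fun p => v p % n = n), g p (v p % n)) = 1 := by
    have : s.filter (fun p => v p % n = n) = ∅ := by
      refine Finset.filter_eq_empty_iff.mpr fun p _ h => ?_
      have := Nat.mod_lt (v p) (by omega : 0 < n); omega
    rw [this, Finset.prod_empty]
  have h1 := prod_fin_succ_eq_prod_range
    (fun k => ∏ p ∈ s.filter (fun p => v p % n = k), g p (v p % n)) hT0 hTn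
  refine h1.trans ?_
  exact Finset.prod_fiberwise_of_maps_to (g := fun p => v p % n) (f := fun p => g p (v p % n))
    fun p _ => Finset.mem_range.mpr (Nat.mod_lt _ (by omega))

/-- `∏ p ∈ a.primeFactors, p ^ v_p(a) = a`. -/
theorem prod_primeFactors_pow_factorization {a : ℕ} (ha : a ≠ 0) :
    ∏ p ∈ a.primeFactors, p ^ a.factorization p = a := by
  conv_rhs => rw [← Nat.prod_factorization_pow_eq_self ha, Nat.prod_factorization_eq_prod_primeFactors]

/-- **Vojta's canonical lift** = candidate proof of support item `CanonicalTowerLift` (stmt-ABC-1654,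
attached as evidence there; a prover lands it) (Vojta2000ABC §3.1): for `n ≥ 1` and `a ≥ 1` put
`q = Π_p p^⌊v_p(a)/n⌋` at the top exponent `n` and `r_k = Π_{v_p(a) ≡ k (mod n)} p` at exponent `k`
(`1 ≤ k < n`); then `Π xᵢ^(i+1) = a` and `(Π xᵢ)ⁿ = qⁿ (Π r_k)ⁿ ≤ a · rad(a)ⁿ`. -/
theorem canonicalTowerLift : CanonicalTowerLift := by
  intro n hn a ha
  classical
  set PF := a.primeFactors with hPF
  set q : ℕ := ∏ p ∈ PF, p ^ (a.factorization p / n) with hq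
  have ha0 : a ≠ 0 := by omega
  have hprime : ∀ p ∈ PF, p.Prime := fun p hp => Nat.prime_of_mem_primeFactors hp
  have hqpos : 0 < q := Finset.prod_pos fun p hp => pow_pos (hprime p hp).pos _
  have hrpos : ∀ k, 0 < ∏ p ∈ PF.filter (fun p => a.factorization p % n = k), p := fun k =>
    Finset.prod_pos fun p hp => (hprime p (Finset.mem_filter.mp hp).1).pos
  let jt : Fin n := ⟨n - 1, by omega⟩
  refine ⟨fun i => (Pi.mulSingle jt q : Fin n → ℕ) i *
      ∏ p ∈ PF.filter (fun p => a.factorization p % n = i.val + 1), p, fun i => ?_, ?_, ?_⟩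
  · -- positivity
    refine Nat.mul_pos ?_ (hrpos _)
    rcases eq_or_ne i jt with rfl | h
    · simp [hqpos]
    · simp [Pi.mulSingle_eq_of_ne h]
  · -- the product is `a`
    have hsplit : (∏ i : Fin n, ((Pi.mulSingle jt q : Fin n → ℕ) i *
        ∏ p ∈ PF.filter (fun p => a.factorization p % n = i.val + 1), p) ^ (i.val + 1)) =
        (∏ i : Fin n, ((Pi.mulSingle jt q : Fin n → ℕ) i) ^ (i.val + 1)) *
          ∏ i : Fin n, (∏ p ∈ PF.filter (fun p => a.factorization p % n = i.val + 1), p) ^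
            (i.val + 1) := by
      rw [← Finset.prod_mul_distrib]; congr 1; ext i; ring
    have hspike : (∏ i : Fin n, ((Pi.mulSingle jt q : Fin n → ℕ) i) ^ (i.val + 1)) = q ^ n := by
      rw [Finset.prod_eq_single jt]
      · simp [jt, Nat.sub_add_cancel hn]
      · intro b _ hb; simp [Pi.mulSingle_eq_of_ne hb]
      · intro h; exact absurd (Finset.mem_univ _) h
    have hres : (∏ i : Fin n, (∏ p ∈ PF.filter (fun p => a.factorization p % n = i.val + 1), p) ^
        (i.val + 1)) = ∏ p ∈ PF, p ^ (a.factorization p % n) := by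
      have step : ∀ i : Fin n,
          (∏ p ∈ PF.filter (fun p => a.factorization p % n = i.val + 1), p) ^ (i.val + 1) =
          ∏ p ∈ PF.filter (fun p => a.factorization p % n = i.val + 1),
            p ^ (a.factorization p % n) := by
        intro i
        rw [← Finset.prod_pow]
        refine Finset.prod_congr rfl fun p hp => ?_
        rw [(Finset.mem_filter.mp hp).2]
      rw [Finset.prod_congr rfl fun i _ => step i]
      exact prod_fin_filter_mod hn PF (fun p => a.factorization p) (fun p e => p ^ e)
        fun p _ h0 => by rw [h0, pow_zero]
    rw [hsplit, hspike, hres, hq, ← Finset.prod_pow, ← Finset.prod_mul_distrib]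
    have : ∀ p ∈ PF, (p ^ (a.factorization p / n)) ^ n * p ^ (a.factorization p % n) =
        p ^ (a.factorization p) := fun p _ => by
      rw [← pow_mul, ← pow_add]; congr 1; rw [mul_comm]; exact Nat.div_add_mod _ n
    rw [Finset.prod_congr rfl this, hPF]
    exact prod_primeFactors_pow_factorization ha0
  · -- the bound (Π xᵢ)ⁿ ≤ rad(a)ⁿ · a
    have hprodx : (∏ i : Fin n, ((Pi.mulSingle jt q : Fin n → ℕ) i *
        ∏ p ∈ PF.filter (fun p => a.factorization p % n = i.val + 1), p)) =
        q * ∏ i : Fin n, ∏ p ∈ PF.filter (fun p => a.factorization p % n = i.val + 1), p := by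
      rw [Finset.prod_mul_distrib, Fintype.prod_pi_mulSingle']
    have hR' : (∏ i : Fin n, ∏ p ∈ PF.filter (fun p => a.factorization p % n = i.val + 1), p) =
        ∏ p ∈ PF.filter (fun p => a.factorization p % n ≠ 0), p := by
      have key := prod_fin_filter_mod hn PF (fun p => a.factorization p)
        (fun p e => if e = 0 then 1 else p) fun p _ h0 => by rw [h0]; rfl
      have step : ∀ i : Fin n,
          (∏ p ∈ PF.filter (fun p => a.factorization p % n = i.val + 1), p) =
          ∏ p ∈ PF.filter (fun p => a.factorization p % n = i.val + 1),
            (if a.factorization p % n = 0 then 1 else p) := by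
        intro i
        refine Finset.prod_congr rfl fun p hp => ?_
        rw [(Finset.mem_filter.mp hp).2]; simp
      rw [Finset.prod_congr rfl fun i _ => step i, key, Finset.prod_filter]
      refine Finset.prod_congr rfl fun p _ => ?_
      by_cases h : a.factorization p % n = 0 <;> simp [h]
    have hR : (∏ i : Fin n, ∏ p ∈ PF.filter (fun p => a.factorization p % n = i.val + 1), p) ∣
        UniqueFactorizationMonoid.radical a := by
      rw [hR', Nat.radical_eq_prod_primeFactors]
      exact Finset.prod_dvd_prod_of_subset _ _ _ (Finset.filter_subset _ _)
    have hRle := Nat.le_of_dvd (Nat.radical_pos a) hR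
    have hqn : q ^ n ≤ a := by
      rw [hq, ← Finset.prod_pow]
      calc ∏ p ∈ PF, (p ^ (a.factorization p / n)) ^ n ≤ ∏ p ∈ PF, p ^ (a.factorization p) := by
            refine Finset.prod_le_prod' fun p hp => ?_
            rw [← pow_mul]
            exact Nat.pow_le_pow_right (hprime p hp).pos (Nat.div_mul_le_self _ _)
        _ = a := by rw [hPF]; exact prod_primeFactors_pow_factorization ha0
    rw [hprodx, mul_pow, mul_comm]
    exact Nat.mul_le_mul (Nat.pow_le_pow_left hRle n) hqn

end Summit.ABC.ABC.Cruxes.TowerExponentWindow.Disproof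

namespace Summit.ABC.ABC.Cruxes.TowerExponentWindow.Disproof

open scoped BigOperators
open Summit.ABC.ABC.Theses.IneffectiveSubspace Finset
open Literature.NumberTheory.DiophantineGeometry

/-- `rad(a)·rad(b)·rad(c) = rad(abc)` for an abc triple (pairwise coprimality). -/
theorem radical_mul_three_of_triple {a b c : ℕ} (h : IsABCTriple a b c) :
    UniqueFactorizationMonoid.radical a * UniqueFactorizationMonoid.radical b *
      UniqueFactorizationMonoid.radical c = rad a b c := by
  obtain ⟨-, -, hsum, hcop⟩ := h
  have hac : Nat.Coprime a c := by rw [← hsum]; exact Nat.coprime_self_add_right.mpr hcop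
  have hbc : Nat.Coprime b c := by rw [← hsum]; exact Nat.coprime_add_self_right.mpr hcop.symm
  unfold rad
  rw [UniqueFactorizationMonoid.radical_mul (Nat.coprime_iff_isRelPrime.mp (Nat.Coprime.mul_left hac hbc)),
    UniqueFactorizationMonoid.radical_mul (Nat.coprime_iff_isRelPrime.mp hcop)]

/-- **Candidate proof of support item `WindowGivesPolynomialAbc` (stmt-ABC-1653)** (attached as
evidence on that item; a prover lands it): a window witness
`(n, A)` gives polynomial abc with `κ = n(A+ε)/(n − 3(A+ε))` (`ε = (n/3 − A)/2`), via the canonical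
lift `Π xᵢyᵢzᵢ ≤ rad(abc)·c^(3/n)`. -/
theorem windowGivesPolynomialAbc : WindowGivesPolynomialAbc := by
  rintro ⟨n, hn, A, hA, h3, hT⟩
  have hnpos : (0:ℝ) < n := by exact_mod_cast (show 0 < n by omega)
  set ε : ℝ := ((n:ℝ) / 3 - A) / 2 with hε
  have hεpos : 0 < ε := by rw [hε]; linarith
  set s : ℝ := A + ε with hs
  have hspos : 0 < s := by rw [hs]; linarith
  have hs3 : 3 * s < n := by rw [hs, hε]; linarith
  set θ : ℝ := 3 * s / n with hθ
  have hθpos : 0 < θ := by rw [hθ]; positivity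
  have hθ1 : θ < 1 := by rw [hθ, div_lt_one hnpos]; exact hs3
  obtain ⟨C, hC, hall⟩ := hT ε hεpos
  refine ⟨s / (1 - θ), C ^ (1 / (1 - θ)), Real.rpow_pos_of_pos hC _, fun a b c htr => ?_⟩
  obtain ⟨ha, hb, hsum, hcop⟩ := htr
  have hc : 0 < c := by omega
  obtain ⟨x, hxpos, hxa, hxle⟩ := canonicalTowerLift n hn a ha
  obtain ⟨y, hypos, hyb, hyle⟩ := canonicalTowerLift n hn b hb
  obtain ⟨z, hzpos, hzc, hzle⟩ := canonicalTowerLift n hn c hc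
  have hmain := hall x y z (fun i => ⟨hxpos i, hypos i, hzpos i⟩) (by rw [hxa, hyb, hzc, hsum])
    (by rw [hxa, hyb]; exact hcop)
  rw [hzc] at hmain
  -- Π = X·Y·Z and (XYZ)^n ≤ R^n · c^3
  set X := ∏ i, x i
  set Y := ∏ i, y i
  set Z := ∏ i, z i
  set R := rad a b c with hR
  have hP : (∏ i, x i * y i * z i) = X * Y * Z := by
    simp only [X, Y, Z, Finset.prod_mul_distrib]
  rw [hP] at hmain
  have hRpos : 0 < R := Nat.radical_pos _
  have hbound : (X * Y * Z) ^ n ≤ R ^ n * c ^ 3 := by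
    have h1 : (X * Y * Z) ^ n ≤ (UniqueFactorizationMonoid.radical a ^ n * a) *
        (UniqueFactorizationMonoid.radical b ^ n * b) * (UniqueFactorizationMonoid.radical c ^ n * c) := by
      rw [mul_pow, mul_pow]
      exact Nat.mul_le_mul (Nat.mul_le_mul hxle hyle) hzle
    have h2 : (UniqueFactorizationMonoid.radical a ^ n * a) *
        (UniqueFactorizationMonoid.radical b ^ n * b) * (UniqueFactorizationMonoid.radical c ^ n * c)
        = R ^ n * (a * b * c) := by
      rw [hR, ← radical_mul_three_of_triple ⟨ha, hb, hsum, hcop⟩]; ring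
    have h3' : a * b * c ≤ c ^ 3 := by
      have : a ≤ c := by omega
      have : b ≤ c := by omega
      calc a * b * c ≤ c * c * c := Nat.mul_le_mul (Nat.mul_le_mul ‹a ≤ c› ‹b ≤ c›) le_rfl
        _ = c ^ 3 := by ring
    calc (X * Y * Z) ^ n ≤ _ := h1
      _ = R ^ n * (a * b * c) := h2
      _ ≤ R ^ n * c ^ 3 := Nat.mul_le_mul_left _ h3'
  -- pass to ℝ: Π ≤ R · c^(3/n)
  have hXYZpos : 0 < X * Y * Z := Nat.mul_pos (Nat.mul_pos (Finset.prod_pos fun i _ => hxpos i)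
    (Finset.prod_pos fun i _ => hypos i)) (Finset.prod_pos fun i _ => hzpos i)
  have hPreal : ((X * Y * Z : ℕ) : ℝ) ≤ (R : ℝ) * (c : ℝ) ^ ((3:ℝ) / n) := by
    have hb' : (((X * Y * Z : ℕ) : ℝ)) ^ (n:ℝ) ≤ ((R : ℝ) * (c:ℝ) ^ ((3:ℝ) / n)) ^ (n:ℝ) := by
      rw [Real.rpow_natCast, Real.mul_rpow (by positivity) (by positivity), Real.rpow_natCast,
        ← Real.rpow_mul (by positivity), div_mul_cancel₀ _ hnpos.ne']
      have : ((c:ℝ)) ^ (3:ℝ) = ((c ^ 3 : ℕ) : ℝ) := by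
        rw [show (3:ℝ) = ((3:ℕ):ℝ) by norm_num, Real.rpow_natCast]; push_cast; ring
      rw [this]
      exact_mod_cast hbound
    have hn0 : (0:ℝ) < n := hnpos
    exact le_of_pow_le_pow_left₀ (show n ≠ 0 by omega)
      (by positivity) (by
        have := hb'
        rwa [Real.rpow_natCast, Real.rpow_natCast] at this)
  -- c < C Π^s ≤ C R^s c^θ
  have hcpos : (0:ℝ) < c := by exact_mod_cast hc
  have hstep : (c:ℝ) < C * (R:ℝ) ^ s * (c:ℝ) ^ θ := by
    calc (c:ℝ) < C * ((X * Y * Z : ℕ) : ℝ) ^ s := by exact_mod_cast hmain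
      _ ≤ C * ((R:ℝ) * (c:ℝ) ^ ((3:ℝ) / n)) ^ s := by
          refine mul_le_mul_of_nonneg_left ?_ hC.le
          exact Real.rpow_le_rpow (by positivity) hPreal hspos.le
      _ = C * (R:ℝ) ^ s * (c:ℝ) ^ θ := by
          rw [Real.mul_rpow (by positivity) (by positivity), ← Real.rpow_mul hcpos.le, hθ]
          ring_nf
  -- divide by c^θ: c^(1-θ) < C R^s
  have hcθ : 0 < (c:ℝ) ^ θ := Real.rpow_pos_of_pos hcpos _
  have hstep2 : (c:ℝ) ^ (1 - θ) < C * (R:ℝ) ^ s := by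
    rw [Real.rpow_sub hcpos, Real.rpow_one, div_lt_iff₀ hcθ]
    exact hstep
  -- raise to 1/(1-θ)
  have h1θ : 0 < 1 - θ := by linarith
  have hfin : (c:ℝ) < (C * (R:ℝ) ^ s) ^ (1 / (1 - θ)) := by
    have := Real.rpow_lt_rpow (Real.rpow_nonneg hcpos.le _) hstep2 (one_div_pos.mpr h1θ)
    rwa [← Real.rpow_mul hcpos.le, mul_one_div_cancel h1θ.ne', Real.rpow_one] at this
  calc (c:ℝ) < (C * (R:ℝ) ^ s) ^ (1 / (1 - θ)) := hfin
    _ = C ^ (1 / (1 - θ)) * ((R : ℕ) : ℝ) ^ (s / (1 - θ)) := by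
        rw [Real.mul_rpow hC.le (by positivity), ← Real.rpow_mul (by positivity)]
        congr 2; ring

end Summit.ABC.ABC.Cruxes.TowerExponentWindow.Disproof

namespace Summit.ABC.ABC.Cruxes.TowerExponentWindow.Disproof

open Summit.ABC.ABC.Theses.IneffectiveSubspace
open Literature.NumberTheory.DiophantineGeometry in
/-- **THE CRUX IS POLYNOMIAL abc — kernel-checked in both directions.**  Consequently it is refutable
iff abc triples have unbounded quality, and `ABC` (polynomial abc with `κ = 2`) implies it
(`abc_imp_towerExponentWindow`). -/
theorem towerExponentWindow_iff_polyAbc :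
    TowerExponentWindow ↔
      ∃ κ C : ℝ, 0 < C ∧ ∀ a b c : ℕ, IsABCTriple a b c → (c : ℝ) < C * ((rad a b c : ℕ) : ℝ) ^ κ :=
  ⟨fun h => windowGivesPolynomialAbc h, towerExponentWindow_of_polyAbc⟩

end Summit.ABC.ABC.Cruxes.TowerExponentWindow.Disproof

namespace Summit.ABC.ABC.Cruxes.TowerExponentWindow.Disproof

/-! ## (d) Targets — the stubs of line `binomial-xi-d-zero-threefold` (cycle 2)

The skeleton reduces the crux to ONE open stub, `stub_binomialDepthWindow` = `∃ n C C', 0 ≤ C ∧ 3C < n ∧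
DepthIneq n C C'` (the other two stubs are provable bookkeeping).  It is implied by abc (skeleton,
`binomialDepthWindow_of_abc`), so it cannot be killed; this section pins down WHERE it can live.
Tree versions (def-free): `Theorems/TowerExponentWindow/Negative/StubBinomialDepthWindowFloors.lean`,
`…/StubBinomialDepthWindowLevelSeven.lean` (namespace `Summit.ABC.ABC.Theorems.TowerExponentWindow.Negative`:
`depth_floor_of_families`, `one_le_of_depth`, `two_le_of_depth_four_dvd`, `nine_fifths_le_of_depth_five`,
`two_le_of_depth_six_dvd`, `seven_le_of_depth_window`, `not_depth_window_le_six`, `depth_window_shape`).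

BIRTHDAY HEURISTIC (why `C* = 2`).  Fix `d = q^m` and boxes `a₁, c₁ ≤ q^(αm)`, `a₂, c₂ ≤ q^(βm)`.  The
congruence `a₁a₂ⁿ ≡ c₁c₂ⁿ (mod q^m)` has `≈ q^((2α+2β−1)m)` solutions in the box (main term of the
character-sum count), so admissible data exist as soon as `α + β > 1/2` (and `α + nβ ≥ 1`, room for
`d ∣ a₁a₂ⁿ − c₁c₂ⁿ ≠ 0`), with depth/height ratio `m/((α+β)m + 1) → 2`.  Explicit algebraic families realise
`2` at the levels divisible by `4` or `6` (norm forms of `ℤ[i]`, `ℤ[ω]` are binary, so every element is a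
value) and `2 − 1/n` at odd levels (Padé); beyond `2` lies abc territory (`ABC ⟹ C = 2 + (n+2)ε` works), and
isolated data of ratio `> 2` exist (e.g. `3¹⁰ ∣ 1·23⁵ − 2·1⁵`: ratio `10 log 3/(log 2 + log 23 + log 3) ≈ 2.23`,
Reyssat's triple) but only `C'` sees finitely many of them.

PAPER-LEVEL COMPLEMENT (not formalised): the floor `2` holds at EVERY even level `n ≥ 4` by Thue's pigeonhole.
Take `r ∣ n` with `r ≥ 3` (`r = 4` if `4 ∣ n`, else `r = n/2`, odd), a prime `p ≡ 1 (mod r)` and `ζ ∈ (ℤ/p^m)ˣ`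
of order `r` (cyclicity of `(ℤ/p^m)ˣ`); the `(⌊p^(m/2)⌋+1)² > p^m` values `u − ζv` collide, giving
`0 < a, c ≤ p^(m/2)` with `a ≡ ±ζc`, hence `p^m ∣ aⁿ − cⁿ` (`n` even, `ζⁿ = 1`); dividing out common factors
(a common `p` costs one power of the modulus but two of the box) leaves coprime `a₂ ≠ c₂` (`ζ ≢ ±1 mod p` as
`r ≥ 3`, `r ∣ p − 1`) with `p^(m') ∣ a₂ⁿ − c₂ⁿ`, `m' ≥ m/2`, `a₂, c₂ ≤ p^(m'/2)`: ratio `→ 2`.  So, rigorously,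
`C ≥ 2` at all even levels `≥ 4` and `C ≥ 2 − 1/n` at all odd levels; the formalised cases are `4 ∣ n`, `6 ∣ n`
(explicit norm-form recursions) and all odd `n` (Padé).
-/

open Literature.NumberTheory.DiophantineGeometry (radical_le_of_dvd_pow)

/-- Verbatim copy of `BinomialXiDZeroThreefold.DepthIneq` (skeleton `Lines/binomial-xi-d-zero-threefold.lean`):
the level-`n` binomial depth inequality with constants `(C, C')`. -/
def DepthIneq (n : ℕ) (C C' : ℝ) : Prop :=
  ∀ a₁ a₂ c₁ c₂ : ℕ, 0 < a₁ → 0 < a₂ → 0 < c₁ → 0 < c₂ → Nat.Coprime (a₁ * a₂) (c₁ * c₂) →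
    a₁ * a₂ ^ n ≠ c₁ * c₂ ^ n →
    ∀ d : ℕ, 0 < d → (d : ℤ) ∣ ((a₁ * a₂ ^ n : ℕ) : ℤ) - ((c₁ * c₂ ^ n : ℕ) : ℤ) →
      Real.log (d : ℝ) ≤ C * (Real.log ((max a₁ c₁ : ℕ) : ℝ) + Real.log ((max a₂ c₂ : ℕ) : ℝ) +
        Real.log ((UniqueFactorizationMonoid.radical d : ℕ) : ℝ)) + C'

/-- Verbatim copy of the registered stub `stub_binomialDepthWindow` (the LEVER of line
`binomial-xi-d-zero-threefold`). -/
def StubBinomialDepthWindow : Prop :=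
  ∃ n : ℕ, ∃ C C' : ℝ, 0 ≤ C ∧ 3 * C < n ∧ ∀ a₁ a₂ c₁ c₂ : ℕ, 0 < a₁ → 0 < a₂ → 0 < c₁ → 0 < c₂ → Nat.Coprime (a₁ * a₂) (c₁ * c₂) → a₁ * a₂ ^ n ≠ c₁ * c₂ ^ n → ∀ d : ℕ, 0 < d → (d : ℤ) ∣ ((a₁ * a₂ ^ n : ℕ) : ℤ) - ((c₁ * c₂ ^ n : ℕ) : ℤ) → Real.log (d : ℝ) ≤ C * (Real.log ((max a₁ c₁ : ℕ) : ℝ) + Real.log ((max a₂ c₂ : ℕ) : ℝ) + Real.log ((UniqueFactorizationMonoid.radical d : ℕ) : ℝ)) + C'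

theorem stubBinomialDepthWindow_iff :
    StubBinomialDepthWindow ↔ ∃ n : ℕ, ∃ C C' : ℝ, 0 ≤ C ∧ 3 * C < n ∧ DepthIneq n C C' :=
  Iff.rfl

/-- **Floor engine for the depth inequality.** A family of admissible data `(a₁, a₂, c₁, c₂, d)_m`
with `log d_m ≥ p·s_m`, `log max₁ + log max₂ + log rad d_m ≤ q·s_m + r` and `s_m` unbounded forces
`p ≤ C·q`. -/
theorem depthIneq_floor {n : ℕ} {C C' : ℝ} (hC : 0 ≤ C) (h : DepthIneq n C C')
    (a₁ a₂ c₁ c₂ d : ℕ → ℕ)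
    (hpos : ∀ m, 0 < a₁ m ∧ 0 < a₂ m ∧ 0 < c₁ m ∧ 0 < c₂ m ∧ 0 < d m)
    (hcop : ∀ m, Nat.Coprime (a₁ m * a₂ m) (c₁ m * c₂ m))
    (hne : ∀ m, a₁ m * a₂ m ^ n ≠ c₁ m * c₂ m ^ n)
    (hdvd : ∀ m, (d m : ℤ) ∣ ((a₁ m * a₂ m ^ n : ℕ) : ℤ) - ((c₁ m * c₂ m ^ n : ℕ) : ℤ))
    {p q r : ℝ} (s : ℕ → ℝ)
    (hlow : ∀ m, p * s m ≤ Real.log (d m : ℝ))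
    (hupp : ∀ m, Real.log ((max (a₁ m) (c₁ m) : ℕ) : ℝ) + Real.log ((max (a₂ m) (c₂ m) : ℕ) : ℝ) +
        Real.log ((UniqueFactorizationMonoid.radical (d m) : ℕ) : ℝ) ≤ q * s m + r)
    (hunb : ∀ K : ℝ, ∃ m, K ≤ s m) :
    p ≤ C * q := by
  by_contra hlt
  have hg : 0 < p - C * q := by linarith [lt_of_not_ge hlt]
  obtain ⟨m, hm⟩ := hunb ((C * r + C' + 1) / (p - C * q))
  have h1 := h (a₁ m) (a₂ m) (c₁ m) (c₂ m) (hpos m).1 (hpos m).2.1 (hpos m).2.2.1 (hpos m).2.2.2.1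
    (hcop m) (hne m) (d m) (hpos m).2.2.2.2 (hdvd m)
  have h2 : p * s m ≤ C * (q * s m + r) + C' :=
    (hlow m).trans (h1.trans (by nlinarith [mul_le_mul_of_nonneg_left (hupp m) hC]))
  have h4 : C * r + C' + 1 ≤ (p - C * q) * s m := by
    have := (div_le_iff₀ hg).mp hm
    linarith
  nlinarith

/-- **Floor `C ≥ 1` at every level** (family `a₁ = 2^(m+1) + 1`, `a₂ = c₁ = c₂ = 1`, `d = 2^(m+1)`):
`(m+1) log 2 ≤ C·((m+2) log 2 + 0 + log 2) + C'` for all `m` forces `C ≥ 1`.  Hence the lever is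
unsatisfiable at levels `n ≤ 3`. -/
theorem one_le_of_depthIneq {n : ℕ} {C C' : ℝ} (hC : 0 ≤ C) (h : DepthIneq n C C') : 1 ≤ C := by
  have hlog2 : 0 < Real.log 2 := Real.log_pos one_lt_two
  have key := depthIneq_floor hC h (fun m => 2 ^ (m + 1) + 1) (fun _ => 1) (fun _ => 1) (fun _ => 1)
    (fun m => 2 ^ (m + 1)) (fun m => ⟨by positivity, one_pos, one_pos, one_pos, by positivity⟩)
    (fun m => by simp) (fun m => by simp) (fun m => by push_cast; simp)
    (p := 1) (q := 1) (r := 2 * Real.log 2) (fun m => ((m : ℝ) + 1) * Real.log 2)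
    (fun m => ?_) (fun m => ?_) (fun K => ?_)
  · linarith
  · push_cast
    rw [Real.log_pow]; push_cast; linarith
  · have e1 : (max (2 ^ (m + 1) + 1) 1 : ℕ) = 2 ^ (m + 1) + 1 := max_eq_left (Nat.le_add_left 1 _)
    have e2 : (max 1 1 : ℕ) = 1 := max_self 1
    rw [e1, e2]
    have hrad : UniqueFactorizationMonoid.radical (2 ^ (m + 1)) ≤ 2 :=
      radical_le_of_dvd_pow (n := m + 1) two_ne_zero dvd_rfl
    have hrad' : Real.log ((UniqueFactorizationMonoid.radical (2 ^ (m + 1)) : ℕ) : ℝ) ≤ Real.log 2 :=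
      Real.log_le_log (by exact_mod_cast Nat.radical_pos _) (by exact_mod_cast hrad)
    have hm1 : Real.log ((2 ^ (m + 1) + 1 : ℕ) : ℝ) ≤ ((m : ℝ) + 2) * Real.log 2 := by
      have hle : ((2 ^ (m + 1) + 1 : ℕ) : ℝ) ≤ (2 : ℝ) ^ (m + 2) := by
        have : 2 ^ (m + 1) + 1 ≤ 2 ^ (m + 2) := by
          have hx : 1 ≤ 2 ^ (m + 1) := Nat.one_le_two_pow
          rw [pow_succ 2 (m + 1)]; omega
        exact_mod_cast this
      calc Real.log ((2 ^ (m + 1) + 1 : ℕ) : ℝ) ≤ Real.log ((2 : ℝ) ^ (m + 2)) :=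
            Real.log_le_log (by positivity) hle
        _ = ((m : ℝ) + 2) * Real.log 2 := by rw [Real.log_pow]; push_cast; ring
    push_cast at hm1 ⊢
    rw [Real.log_one]
    linarith
  · obtain ⟨m, hm⟩ := exists_nat_ge (K / Real.log 2)
    refine ⟨m, ?_⟩
    have := (div_le_iff₀ hlog2).mp hm
    nlinarith

/-- The lever of line `binomial-xi-d-zero-threefold` cannot be witnessed at a level `n ≤ 3`. -/
theorem four_le_of_depthIneq_window {n : ℕ} {C C' : ℝ} (hC : 0 ≤ C) (h3 : 3 * C < n)
    (h : DepthIneq n C C') : 4 ≤ n := by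
  have h1 := one_le_of_depthIneq hC h
  by_contra hlt
  have : (n : ℝ) ≤ 3 := by exact_mod_cast (by omega : n ≤ 3)
  linarith


/-! ### Floor `C ≥ 2` at every level divisible by `4`: the Gaussian family `(2 + i)^m = X_m + i Y_m`

`X_m² + Y_m² = 5^m` divides `X_m⁴ − Y_m⁴`, hence `|X_m|ⁿ − |Y_m|ⁿ` for `4 ∣ n`, while `|X_m|, |Y_m| ≤ 5^(m/2)`,
`gcd(X_m, Y_m) = 1` (because `X_m + 2Y_m ≢ 0 mod 5`): depth `m log 5` against
`C·(0 + (m/2) log 5 + log 5) + C'`. -/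

/-- `(X, Y) ↦ (2X − Y, X + 2Y)` (multiplication by `2 + i`), from `(1, 0)`. -/
def gauss : ℕ → ℤ × ℤ
  | 0 => (1, 0)
  | m + 1 => (2 * (gauss m).1 - (gauss m).2, (gauss m).1 + 2 * (gauss m).2)

theorem gauss_norm (m : ℕ) : (gauss m).1 ^ 2 + (gauss m).2 ^ 2 = 5 ^ m := by
  induction m with
  | zero => simp [gauss]
  | succ m ih => simp only [gauss]; rw [pow_succ]; linear_combination 5 * ih

theorem prime_five_int : Prime (5 : ℤ) := Int.prime_iff_natAbs_prime.mpr (by norm_num)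

/-- The invariant `X_m + 2 Y_m ≢ 0 (mod 5)` (it is multiplied by `4` at each step). -/
theorem gauss_not_dvd (m : ℕ) : ¬ (5 : ℤ) ∣ (gauss m).1 + 2 * (gauss m).2 := by
  induction m with
  | zero => simp only [gauss]; decide
  | succ m ih =>
    simp only [gauss]
    intro h
    apply ih
    have h4 : (5 : ℤ) ∣ 4 * ((gauss m).1 + 2 * (gauss m).2) := by
      have e : 4 * ((gauss m).1 + 2 * (gauss m).2)
          = (2 * (gauss m).1 - (gauss m).2 + 2 * ((gauss m).1 + 2 * (gauss m).2)) + 5 * (gauss m).2 := by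
        ring
      rw [e]; exact dvd_add h (dvd_mul_right 5 _)
    rcases prime_five_int.dvd_or_dvd h4 with h' | h'
    · exact absurd h' (by decide)
    · exact h'

theorem gauss_fst_ne_zero {m : ℕ} (hm : 1 ≤ m) : (gauss m).1 ≠ 0 := by
  intro h0
  have hn := gauss_norm m
  have h5 : (5 : ℤ) ∣ (gauss m).2 ^ 2 := by
    have : (5 : ℤ) ∣ 5 ^ m := dvd_pow_self 5 (by omega)
    rw [← hn, h0] at this; simpa using this
  apply gauss_not_dvd m
  rw [h0, zero_add]
  exact dvd_mul_of_dvd_right (prime_five_int.dvd_of_dvd_pow h5) 2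

theorem gauss_snd_ne_zero {m : ℕ} (hm : 1 ≤ m) : (gauss m).2 ≠ 0 := by
  intro h0
  have hn := gauss_norm m
  have h5 : (5 : ℤ) ∣ (gauss m).1 ^ 2 := by
    have : (5 : ℤ) ∣ 5 ^ m := dvd_pow_self 5 (by omega)
    rw [← hn, h0] at this; simpa using this
  apply gauss_not_dvd m
  rw [h0, mul_zero, add_zero]
  exact prime_five_int.dvd_of_dvd_pow h5

theorem gauss_natAbs_ne (m : ℕ) : (gauss m).1.natAbs ≠ (gauss m).2.natAbs := by
  intro h
  have hsq : (gauss m).1 ^ 2 = (gauss m).2 ^ 2 := by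
    rw [← Int.natAbs_sq (gauss m).1, ← Int.natAbs_sq (gauss m).2, h]
  have hn := gauss_norm m
  rw [hsq] at hn
  have hodd : Odd ((5 : ℤ) ^ m) := Odd.pow (by decide)
  rw [← hn] at hodd
  exact Int.not_even_iff_odd.mpr hodd ⟨(gauss m).2 ^ 2, rfl⟩

theorem gauss_coprime (m : ℕ) : Nat.Coprime (gauss m).1.natAbs (gauss m).2.natAbs := by
  show Int.gcd (gauss m).1 (gauss m).2 = 1
  set g : ℕ := Int.gcd (gauss m).1 (gauss m).2 with hg
  have hgX : (g : ℤ) ∣ (gauss m).1 := Int.gcd_dvd_left ..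
  have hgY : (g : ℤ) ∣ (gauss m).2 := Int.gcd_dvd_right ..
  have hg5 : g ∣ 5 ^ m := by
    have h1 : (g : ℤ) ∣ 5 ^ m := by
      rw [← gauss_norm m]; exact dvd_add (dvd_pow hgX two_ne_zero) (dvd_pow hgY two_ne_zero)
    exact_mod_cast h1
  obtain ⟨k, hk, hgk⟩ := (Nat.dvd_prime_pow Nat.prime_five).mp hg5
  rcases Nat.eq_zero_or_pos k with hk0 | hk0
  · rw [hgk, hk0, pow_zero]
  · exfalso
    have h5g : (5 : ℤ) ∣ (g : ℤ) := by
      rw [hgk]; push_cast; exact dvd_pow_self 5 hk0.ne'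
    apply gauss_not_dvd m
    exact dvd_add (h5g.trans hgX) (dvd_mul_of_dvd_right (h5g.trans hgY) 2)

/-- `|X_m|², |Y_m|² ≤ 5^m`. -/
theorem gauss_natAbs_sq_le (m : ℕ) :
    (gauss m).1.natAbs ^ 2 ≤ 5 ^ m ∧ (gauss m).2.natAbs ^ 2 ≤ 5 ^ m := by
  have hn := gauss_norm m
  have h1 : ((gauss m).1.natAbs : ℤ) ^ 2 ≤ 5 ^ m := by
    rw [Int.natAbs_sq]; nlinarith [sq_nonneg (gauss m).2]
  have h2 : ((gauss m).2.natAbs : ℤ) ^ 2 ≤ 5 ^ m := by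
    rw [Int.natAbs_sq]; nlinarith [sq_nonneg (gauss m).1]
  exact ⟨by exact_mod_cast h1, by exact_mod_cast h2⟩

/-- `5^m ∣ X_m^(4k) − Y_m^(4k)`. -/
theorem gauss_dvd (m k : ℕ) : (5 : ℤ) ^ m ∣ (gauss m).1 ^ (4 * k) - (gauss m).2 ^ (4 * k) := by
  have h1 : (5 : ℤ) ^ m ∣ (gauss m).1 ^ 4 - (gauss m).2 ^ 4 :=
    ⟨(gauss m).1 ^ 2 - (gauss m).2 ^ 2, by rw [← gauss_norm m]; ring⟩
  have h2 : (gauss m).1 ^ 4 - (gauss m).2 ^ 4 ∣ ((gauss m).1 ^ 4) ^ k - ((gauss m).2 ^ 4) ^ k :=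
    sub_dvd_pow_sub_pow _ _ k
  rw [pow_mul, pow_mul]
  exact h1.trans h2

/-- **Floor `C ≥ 2` at every level `n = 4k ≥ 4`.** -/
theorem two_le_of_depthIneq_four_dvd {n : ℕ} (hn : n ≠ 0) (h4 : 4 ∣ n) {C C' : ℝ} (hC : 0 ≤ C)
    (h : DepthIneq n C C') : 2 ≤ C := by
  obtain ⟨k, rfl⟩ := h4
  have hlog5 : 0 < Real.log 5 := Real.log_pos (by norm_num)
  have key := depthIneq_floor hC h (fun _ => 1) (fun m => (gauss (m + 1)).1.natAbs) (fun _ => 1)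
    (fun m => (gauss (m + 1)).2.natAbs) (fun m => 5 ^ (m + 1))
    (fun m => ⟨one_pos, Int.natAbs_pos.mpr (gauss_fst_ne_zero (by omega)), one_pos,
      Int.natAbs_pos.mpr (gauss_snd_ne_zero (by omega)), by positivity⟩)
    (fun m => by simpa using gauss_coprime (m + 1))
    (fun m => ?_) (fun m => ?_)
    (p := 1) (q := 1 / 2) (r := Real.log 5) (fun m => ((m : ℝ) + 1) * Real.log 5)
    (fun m => ?_) (fun m => ?_) (fun K => ?_)
  · linarith
  · -- `|X|ⁿ ≠ |Y|ⁿ`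
    rw [one_mul, one_mul]
    exact fun he => gauss_natAbs_ne (m + 1) (Nat.pow_left_injective (by omega) he)
  · -- divisibility
    push_cast
    rw [show 4 * k = 2 * (2 * k) by ring, pow_mul, pow_mul |(gauss (m+1)).2|, sq_abs, sq_abs,
      ← pow_mul, ← pow_mul, show 2 * (2 * k) = 4 * k by ring, one_mul, one_mul]
    exact gauss_dvd (m + 1) k
  · push_cast
    rw [Real.log_pow]; push_cast; linarith
  · -- sizes
    obtain ⟨hX, hY⟩ := gauss_natAbs_sq_le (m + 1)
    set M : ℕ := max (gauss (m + 1)).1.natAbs (gauss (m + 1)).2.natAbs with hM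
    have hM1 : 1 ≤ M := le_max_of_le_left (Int.natAbs_pos.mpr (gauss_fst_ne_zero (by omega)))
    have hM2 : M ^ 2 ≤ 5 ^ (m + 1) := by
      rcases le_total (gauss (m + 1)).1.natAbs (gauss (m + 1)).2.natAbs with hle | hle
      · rw [hM, max_eq_right hle]; exact hY
      · rw [hM, max_eq_left hle]; exact hX
    have hlogM : 2 * Real.log (M : ℝ) ≤ ((m : ℝ) + 1) * Real.log 5 := by
      have h1 : ((M : ℕ) : ℝ) ^ 2 ≤ (5 : ℝ) ^ (m + 1) := by exact_mod_cast hM2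
      have h2 := Real.log_le_log (by positivity) h1
      rw [Real.log_pow, Real.log_pow] at h2
      push_cast at h2
      linarith
    have hrad : UniqueFactorizationMonoid.radical (5 ^ (m + 1)) ≤ 5 :=
      radical_le_of_dvd_pow (n := m + 1) (by norm_num) dvd_rfl
    have hrad' : Real.log ((UniqueFactorizationMonoid.radical (5 ^ (m + 1)) : ℕ) : ℝ) ≤ Real.log 5 :=
      Real.log_le_log (by exact_mod_cast Nat.radical_pos _) (by exact_mod_cast hrad)
    push_cast
    rw [max_self, Real.log_one]
    linarith
  · obtain ⟨m, hm⟩ := exists_nat_ge (K / Real.log 5)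
    refine ⟨m, ?_⟩
    have := (div_le_iff₀ hlog5).mp hm
    nlinarith


/-! ### Floor `C ≥ 9/5` at level `5`: the Padé family `A(t)·(t+1)⁵ − B(t) = t⁹`

The `[n−1 ∣ n−1]` Padé approximant of `(1+t)ⁿ` is the split of `(X − Y)^(2n−1)` into its `Xⁿ`- and
`Yⁿ`-divisible halves: `Q(X,Y)·Xⁿ − Q(Y,X)·Yⁿ = (X − Y)^(2n−1)`, `Q(X,Y) = Σ_{i<n} C(2n−1, n+i) Xⁱ(−Y)^(n−1−i)`.
At `(X, Y) = (t+1, 1)` both coefficients are POSITIVE exactly when `n` is odd (for even `n` one of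
`Q(ρ,1), Q(1,ρ)` is negative for every real `ρ > 0`: no positive Padé family exists), and with `t = qʲ`
the depth is `(2n−1)·j log q` against heights `(n−1)j log q + j log q + log q`: `C ≥ 2 − 1/n`.  The case that
matters for the dead-level census is `n = 5` (`9/5 > 5/3`); here `A(t) = t⁴ − 5t³ + 15t² − 35t + 70`,
`B(t) = 126t⁴ + 420t³ + 540t² + 315t + 70 = (126t³ + 294t² + 246t + 69)(t+1) + 1`, `t = 11^(j+1)`. -/

/-- `A(t) = t⁴ − 5t³ + 15t² − 35t + 70` (over `ℤ`). -/
def padeA (t : ℤ) : ℤ := t ^ 4 - 5 * t ^ 3 + 15 * t ^ 2 - 35 * t + 70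

/-- `B(t) = (126t³ + 294t² + 246t + 69)(t+1) + 1 = 126t⁴ + 420t³ + 540t² + 315t + 70` (over `ℕ`). -/
def padeB (t : ℕ) : ℕ := (126 * t ^ 3 + 294 * t ^ 2 + 246 * t + 69) * (t + 1) + 1

theorem padeB_cast (t : ℕ) :
    ((padeB t : ℕ) : ℤ) = 126 * (t : ℤ) ^ 4 + 420 * (t : ℤ) ^ 3 + 540 * (t : ℤ) ^ 2 + 315 * t + 70 := by
  unfold padeB; push_cast; ring

/-- The Padé identity at level `5`. -/
theorem pade_identity (t : ℤ) :
    padeA t * (t + 1) ^ 5 - (126 * t ^ 4 + 420 * t ^ 3 + 540 * t ^ 2 + 315 * t + 70) = t ^ 9 := by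
  unfold padeA; ring

theorem padeA_pos {t : ℤ} (ht : 6 ≤ t) : 0 < padeA t := by
  unfold padeA
  have h1 : 0 ≤ t ^ 3 * (t - 6) := mul_nonneg (by positivity) (by linarith)
  have ht2 : 36 ≤ t ^ 2 := by nlinarith
  have h2 : 36 * t ≤ t ^ 3 := by
    rw [show t ^ 3 = t ^ 2 * t by ring]; exact mul_le_mul_of_nonneg_right ht2 (by linarith)
  nlinarith

/-- **Floor `C ≥ 9/5` at level `5`** (family `a₁ = A(t)`, `a₂ = t + 1`, `c₁ = B(t)`, `c₂ = 1`, `d = t⁹`,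
`t = 11^(j+1)`).  Consequently the lever is unsatisfiable at level `5` (`9/5 > 5/3`). -/
theorem nine_fifths_le_of_depthIneq_five {C C' : ℝ} (hC : 0 ≤ C) (h : DepthIneq 5 C C') :
    9 / 5 ≤ C := by
  have hlog11 : 0 < Real.log 11 := Real.log_pos (by norm_num)
  -- the parameter and the coefficient `a₁`
  set T : ℕ → ℕ := fun j => 11 ^ (j + 1) with hT
  have hT11 : ∀ j, 11 ≤ T j := fun j => by
    show 11 ≤ 11 ^ (j + 1)
    calc (11:ℕ) = 11 ^ 1 := by norm_num
      _ ≤ 11 ^ (j + 1) := Nat.pow_le_pow_right (by norm_num) (by omega)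
  have hApos : ∀ j, 0 < padeA (T j) := fun j => padeA_pos (by have := hT11 j; omega)
  have hAcast : ∀ j, (((padeA (T j)).toNat : ℕ) : ℤ) = padeA (T j) := fun j =>
    Int.toNat_of_nonneg (hApos j).le
  have hlogT : ∀ j, Real.log (T j : ℝ) = ((j : ℝ) + 1) * Real.log 11 := fun j => by
    show Real.log ((11 ^ (j + 1) : ℕ) : ℝ) = _
    push_cast; rw [Real.log_pow]; push_cast; ring
  have key := depthIneq_floor hC h (fun j => (padeA (T j)).toNat) (fun j => T j + 1) (fun j => padeB (T j))
    (fun _ => 1) (fun j => (T j) ^ 9)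
    (fun j => ⟨by have := hApos j; omega, by omega, by unfold padeB; omega, one_pos,
      by positivity⟩)
    (fun j => ?_) (fun j => ?_) (fun j => ?_)
    (p := 9) (q := 5) (r := Real.log 1471 + Real.log 2 + Real.log 11)
    (fun j => ((j : ℝ) + 1) * Real.log 11)
    (fun j => ?_) (fun j => ?_) (fun K => ?_)
  · linarith
  · -- coprimality `gcd(A(t)(t+1), B(t)·1) = 1`
    rw [mul_one]
    refine Nat.Coprime.mul_left ?_ ?_
    · refine Nat.coprime_of_dvd fun p hp hpa hpb => ?_
      have hpa' : (p : ℤ) ∣ padeA (T j) := by rw [← hAcast j]; exact_mod_cast hpa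
      have hpb' : (p : ℤ) ∣ ((padeB (T j) : ℕ) : ℤ) := by exact_mod_cast hpb
      have hpt : (p : ℤ) ∣ ((T j : ℕ) : ℤ) ^ 9 := by
        rw [← pade_identity, ← padeB_cast]
        exact dvd_sub (dvd_mul_of_dvd_left hpa' _) hpb'
      have hpt' : p ∣ (T j) ^ 9 := by exact_mod_cast hpt
      have hp11 : p = 11 := by
        have e : (T j) ^ 9 = 11 ^ (9 * (j + 1)) := by
          show (11 ^ (j + 1)) ^ 9 = _; rw [← pow_mul, mul_comm]
        have h1 : p ∣ 11 ^ (9 * (j + 1)) := by rwa [e] at hpt'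
        exact (Nat.prime_dvd_prime_iff_eq hp (by norm_num)).mp (hp.dvd_of_dvd_pow h1)
      subst hp11
      have h11t : (11 : ℤ) ∣ ((T j : ℕ) : ℤ) := by
        show (11 : ℤ) ∣ ((11 ^ (j + 1) : ℕ) : ℤ); push_cast; exact dvd_pow_self 11 (by omega)
      have h70 : (11 : ℤ) ∣ 70 := by
        have e : (70 : ℤ) = padeA (T j) - (T j : ℤ) * ((T j : ℤ) ^ 3 - 5 * (T j : ℤ) ^ 2 + 15 * (T j) - 35) := by
          unfold padeA; ring
        rw [e]; exact dvd_sub (by exact_mod_cast hpa') (dvd_mul_of_dvd_left h11t _)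
      revert h70; decide
    · show Nat.Coprime (T j + 1) ((126 * T j ^ 3 + 294 * T j ^ 2 + 246 * T j + 69) * (T j + 1) + 1)
      rw [Nat.coprime_mul_right_add_right]
      exact Nat.coprime_one_right _
  · -- `a₁a₂⁵ ≠ c₁c₂⁵`
    intro he
    have he' : (((padeA (T j)).toNat : ℕ) : ℤ) * ((T j : ℕ) + 1 : ℤ) ^ 5 = ((padeB (T j) : ℕ) : ℤ) * 1 ^ 5 := by
      exact_mod_cast he
    rw [hAcast, padeB_cast, one_pow, mul_one] at he'
    have hid := pade_identity (T j : ℤ)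
    rw [he', sub_self] at hid
    have : (0 : ℤ) < (T j : ℤ) ^ 9 := by positivity
    rw [← hid] at this; exact lt_irrefl _ this
  · -- divisibility `t⁹ ∣ A(t)(t+1)⁵ − B(t)`
    simp only [Nat.cast_pow, Nat.cast_mul, Nat.cast_add, Nat.cast_one, one_pow, mul_one]
    rw [hAcast, padeB_cast, ← pade_identity]
  · -- `log d = 9 (j+1) log 11`
    push_cast
    rw [Real.log_pow, hlogT]; push_cast; linarith
  · -- sizes: `max(a₁,c₁) ≤ 1471 t⁴`, `max(a₂,c₂) = t + 1 ≤ 2t`, `rad(t⁹) ≤ 11`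
    have ht1 : (1 : ℝ) ≤ (T j : ℝ) := by exact_mod_cast (hT11 j).trans' (by norm_num)
    have htpos : (0 : ℝ) < (T j : ℝ) := by linarith
    -- first height
    have hmax1 : ((max (padeA (T j)).toNat (padeB (T j)) : ℕ) : ℝ) ≤ 1471 * (T j : ℝ) ^ 4 := by
      have hA : (((padeA (T j)).toNat : ℕ) : ℝ) ≤ 1471 * (T j : ℝ) ^ 4 := by
        have h1 : (((padeA (T j)).toNat : ℕ) : ℤ) ≤ 1471 * (T j : ℤ) ^ 4 := by
          rw [hAcast]; unfold padeA
          have hT0 : (0:ℤ) ≤ T j := by positivity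
          have hT1' : (1:ℤ) ≤ T j := by exact_mod_cast (hT11 j).trans' (by norm_num)
          have e4 : (T j : ℤ) ^ 2 ≤ (T j : ℤ) ^ 4 := pow_le_pow_right₀ hT1' (by norm_num)
          have e0 : (1 : ℤ) ≤ (T j : ℤ) ^ 4 := one_le_pow₀ hT1'
          have e3 : (0 : ℤ) ≤ (T j : ℤ) ^ 3 := by positivity
          linarith
        exact_mod_cast h1
      have hB : ((padeB (T j) : ℕ) : ℝ) ≤ 1471 * (T j : ℝ) ^ 4 := by
        have h1 : ((padeB (T j) : ℕ) : ℤ) ≤ 1471 * (T j : ℤ) ^ 4 := by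
          rw [padeB_cast]
          have hT1' : (1:ℤ) ≤ T j := by exact_mod_cast (hT11 j).trans' (by norm_num)
          have e3 : (T j : ℤ) ^ 3 ≤ (T j : ℤ) ^ 4 := pow_le_pow_right₀ hT1' (by norm_num)
          have e2 : (T j : ℤ) ^ 2 ≤ (T j : ℤ) ^ 4 := pow_le_pow_right₀ hT1' (by norm_num)
          have e1 : (T j : ℤ) ≤ (T j : ℤ) ^ 4 := le_self_pow₀ hT1' (by norm_num)
          have e0 : (1 : ℤ) ≤ (T j : ℤ) ^ 4 := one_le_pow₀ hT1'
          linarith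
        exact_mod_cast h1
      push_cast
      exact max_le hA hB
    have hlog1 : Real.log ((max (padeA (T j)).toNat (padeB (T j)) : ℕ) : ℝ) ≤
        Real.log 1471 + 4 * Real.log (T j : ℝ) := by
      have hpos1 : (0 : ℝ) < ((max (padeA (T j)).toNat (padeB (T j)) : ℕ) : ℝ) := by
        have : 0 < padeB (T j) := by unfold padeB; omega
        exact_mod_cast lt_max_of_lt_right this
      calc Real.log ((max (padeA (T j)).toNat (padeB (T j)) : ℕ) : ℝ)
          ≤ Real.log (1471 * (T j : ℝ) ^ 4) := Real.log_le_log hpos1 hmax1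
        _ = Real.log 1471 + 4 * Real.log (T j : ℝ) := by
          rw [Real.log_mul (by norm_num) (by positivity), Real.log_pow]; push_cast; ring
    -- second height
    have hlog2 : Real.log ((max (T j + 1) 1 : ℕ) : ℝ) ≤ Real.log 2 + Real.log (T j : ℝ) := by
      rw [max_eq_left (by omega : 1 ≤ T j + 1)]
      calc Real.log ((T j + 1 : ℕ) : ℝ) ≤ Real.log (2 * (T j : ℝ)) :=
            Real.log_le_log (by positivity) (by push_cast; linarith)
        _ = Real.log 2 + Real.log (T j : ℝ) := Real.log_mul (by norm_num) htpos.ne'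
    -- radical
    have hrad : UniqueFactorizationMonoid.radical ((T j) ^ 9) ≤ 11 := by
      refine radical_le_of_dvd_pow (n := 9 * (j + 1)) (by norm_num) ?_
      show (11 ^ (j + 1)) ^ 9 ∣ 11 ^ (9 * (j + 1))
      rw [← pow_mul, mul_comm]
    have hlog3 : Real.log ((UniqueFactorizationMonoid.radical ((T j) ^ 9) : ℕ) : ℝ) ≤ Real.log 11 :=
      Real.log_le_log (by exact_mod_cast Nat.radical_pos _) (by exact_mod_cast hrad)
    rw [hlogT] at hlog1 hlog2
    linarith
  · obtain ⟨j, hj⟩ := exists_nat_ge (K / Real.log 11)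
    refine ⟨j, ?_⟩
    have := (div_le_iff₀ hlog11).mp hj
    nlinarith

/-- The lever of line `binomial-xi-d-zero-threefold` cannot be witnessed at level `5`. -/
theorem not_depthIneq_window_five {C C' : ℝ} (hC : 0 ≤ C) (h3 : 3 * C < (5 : ℕ))
    (h : DepthIneq 5 C C') : False := by
  have := nine_fifths_le_of_depthIneq_five hC h
  push_cast at h3
  linarith


/-! ### Floor `C ≥ 2` at every level divisible by `6`: the Eisenstein family `(3 + ω)^m = X_m + Y_m ω`

`N(X + Yω) = X² − XY + Y² = 7^m` divides `X⁶ − Y⁶ = (X² − XY + Y²)(X + Y)(X³ − Y³)`, hence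
`|X_m|ⁿ − |Y_m|ⁿ` for `6 ∣ n`; `3X², 3Y² ≤ 4·7^m`; `gcd = 1` because `X_m + 2Y_m ≢ 0 (mod 7)`. -/

/-- `(X, Y) ↦ (3X − Y, X + 2Y)` (multiplication by `3 + ω`, `ω² + ω + 1 = 0`), from `(1, 0)`. -/
def eis : ℕ → ℤ × ℤ
  | 0 => (1, 0)
  | m + 1 => (3 * (eis m).1 - (eis m).2, (eis m).1 + 2 * (eis m).2)

theorem eis_norm (m : ℕ) : (eis m).1 ^ 2 - (eis m).1 * (eis m).2 + (eis m).2 ^ 2 = 7 ^ m := by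
  induction m with
  | zero => simp [eis]
  | succ m ih => simp only [eis]; rw [pow_succ]; linear_combination 7 * ih

theorem prime_seven_int : Prime (7 : ℤ) := Int.prime_iff_natAbs_prime.mpr (by norm_num)

/-- The invariant `X_m + 2 Y_m ≢ 0 (mod 7)` (it is multiplied by `5` at each step). -/
theorem eis_not_dvd (m : ℕ) : ¬ (7 : ℤ) ∣ (eis m).1 + 2 * (eis m).2 := by
  induction m with
  | zero => simp only [eis]; decide
  | succ m ih =>
    simp only [eis]
    intro h
    apply ih
    have h5 : (7 : ℤ) ∣ 5 * ((eis m).1 + 2 * (eis m).2) := by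
      have e : 5 * ((eis m).1 + 2 * (eis m).2)
          = (3 * (eis m).1 - (eis m).2 + 2 * ((eis m).1 + 2 * (eis m).2)) + 7 * (eis m).2 := by ring
      rw [e]; exact dvd_add h (dvd_mul_right 7 _)
    rcases prime_seven_int.dvd_or_dvd h5 with h' | h'
    · exact absurd h' (by decide)
    · exact h'

theorem eis_fst_ne_zero {m : ℕ} (hm : 1 ≤ m) : (eis m).1 ≠ 0 := by
  intro h0
  have hn := eis_norm m
  have h7 : (7 : ℤ) ∣ (eis m).2 ^ 2 := by
    have : (7 : ℤ) ∣ 7 ^ m := dvd_pow_self 7 (by omega)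
    rw [← hn, h0] at this; simpa using this
  apply eis_not_dvd m
  rw [h0, zero_add]
  exact dvd_mul_of_dvd_right (prime_seven_int.dvd_of_dvd_pow h7) 2

theorem eis_snd_ne_zero {m : ℕ} (hm : 1 ≤ m) : (eis m).2 ≠ 0 := by
  intro h0
  have hn := eis_norm m
  have h7 : (7 : ℤ) ∣ (eis m).1 ^ 2 := by
    have : (7 : ℤ) ∣ 7 ^ m := dvd_pow_self 7 (by omega)
    rw [← hn, h0] at this; simpa using this
  apply eis_not_dvd m
  rw [h0, mul_zero, add_zero]
  exact prime_seven_int.dvd_of_dvd_pow h7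

theorem eis_natAbs_ne {m : ℕ} (hm : 1 ≤ m) : (eis m).1.natAbs ≠ (eis m).2.natAbs := by
  intro h
  have hn := eis_norm m
  rcases Int.natAbs_eq_natAbs_iff.mp h with h' | h'
  · -- `X = Y`: norm `= X²`, so `7 ∣ X` and `7 ∣ X + 2Y = 3X`
    rw [h'] at hn
    have h7 : (7 : ℤ) ∣ (eis m).2 ^ 2 := by
      have : (7 : ℤ) ∣ 7 ^ m := dvd_pow_self 7 (by omega)
      rw [← hn] at this; convert this using 1; ring
    have h7Y := prime_seven_int.dvd_of_dvd_pow h7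
    apply eis_not_dvd m
    rw [h']; exact dvd_add h7Y (dvd_mul_of_dvd_right h7Y 2)
  · -- `X = −Y`: norm `= 3Y²`, so `3 ∣ 7^m`
    rw [h'] at hn
    have h3 : (3 : ℤ) ∣ 7 ^ m := ⟨(eis m).2 ^ 2, by rw [← hn]; ring⟩
    have h37 : (3 : ℤ) ∣ 7 := (Int.prime_iff_natAbs_prime.mpr (by norm_num) : Prime (3 : ℤ)).dvd_of_dvd_pow h3
    revert h37; decide

theorem eis_coprime (m : ℕ) : Nat.Coprime (eis m).1.natAbs (eis m).2.natAbs := by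
  show Int.gcd (eis m).1 (eis m).2 = 1
  set g : ℕ := Int.gcd (eis m).1 (eis m).2 with hg
  have hgX : (g : ℤ) ∣ (eis m).1 := Int.gcd_dvd_left ..
  have hgY : (g : ℤ) ∣ (eis m).2 := Int.gcd_dvd_right ..
  have hg7 : g ∣ 7 ^ m := by
    have h1 : (g : ℤ) ∣ 7 ^ m := by
      rw [← eis_norm m]
      exact dvd_add (dvd_sub (dvd_pow hgX two_ne_zero) (dvd_mul_of_dvd_left hgX _))
        (dvd_pow hgY two_ne_zero)
    exact_mod_cast h1
  obtain ⟨k, hk, hgk⟩ := (Nat.dvd_prime_pow (by norm_num : Nat.Prime 7)).mp hg7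
  rcases Nat.eq_zero_or_pos k with hk0 | hk0
  · rw [hgk, hk0, pow_zero]
  · exfalso
    have h7g : (7 : ℤ) ∣ (g : ℤ) := by
      rw [hgk]; push_cast; exact dvd_pow_self 7 hk0.ne'
    apply eis_not_dvd m
    exact dvd_add (h7g.trans hgX) (dvd_mul_of_dvd_right (h7g.trans hgY) 2)

/-- `3|X_m|², 3|Y_m|² ≤ 4·7^m`. -/
theorem eis_natAbs_sq_le (m : ℕ) :
    3 * (eis m).1.natAbs ^ 2 ≤ 4 * 7 ^ m ∧ 3 * (eis m).2.natAbs ^ 2 ≤ 4 * 7 ^ m := by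
  have hn := eis_norm m
  have h1 : 3 * ((eis m).1.natAbs : ℤ) ^ 2 ≤ 4 * 7 ^ m := by
    rw [Int.natAbs_sq]; nlinarith [sq_nonneg (2 * (eis m).2 - (eis m).1)]
  have h2 : 3 * ((eis m).2.natAbs : ℤ) ^ 2 ≤ 4 * 7 ^ m := by
    rw [Int.natAbs_sq]; nlinarith [sq_nonneg (2 * (eis m).1 - (eis m).2)]
  exact ⟨by exact_mod_cast h1, by exact_mod_cast h2⟩

/-- `7^m ∣ X_m^(6k) − Y_m^(6k)`. -/
theorem eis_dvd (m k : ℕ) : (7 : ℤ) ^ m ∣ (eis m).1 ^ (6 * k) - (eis m).2 ^ (6 * k) := by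
  have h1 : (7 : ℤ) ^ m ∣ (eis m).1 ^ 6 - (eis m).2 ^ 6 :=
    ⟨((eis m).1 + (eis m).2) * ((eis m).1 ^ 3 - (eis m).2 ^ 3), by rw [← eis_norm m]; ring⟩
  have h2 : (eis m).1 ^ 6 - (eis m).2 ^ 6 ∣ ((eis m).1 ^ 6) ^ k - ((eis m).2 ^ 6) ^ k :=
    sub_dvd_pow_sub_pow _ _ k
  rw [pow_mul, pow_mul]
  exact h1.trans h2

/-- **Floor `C ≥ 2` at every level `n = 6k ≥ 6`.** -/
theorem two_le_of_depthIneq_six_dvd {n : ℕ} (hn : n ≠ 0) (h6 : 6 ∣ n) {C C' : ℝ} (hC : 0 ≤ C)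
    (h : DepthIneq n C C') : 2 ≤ C := by
  obtain ⟨k, rfl⟩ := h6
  have hlog7 : 0 < Real.log 7 := Real.log_pos (by norm_num)
  have key := depthIneq_floor hC h (fun _ => 1) (fun m => (eis (m + 1)).1.natAbs) (fun _ => 1)
    (fun m => (eis (m + 1)).2.natAbs) (fun m => 7 ^ (m + 1))
    (fun m => ⟨one_pos, Int.natAbs_pos.mpr (eis_fst_ne_zero (by omega)), one_pos,
      Int.natAbs_pos.mpr (eis_snd_ne_zero (by omega)), by positivity⟩)
    (fun m => by simpa using eis_coprime (m + 1))
    (fun m => ?_) (fun m => ?_)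
    (p := 1) (q := 1 / 2) (r := Real.log 2 + Real.log 7) (fun m => ((m : ℝ) + 1) * Real.log 7)
    (fun m => ?_) (fun m => ?_) (fun K => ?_)
  · linarith
  · rw [one_mul, one_mul]
    exact fun he => eis_natAbs_ne (by omega) (Nat.pow_left_injective (by omega) he)
  · push_cast
    rw [show 6 * k = 2 * (3 * k) by ring, pow_mul, pow_mul |(eis (m+1)).2|, sq_abs, sq_abs,
      ← pow_mul, ← pow_mul, show 2 * (3 * k) = 6 * k by ring, one_mul, one_mul]
    exact eis_dvd (m + 1) k
  · push_cast
    rw [Real.log_pow]; push_cast; linarith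
  · obtain ⟨hX, hY⟩ := eis_natAbs_sq_le (m + 1)
    set M : ℕ := max (eis (m + 1)).1.natAbs (eis (m + 1)).2.natAbs with hM
    have hM1 : 1 ≤ M := le_max_of_le_left (Int.natAbs_pos.mpr (eis_fst_ne_zero (by omega)))
    have hM2 : 3 * M ^ 2 ≤ 4 * 7 ^ (m + 1) := by
      rcases le_total (eis (m + 1)).1.natAbs (eis (m + 1)).2.natAbs with hle | hle
      · rw [hM, max_eq_right hle]; exact hY
      · rw [hM, max_eq_left hle]; exact hX
    have hlogM : 2 * Real.log (M : ℝ) ≤ ((m : ℝ) + 1) * Real.log 7 + Real.log 2 := by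
      have h1 : ((M : ℕ) : ℝ) ^ 2 ≤ 2 * (7 : ℝ) ^ (m + 1) := by
        have : (3 * M ^ 2 : ℕ) ≤ 4 * 7 ^ (m + 1) := hM2
        have h' : ((3 * M ^ 2 : ℕ) : ℝ) ≤ ((4 * 7 ^ (m + 1) : ℕ) : ℝ) := by exact_mod_cast this
        push_cast at h'
        nlinarith [h']
      have h2 := Real.log_le_log (by positivity) h1
      rw [Real.log_pow, Real.log_mul (by norm_num) (by positivity), Real.log_pow] at h2
      push_cast at h2
      linarith
    have hrad : UniqueFactorizationMonoid.radical (7 ^ (m + 1)) ≤ 7 :=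
      radical_le_of_dvd_pow (n := m + 1) (by norm_num) dvd_rfl
    have hrad' : Real.log ((UniqueFactorizationMonoid.radical (7 ^ (m + 1)) : ℕ) : ℝ) ≤ Real.log 7 :=
      Real.log_le_log (by exact_mod_cast Nat.radical_pos _) (by exact_mod_cast hrad)
    have hlog2 : 0 ≤ Real.log 2 := Real.log_nonneg (by norm_num)
    push_cast
    rw [max_self, Real.log_one]
    linarith
  · obtain ⟨m, hm⟩ := exists_nat_ge (K / Real.log 7)
    refine ⟨m, ?_⟩
    have := (div_le_iff₀ hlog7).mp hm
    nlinarith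

/-! ### Consequence: the lever lives at levels `n ≥ 7` only -/

/-- **Any witness `(n, C, C')` of the lever has `n ≥ 7`** (levels `≤ 3`: floor `1`; level `4`: floor `2`;
level `5`: floor `9/5`; level `6`: floor `2` — each `≥ n/3`). -/
theorem seven_le_of_depthIneq_window {n : ℕ} {C C' : ℝ} (hC : 0 ≤ C) (h3 : 3 * C < n)
    (h : DepthIneq n C C') : 7 ≤ n := by
  have h4 := four_le_of_depthIneq_window hC h3 h
  by_contra hlt
  have hn : n = 4 ∨ n = 5 ∨ n = 6 := by omega
  rcases hn with rfl | rfl | rfl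
  · have := two_le_of_depthIneq_four_dvd (by norm_num) (dvd_refl 4) hC h
    push_cast at h3; linarith
  · exact not_depthIneq_window_five hC h3 h
  · have := two_le_of_depthIneq_six_dvd (by norm_num) (dvd_refl 6) hC h
    push_cast at h3; linarith

/-- STRENGTHENING REFUTED: the lever at some level `n ≤ 6`. -/
theorem not_stubBinomialDepthWindow_le_six :
    ¬ ∃ n : ℕ, n ≤ 6 ∧ ∃ C C' : ℝ, 0 ≤ C ∧ 3 * C < n ∧ DepthIneq n C C' := by
  rintro ⟨n, hn6, C, C', hC, h3, h⟩
  have := seven_le_of_depthIneq_window hC h3 h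
  omega

/-- What a proof of the stub must produce: a level `n ≥ 7` and a constant `C ∈ [1, n/3)`, with
`C ≥ 2` whenever `4 ∣ n` or `6 ∣ n` (and `C ≥ 9/5` at `n = 5`, moot). -/
theorem stubBinomialDepthWindow_shape (hS : StubBinomialDepthWindow) :
    ∃ n : ℕ, 7 ≤ n ∧ ∃ C C' : ℝ, 1 ≤ C ∧ 3 * C < n ∧ (4 ∣ n ∨ 6 ∣ n → 2 ≤ C) ∧ DepthIneq n C C' := by
  obtain ⟨n, C, C', hC, h3, h⟩ := hS
  refine ⟨n, seven_le_of_depthIneq_window hC h3 h, C, C', one_le_of_depthIneq hC h, h3, ?_, h⟩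
  rintro (h4 | h6)
  · exact two_le_of_depthIneq_four_dvd (by rintro rfl; norm_num at h3; linarith) h4 hC h
  · exact two_le_of_depthIneq_six_dvd (by rintro rfl; norm_num at h3; linarith) h6 hC h

end Summit.ABC.ABC.Cruxes.TowerExponentWindow.Disproof

/-! ## (d') The lever is sandwiched: `PolyABC_{κ<3/2} ⟹ stub_binomialDepthWindow ⟹ PolyABC`

The skeleton proves `ABC ⟹ lever` (level `10`, `C = 3`).  Sharper: polynomial abc with ANY exponent
`κ < 3/2` already gives the lever (`stub_of_polyAbc`), at level `n > 6κ/(3 − 2κ)` with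
`C = 2 + n·max(κ−1,0)/κ`; conversely the line's own stubs B + C give `lever ⟹ PolyABC` (some exponent).  So the
lever sits in the interval `[PolyABC_{<3/2}, PolyABC_{<∞}]` of the crux's equivalence class: it is NOT the
crux in costume (`PolyABC_{<∞} ⟹ lever` is not available), but it is at least as hard as the crux and is
implied by a very mild strengthening of it.  (With the relaxed window `2C < n` of the mutation note,
`PolyABC_{<2}` suffices.)
-/

namespace Summit.ABC.ABC.Cruxes.TowerExponentWindow.Disproof

open Literature.NumberTheory.DiophantineGeometry
open Summit.ABC.ABC.Theses.IneffectiveSubspace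

/-- Core of the sandwich `PolyABC(κ) ⟹ DepthIneq n (2 + n·max(κ−1,0)/κ) (max (log K) 0 / κ)`, in the
orientation `c₁c₂ⁿ < a₁a₂ⁿ`: apply polynomial abc to the triple `(P − Q, Q, P)` and use
`rad(P − Q) ≤ rad d · (P − Q)/d`. -/
theorem depth_core_of_polyAbc {κ K : ℝ} (hκ : 0 < κ) (hK : 0 < K)
    (hP : ∀ a b c : ℕ, IsABCTriple a b c → (c : ℝ) < K * ((rad a b c : ℕ) : ℝ) ^ κ)
    {n a₁ a₂ c₁ c₂ d : ℕ} (hn : 1 ≤ n) (ha₁ : 0 < a₁) (ha₂ : 0 < a₂) (hc₁ : 0 < c₁) (hc₂ : 0 < c₂)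
    (hcop : Nat.Coprime (a₁ * a₂) (c₁ * c₂)) (hlt : c₁ * c₂ ^ n < a₁ * a₂ ^ n) (hd : 0 < d)
    (hdvd : (d : ℤ) ∣ ((a₁ * a₂ ^ n : ℕ) : ℤ) - ((c₁ * c₂ ^ n : ℕ) : ℤ)) :
    Real.log (d : ℝ) ≤ (2 + n * (max (κ - 1) 0 / κ)) * (Real.log ((max a₁ c₁ : ℕ) : ℝ) +
      Real.log ((max a₂ c₂ : ℕ) : ℝ) + Real.log ((UniqueFactorizationMonoid.radical d : ℕ) : ℝ)) +
      max (Real.log K) 0 / κ := by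
  set P : ℕ := a₁ * a₂ ^ n with hPdef
  set Q : ℕ := c₁ * c₂ ^ n with hQdef
  have hn0 : n ≠ 0 := by omega
  have hP0 : 0 < P := by positivity
  have hQ0 : 0 < Q := by positivity
  -- `d ∣ P - Q` in `ℕ`
  obtain ⟨e, he⟩ : d ∣ P - Q := by
    have h1 : ((P - Q : ℕ) : ℤ) = (P : ℤ) - (Q : ℤ) := Nat.cast_sub hlt.le
    have h2 : (d : ℤ) ∣ ((P - Q : ℕ) : ℤ) := by rw [h1]; exact hdvd
    exact Int.natCast_dvd_natCast.mp h2
  have hD0 : 0 < P - Q := Nat.sub_pos_of_lt hlt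
  have he0 : 0 < e := by
    rcases Nat.eq_zero_or_pos e with h | h
    · rw [h, mul_zero] at he; omega
    · exact h
  -- `(P - Q, Q, P)` is an abc triple
  have hPd : P ∣ (a₁ * a₂) ^ n := by
    rw [mul_pow]; exact mul_dvd_mul (dvd_pow_self a₁ hn0) dvd_rfl
  have hQd : Q ∣ (c₁ * c₂) ^ n := by
    rw [mul_pow]; exact mul_dvd_mul (dvd_pow_self c₁ hn0) dvd_rfl
  have hPQ : Nat.Coprime P Q :=
    Nat.Coprime.coprime_dvd_left hPd (Nat.Coprime.coprime_dvd_right hQd (Nat.Coprime.pow n n hcop))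
  have hDQ : Nat.Coprime (P - Q) Q := (Nat.coprime_sub_self_left hlt.le).mpr hPQ
  have habc3 : IsABCTriple (P - Q) Q P := ⟨hD0, hQ0, Nat.sub_add_cancel hlt.le, hDQ⟩
  have hmain := hP _ _ _ habc3
  -- the radical bound in `ℕ`: `rad((P-Q)·Q·P) ≤ rad d · e · c₁c₂ · a₁a₂`
  have hDrad : UniqueFactorizationMonoid.radical (P - Q) ≤ UniqueFactorizationMonoid.radical d * e := by
    rw [he]
    calc UniqueFactorizationMonoid.radical (d * e)
        ≤ UniqueFactorizationMonoid.radical d * UniqueFactorizationMonoid.radical e :=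
          Nat.le_of_dvd (mul_pos (Nat.radical_pos _) (Nat.radical_pos _))
            UniqueFactorizationMonoid.radical_mul_dvd
      _ ≤ UniqueFactorizationMonoid.radical d * e :=
          Nat.mul_le_mul_left _ (Nat.radical_le_self_iff.mpr he0.ne')
  have hQrad : UniqueFactorizationMonoid.radical Q ≤ c₁ * c₂ :=
    radical_le_of_dvd_pow (n := n) (by positivity) hQd
  have hPrad : UniqueFactorizationMonoid.radical P ≤ a₁ * a₂ :=
    radical_le_of_dvd_pow (n := n) (by positivity) hPd
  have hradN : rad (P - Q) Q P ≤ UniqueFactorizationMonoid.radical d * e * (c₁ * c₂) * (a₁ * a₂) := by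
    rw [rad_def]
    exact (radical_mul_three_le _ _ _).trans (Nat.mul_le_mul (Nat.mul_le_mul hDrad hQrad) hPrad)
  -- real-side facts
  set R : ℝ := ((rad (P - Q) Q P : ℕ) : ℝ) with hRdef
  have hR1 : (1 : ℝ) ≤ R := by
    have h : rad (P - Q) Q P ≠ 0 := by rw [rad_def]; exact UniqueFactorizationMonoid.radical_ne_zero
    have h' : (1 : ℕ) ≤ rad (P - Q) Q P := Nat.one_le_iff_ne_zero.mpr h
    rw [hRdef]; exact_mod_cast h'
  have hR0 : 0 < R := by linarith
  have hPR : (0 : ℝ) < (P : ℝ) := by exact_mod_cast hP0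
  have hdR : (0 : ℝ) < (d : ℝ) := by exact_mod_cast hd
  have heR : (0 : ℝ) < (e : ℝ) := by exact_mod_cast he0
  have ha₁R : (0 : ℝ) < (a₁ : ℝ) := by exact_mod_cast ha₁
  have ha₂R : (0 : ℝ) < (a₂ : ℝ) := by exact_mod_cast ha₂
  have hc₁R : (0 : ℝ) < (c₁ : ℝ) := by exact_mod_cast hc₁
  have hc₂R : (0 : ℝ) < (c₂ : ℝ) := by exact_mod_cast hc₂
  have hrdR : (0 : ℝ) < ((UniqueFactorizationMonoid.radical d : ℕ) : ℝ) := by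
    exact_mod_cast Nat.radical_pos d
  -- (1) polynomial abc, logarithmically
  have h1 : Real.log (P : ℝ) < Real.log K + κ * Real.log R := by
    have h := Real.log_lt_log hPR hmain
    rwa [Real.log_mul hK.ne' (Real.rpow_pos_of_pos hR0 _).ne', Real.log_rpow hR0] at h
  -- (2) the radical bound, logarithmically
  have h2 : Real.log R ≤ Real.log ((UniqueFactorizationMonoid.radical d : ℕ) : ℝ) + Real.log (e : ℝ) +
      (Real.log (c₁ : ℝ) + Real.log (c₂ : ℝ)) + (Real.log (a₁ : ℝ) + Real.log (a₂ : ℝ)) := by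
    have hcast : R ≤ ((UniqueFactorizationMonoid.radical d : ℕ) : ℝ) * (e : ℝ) * ((c₁ : ℝ) * (c₂ : ℝ)) *
        ((a₁ : ℝ) * (a₂ : ℝ)) := by
      rw [hRdef]; exact_mod_cast hradN
    have h := Real.log_le_log hR0 hcast
    rwa [Real.log_mul (mul_pos (mul_pos hrdR heR) (mul_pos hc₁R hc₂R)).ne' (mul_pos ha₁R ha₂R).ne',
      Real.log_mul (mul_pos hrdR heR).ne' (mul_pos hc₁R hc₂R).ne', Real.log_mul hrdR.ne' heR.ne',
      Real.log_mul hc₁R.ne' hc₂R.ne', Real.log_mul ha₁R.ne' ha₂R.ne'] at h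
  -- (3) `d · e = P - Q ≤ P`
  have h3 : Real.log (d : ℝ) + Real.log (e : ℝ) ≤ Real.log (P : ℝ) := by
    have hDP : ((P - Q : ℕ) : ℝ) ≤ (P : ℝ) := by exact_mod_cast Nat.sub_le P Q
    have hDe : ((P - Q : ℕ) : ℝ) = (d : ℝ) * (e : ℝ) := by rw [he]; push_cast; ring
    have h := Real.log_le_log (by rw [hDe]; positivity) hDP
    rwa [hDe, Real.log_mul hdR.ne' heR.ne'] at h
  -- (4) heights
  have h4 : Real.log (P : ℝ) = Real.log (a₁ : ℝ) + n * Real.log (a₂ : ℝ) := by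
    have : (P : ℝ) = (a₁ : ℝ) * (a₂ : ℝ) ^ n := by rw [hPdef]; push_cast; ring
    rw [this, Real.log_mul ha₁R.ne' (pow_pos ha₂R n).ne', Real.log_pow]
  have h5a : Real.log (a₁ : ℝ) ≤ Real.log ((max a₁ c₁ : ℕ) : ℝ) :=
    Real.log_le_log ha₁R (by exact_mod_cast le_max_left a₁ c₁)
  have h5c : Real.log (c₁ : ℝ) ≤ Real.log ((max a₁ c₁ : ℕ) : ℝ) :=
    Real.log_le_log hc₁R (by exact_mod_cast le_max_right a₁ c₁)
  have h6a : Real.log (a₂ : ℝ) ≤ Real.log ((max a₂ c₂ : ℕ) : ℝ) :=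
    Real.log_le_log ha₂R (by exact_mod_cast le_max_left a₂ c₂)
  have h6c : Real.log (c₂ : ℝ) ≤ Real.log ((max a₂ c₂ : ℕ) : ℝ) :=
    Real.log_le_log hc₂R (by exact_mod_cast le_max_right a₂ c₂)
  have h9 : 0 ≤ Real.log ((UniqueFactorizationMonoid.radical d : ℕ) : ℝ) :=
    Real.log_nonneg (by exact_mod_cast Nat.succ_le_of_lt (Nat.radical_pos d))
  have h10 : 0 ≤ Real.log (a₁ : ℝ) := Real.log_nonneg (by exact_mod_cast ha₁)
  have h11 : 0 ≤ Real.log (a₂ : ℝ) := Real.log_nonneg (by exact_mod_cast ha₂)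
  have hm1 : Real.log K ≤ max (Real.log K) 0 := le_max_left _ _
  have hn1 : (1 : ℝ) ≤ n := by exact_mod_cast hn
  -- abbreviations
  set H1 : ℝ := Real.log ((max a₁ c₁ : ℕ) : ℝ) with hH1
  set H2 : ℝ := Real.log ((max a₂ c₂ : ℕ) : ℝ) with hH2
  set Lr : ℝ := Real.log ((UniqueFactorizationMonoid.radical d : ℕ) : ℝ) with hLr
  set LP : ℝ := Real.log (P : ℝ) with hLP
  set μ : ℝ := max (κ - 1) 0 with hμ
  have hμ0 : 0 ≤ μ := le_max_right _ _
  have hH1n : 0 ≤ H1 := h10.trans h5a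
  have hH2n : 0 ≤ H2 := h11.trans h6a
  have hLP0 : 0 ≤ LP := by
    rw [h4]; have : 0 ≤ (n : ℝ) * Real.log (a₂ : ℝ) := by positivity
    linarith
  have hLPle : LP ≤ H1 + n * H2 := by
    rw [h4]
    have : (n : ℝ) * Real.log (a₂ : ℝ) ≤ n * H2 := mul_le_mul_of_nonneg_left h6a (by positivity)
    linarith
  -- products
  have sA : Real.log R ≤ Lr + Real.log (e : ℝ) + 2 * H1 + 2 * H2 := by linarith
  have sB : κ * Real.log R ≤ κ * (Lr + Real.log (e : ℝ) + 2 * H1 + 2 * H2) :=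
    mul_le_mul_of_nonneg_left sA hκ.le
  have c1 : κ * (Real.log (d : ℝ) + Real.log (e : ℝ)) ≤ κ * LP := mul_le_mul_of_nonneg_left h3 hκ.le
  have hμP : (κ - 1) * LP ≤ μ * (H1 + n * H2) := by
    rcases le_or_gt κ 1 with hk | hk
    · have h0 : (κ - 1) * LP ≤ 0 := mul_nonpos_of_nonpos_of_nonneg (by linarith) hLP0
      have h0' : 0 ≤ μ * (H1 + n * H2) := by positivity
      linarith
    · have hμe : μ = κ - 1 := max_eq_left (by linarith)
      rw [hμe]; exact mul_le_mul_of_nonneg_left hLPle (by linarith)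
  have hμn : μ * (H1 + n * H2) ≤ μ * (n * (H1 + H2)) := by
    refine mul_le_mul_of_nonneg_left ?_ hμ0
    have : H1 ≤ n * H1 := le_mul_of_one_le_left hH1n hn1
    linarith
  have hμLr : 0 ≤ μ * (n * Lr) := by positivity
  have hκLr : 0 ≤ κ * Lr := by positivity
  -- conclude: κ · log d ≤ (2κ + nμ)·(H1 + H2 + Lr) + max (log K) 0, then divide by κ
  have hfin : κ * Real.log (d : ℝ) ≤ (2 * κ + n * μ) * (H1 + H2 + Lr) + max (Real.log K) 0 := by
    linarith
  have hgoal : κ * Real.log (d : ℝ) ≤ κ * ((2 + n * (μ / κ)) * (H1 + H2 + Lr) + max (Real.log K) 0 / κ) := by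
    have e : κ * ((2 + n * (μ / κ)) * (H1 + H2 + Lr) + max (Real.log K) 0 / κ)
        = (2 * κ + n * μ) * (H1 + H2 + Lr) + max (Real.log K) 0 := by
      field_simp
    rw [e]; exact hfin
  exact le_of_mul_le_mul_left hgoal hκ


/-- `PolyABC(κ, K)` (`0 < κ`) gives the depth inequality at EVERY level `n ≥ 1`, with
`C = 2 + n·max(κ−1,0)/κ`, `C' = max (log K) 0 / κ`. -/
theorem depthIneq_of_polyAbc {κ K : ℝ} (hκ : 0 < κ) (hK : 0 < K)
    (hP : ∀ a b c : ℕ, IsABCTriple a b c → (c : ℝ) < K * ((rad a b c : ℕ) : ℝ) ^ κ) {n : ℕ} (hn : 1 ≤ n) :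
    DepthIneq n (2 + n * (max (κ - 1) 0 / κ)) (max (Real.log K) 0 / κ) := by
  intro a₁ a₂ c₁ c₂ ha₁ ha₂ hc₁ hc₂ hcop hne d hd hdvd
  rcases Nat.lt_or_gt_of_ne hne with hlt | hlt
  · have h := depth_core_of_polyAbc hκ hK hP hn hc₁ hc₂ ha₁ ha₂ hcop.symm hlt hd (dvd_sub_comm.mp hdvd)
    rwa [max_comm c₁ a₁, max_comm c₂ a₂] at h
  · exact depth_core_of_polyAbc hκ hK hP hn ha₁ ha₂ hc₁ hc₂ hcop hlt hd hdvd

/-- **Polynomial abc with any exponent `κ < 3/2` implies the lever** `stub_binomialDepthWindow`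
(level `n = ⌈6κ/(3−2κ)⌉ + 1`-ish, `C = 2 + n·max(κ−1,0)/κ < n/3`). -/
theorem stub_of_polyAbc {κ K : ℝ} (hκ : 0 < κ) (hκ3 : κ < 3 / 2) (hK : 0 < K)
    (hP : ∀ a b c : ℕ, IsABCTriple a b c → (c : ℝ) < K * ((rad a b c : ℕ) : ℝ) ^ κ) :
    StubBinomialDepthWindow := by
  set θ : ℝ := max (κ - 1) 0 / κ with hθ
  have hθ0 : 0 ≤ θ := div_nonneg (le_max_right _ _) hκ.le
  have hθ3 : θ < 1 / 3 := by
    rw [hθ, div_lt_iff₀ hκ]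
    rcases le_or_gt κ 1 with hk | hk
    · rw [max_eq_right (by linarith)]; linarith
    · rw [max_eq_left (by linarith)]; linarith
  have hg : 0 < 1 - 3 * θ := by linarith
  obtain ⟨n, hn⟩ := exists_nat_gt (6 / (1 - 3 * θ))
  have hn6 : 6 < (n : ℝ) * (1 - 3 * θ) := (div_lt_iff₀ hg).mp hn
  have hn1 : 1 ≤ n := by
    rcases Nat.eq_zero_or_pos n with h0 | h0
    · subst h0; norm_num at hn6
    · exact h0
  refine ⟨n, 2 + n * θ, max (Real.log K) 0 / κ, by positivity, by nlinarith, ?_⟩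
  exact depthIneq_of_polyAbc hκ hK hP hn1

/-- In particular `ABC ⟹ lever` (abc at `ε = 1/4`, `κ = 5/4 < 3/2`) — the skeleton's
`binomialDepthWindow_of_abc` recovered from the general sandwich. -/
theorem stub_of_abc (habc : ABC) : StubBinomialDepthWindow := by
  obtain ⟨K, hK, hall⟩ := habc ((1 : ℝ) / 4) (by norm_num)
  exact stub_of_polyAbc (κ := 1 + 1 / 4) (by norm_num) (by norm_num) hK hall

/-! ## (a') `ε` is decorative in the crux

Unlike abc itself (`Literature.Barriers.ABC.EpsilonCannotBeDropped`), the crux loses nothing when the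
`∀ ε > 0 ∃ C(ε)` is replaced by a single exponent and constant: both sides are polynomial abc. -/

/-- **`TowerExponentWindow` ↔ its `ε`-free form** `∃ n ≥ 1, ∃ A ∈ (0, n/3), ∃ C > 0, c < C·Π^A`. -/
theorem towerExponentWindow_iff_epsFree :
    TowerExponentWindow ↔ ∃ n : ℕ, 1 ≤ n ∧ ∃ A : ℝ, 0 < A ∧ 3 * A < n ∧ ∃ C : ℝ, 0 < C ∧
      ∀ x y z : Fin n → ℕ, (∀ i, 0 < x i ∧ 0 < y i ∧ 0 < z i) →
      (∏ i, x i ^ (i.val + 1)) + (∏ i, y i ^ (i.val + 1)) = ∏ i, z i ^ (i.val + 1) →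
      Nat.Coprime (∏ i, x i ^ (i.val + 1)) (∏ i, y i ^ (i.val + 1)) →
      ((∏ i, z i ^ (i.val + 1) : ℕ) : ℝ) < C * ((∏ i, x i * y i * z i : ℕ) : ℝ) ^ A := by
  constructor
  · intro h
    obtain ⟨κ, K, hK, hP⟩ := towerExponentWindow_iff_polyAbc.mp h
    obtain ⟨n, hn⟩ := exists_nat_gt (3 * (|κ| + 1))
    have hnpos : (0:ℝ) < n := by linarith [abs_nonneg κ]
    have hn1 : 1 ≤ n := Nat.one_le_iff_ne_zero.mpr (by rintro rfl; simp at hnpos)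
    refine ⟨n, hn1, |κ| + 1, by positivity, hn, K, hK, fun x y z hpos heq hcop => ?_⟩
    have ha : 0 < ∏ i, x i ^ (i.val + 1) := Finset.prod_pos fun i _ => pow_pos (hpos i).1 _
    have hb : 0 < ∏ i, y i ^ (i.val + 1) := Finset.prod_pos fun i _ => pow_pos (hpos i).2.1 _
    have h1 := hP _ _ _ ⟨ha, hb, heq, hcop⟩
    have hrad1 : (1:ℝ) ≤ ((rad (∏ i, x i ^ (i.val + 1)) (∏ i, y i ^ (i.val + 1))
        (∏ i, z i ^ (i.val + 1)) : ℕ) : ℝ) := by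
      exact_mod_cast Nat.radical_pos _
    have hradle' : ((rad (∏ i, x i ^ (i.val + 1)) (∏ i, y i ^ (i.val + 1))
        (∏ i, z i ^ (i.val + 1)) : ℕ) : ℝ) ≤ ((∏ i, x i * y i * z i : ℕ) : ℝ) := by
      exact_mod_cast rad_le_tower x y z hpos
    calc _ < _ := h1
      _ ≤ K * ((rad (∏ i, x i ^ (i.val + 1)) (∏ i, y i ^ (i.val + 1))
        (∏ i, z i ^ (i.val + 1)) : ℕ) : ℝ) ^ (|κ| + 1) := by
          refine mul_le_mul_of_nonneg_left ?_ hK.le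
          exact Real.rpow_le_rpow_of_exponent_le hrad1 (by linarith [le_abs_self κ])
      _ ≤ K * ((∏ i, x i * y i * z i : ℕ) : ℝ) ^ (|κ| + 1) := by
          refine mul_le_mul_of_nonneg_left ?_ hK.le
          exact Real.rpow_le_rpow (by positivity) hradle' (by linarith [abs_nonneg κ])
  · rintro ⟨n, hn, A, hA, h3, C, hC, hall⟩
    refine ⟨n, hn, A, hA, h3, fun ε hε => ⟨C, hC, fun x y z hp he hc => ?_⟩⟩
    have h1 := hall x y z hp he hc
    have hP1 : (1 : ℝ) ≤ ((∏ i, x i * y i * z i : ℕ) : ℝ) := by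
      have : 0 < ∏ i, x i * y i * z i :=
        Finset.prod_pos fun i _ => Nat.mul_pos (Nat.mul_pos (hp i).1 (hp i).2.1) (hp i).2.2
      exact_mod_cast this
    calc _ < _ := h1
      _ ≤ C * ((∏ i, x i * y i * z i : ℕ) : ℝ) ^ (A + ε) :=
          mul_le_mul_of_nonneg_left (Real.rpow_le_rpow_of_exponent_le hP1 (by linarith)) hC.le

end Summit.ABC.ABC.Cruxes.TowerExponentWindow.Disproof

/-! ## (d'') Hypothesis mutation on stub B: the window `3C < n` relaxes to `2C < n`

The registered `stub_flatBoundOfDepth` consumes the lever only through two applications of the depth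
inequality; with `wZⁿ ≤ 2·max(uXⁿ, vYⁿ)` in place of `wZⁿ ≤ 2uXⁿ·vYⁿ` the elimination closes under
`2C < n` (`flatBound_of_depthIneq_two`), which contains the registered stub B verbatim
(`stub_flatBoundOfDepth_candidate` — a candidate proof for the lead; positive Lines content, offered as
evidence, not landed by the refuter).  Consequence for the line: stub A may be RESHAPED to the weaker
`∃ n C C', 0 ≤ C ∧ 2C < n ∧ DepthIneq n C C'` without touching C; with the floors of section (d) the
reshaped lever lives from level `5` on (`C ≥ 9/5`, `2C < 5`) instead of `7`, and is implied by
`PolyABC_{κ<2}` (same computation as `stub_of_polyAbc` with `4 + 2nθ < n`).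
-/

namespace Summit.ABC.ABC.Cruxes.TowerExponentWindow.Disproof

open Literature.NumberTheory.DiophantineGeometry (radical_le_of_dvd_pow)

/-- Verbatim copy of the skeleton's `FlatBound n` (Vojta's `D = 0` inequality at level `n`). -/
def FlatBound (n : ℕ) : Prop :=
  ∃ κ K : ℝ, ∀ u v w X Y Z : ℕ, 0 < u → 0 < v → 0 < w → 0 < X → 0 < Y → 0 < Z →
    u * X ^ n + v * Y ^ n = w * Z ^ n → Nat.Coprime (u * X ^ n) (v * Y ^ n) →
      ((w * Z ^ n : ℕ) : ℝ) ≤ K * ((u * v * w : ℕ) : ℝ) ^ κ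

/-- One application of the depth inequality to a flat point, at `(a₁,a₂,c₁,c₂) = (v, Y, w, Z)`, `d = uXⁿ`:
`n(n − C)·log X ≤ 2nC·H + C·ℓ + n·max C' 0` with `H = log(uvw)`, `ℓ = log(wZⁿ)`. -/
theorem depth_apply_flat {n : ℕ} {C C' : ℝ} (hC : 0 ≤ C) (hn : 1 ≤ n) (h : DepthIneq n C C')
    {u v w X Y Z : ℕ} (hu : 0 < u) (hv : 0 < v) (hw : 0 < w) (hX : 0 < X) (hY : 0 < Y) (hZ : 0 < Z)
    (heq : u * X ^ n + v * Y ^ n = w * Z ^ n) (hcop : Nat.Coprime (u * X ^ n) (v * Y ^ n)) :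
    (n : ℝ) * ((n - C) * Real.log (X : ℝ)) ≤ 2 * n * C * Real.log ((u * v * w : ℕ) : ℝ) +
      C * Real.log ((w * Z ^ n : ℕ) : ℝ) + n * max C' 0 := by
  have hn0 : n ≠ 0 := by omega
  -- hypotheses of the depth inequality at (v, Y, w, Z), d = u Xⁿ
  have hcop' : Nat.Coprime (v * Y) (w * Z) := by
    -- gcd(vYⁿ, wZⁿ) = gcd(vYⁿ, uXⁿ + vYⁿ) = gcd(vYⁿ, uXⁿ) = 1
    have h1 : Nat.Coprime (v * Y ^ n) (w * Z ^ n) := by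
      rw [← heq]; exact Nat.coprime_add_self_right.mpr hcop.symm
    have h2 : Nat.Coprime (v * Y) (w * Z ^ n) :=
      Nat.Coprime.coprime_dvd_left (mul_dvd_mul_left v (dvd_pow_self Y hn0)) h1
    exact Nat.Coprime.coprime_dvd_right (mul_dvd_mul_left w (dvd_pow_self Z hn0)) h2
  have hne : v * Y ^ n ≠ w * Z ^ n := by
    intro he; have : 0 < u * X ^ n := by positivity
    omega
  have hd : 0 < u * X ^ n := by positivity
  have hdvd : ((u * X ^ n : ℕ) : ℤ) ∣ ((v * Y ^ n : ℕ) : ℤ) - ((w * Z ^ n : ℕ) : ℤ) := by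
    refine ⟨-1, ?_⟩
    have : ((w * Z ^ n : ℕ) : ℤ) = ((u * X ^ n : ℕ) : ℤ) + ((v * Y ^ n : ℕ) : ℤ) := by exact_mod_cast heq.symm
    rw [this]; ring
  have key := h v Y w Z hv hY hw hZ hcop' hne (u * X ^ n) hd hdvd
  -- real-side bounds
  have huR : (0:ℝ) < u := by exact_mod_cast hu
  have hvR : (0:ℝ) < v := by exact_mod_cast hv
  have hwR : (0:ℝ) < w := by exact_mod_cast hw
  have hXR : (0:ℝ) < X := by exact_mod_cast hX
  have hYR : (0:ℝ) < Y := by exact_mod_cast hY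
  have hZR : (0:ℝ) < Z := by exact_mod_cast hZ
  set H : ℝ := Real.log ((u * v * w : ℕ) : ℝ) with hH
  set ℓ : ℝ := Real.log ((w * Z ^ n : ℕ) : ℝ) with hℓ
  -- (i) log max(v,w) ≤ H
  have h1 : Real.log ((max v w : ℕ) : ℝ) ≤ H := by
    have hle : max v w ≤ u * v * w := by
      rcases le_total v w with hvw | hvw
      · rw [max_eq_right hvw]; exact Nat.le_mul_of_pos_left w (by positivity)
      · rw [max_eq_left hvw]
        calc v ≤ u * v := Nat.le_mul_of_pos_left v hu
          _ ≤ u * v * w := Nat.le_mul_of_pos_right _ hw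
    exact Real.log_le_log (by positivity) (by exact_mod_cast hle)
  -- (ii) n log max(Y,Z) ≤ ℓ
  have h2 : (n : ℝ) * Real.log ((max Y Z : ℕ) : ℝ) ≤ ℓ := by
    have hle : (max Y Z) ^ n ≤ w * Z ^ n := by
      rcases le_total Y Z with hyz | hyz
      · rw [max_eq_right hyz]; exact Nat.le_mul_of_pos_left _ hw
      · rw [max_eq_left hyz]
        calc Y ^ n ≤ v * Y ^ n := Nat.le_mul_of_pos_left _ hv
          _ ≤ u * X ^ n + v * Y ^ n := Nat.le_add_left _ _
          _ = w * Z ^ n := heq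
    have hle' : (((max Y Z : ℕ) : ℝ)) ^ n ≤ ((w * Z ^ n : ℕ) : ℝ) := by exact_mod_cast hle
    have := Real.log_le_log (by positivity) hle'
    rwa [Real.log_pow] at this
  -- (iii) log rad(uXⁿ) ≤ log u + log X
  have h3 : Real.log ((UniqueFactorizationMonoid.radical (u * X ^ n) : ℕ) : ℝ) ≤
      Real.log (u : ℝ) + Real.log (X : ℝ) := by
    have hle : UniqueFactorizationMonoid.radical (u * X ^ n) ≤ u * X := by
      refine radical_le_of_dvd_pow (n := n) (by positivity) ?_
      rw [mul_pow]; exact mul_dvd_mul (dvd_pow_self u hn0) dvd_rfl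
    have hpos : (0:ℝ) < ((UniqueFactorizationMonoid.radical (u * X ^ n) : ℕ) : ℝ) := by
      exact_mod_cast Nat.radical_pos _
    have hle' : ((UniqueFactorizationMonoid.radical (u * X ^ n) : ℕ) : ℝ) ≤ ((u * X : ℕ) : ℝ) := by
      exact_mod_cast hle
    have := Real.log_le_log hpos hle'
    rwa [Nat.cast_mul, Real.log_mul huR.ne' hXR.ne'] at this
  -- (iv) log d = log u + n log X, log u ≥ 0, log u ≤ H
  have h4 : Real.log ((u * X ^ n : ℕ) : ℝ) = Real.log (u : ℝ) + n * Real.log (X : ℝ) := by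
    push_cast; rw [Real.log_mul huR.ne' (pow_pos hXR n).ne', Real.log_pow]
  have hu0 : 0 ≤ Real.log (u : ℝ) := Real.log_nonneg (by exact_mod_cast hu)
  have huH : Real.log (u : ℝ) ≤ H := by
    have hle : u ≤ u * v * w := by
      calc u ≤ u * v := Nat.le_mul_of_pos_right u hv
        _ ≤ u * v * w := Nat.le_mul_of_pos_right _ hw
    exact Real.log_le_log huR (by exact_mod_cast hle)
  have hX0 : 0 ≤ Real.log (X : ℝ) := Real.log_nonneg (by exact_mod_cast hX)
  have hC' : C' ≤ max C' 0 := le_max_left _ _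
  have hnR : (1:ℝ) ≤ n := by exact_mod_cast hn
  -- combine: key : log u + n log X ≤ C (log max(v,w) + log max(Y,Z) + log rad) + C'
  rw [h4] at key
  -- multiply by n and use n·log max(Y,Z) ≤ ℓ
  have k1 : (n : ℝ) * (C * Real.log ((max Y Z : ℕ) : ℝ)) ≤ C * ℓ := by
    have := mul_le_mul_of_nonneg_left h2 hC; linarith
  have k2 : C * Real.log ((max v w : ℕ) : ℝ) ≤ C * H := mul_le_mul_of_nonneg_left h1 hC
  have k3 : C * Real.log ((UniqueFactorizationMonoid.radical (u * X ^ n) : ℕ) : ℝ) ≤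
      C * H + C * Real.log (X : ℝ) := by
    have := mul_le_mul_of_nonneg_left h3 hC; linarith [mul_le_mul_of_nonneg_left huH hC]
  have k4 : (n : ℝ) * (Real.log (u : ℝ) + n * Real.log (X : ℝ)) ≤
      n * (C * (Real.log ((max v w : ℕ) : ℝ) + Real.log ((max Y Z : ℕ) : ℝ) +
        Real.log ((UniqueFactorizationMonoid.radical (u * X ^ n) : ℕ) : ℝ)) + C') :=
    mul_le_mul_of_nonneg_left key (by positivity)
  have k5 : (n : ℝ) * (C * H) ≤ n * (C * H) := le_rfl
  have k6 : 0 ≤ (n : ℝ) * Real.log (u : ℝ) := by positivity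
  have k7 : (n : ℝ) * C' ≤ n * max C' 0 := mul_le_mul_of_nonneg_left hC' (by positivity)
  have k8 : (n : ℝ) * (C * H) + n * (C * H) = 2 * n * C * H := by ring
  nlinarith [mul_le_mul_of_nonneg_left k2 (by positivity : (0:ℝ) ≤ n),
    mul_le_mul_of_nonneg_left k3 (by positivity : (0:ℝ) ≤ n)]


/-- **Stub B with the RELAXED window `2C < n`** (the registered stub has `3C < n`): the depth inequality at
level `n` with `0 ≤ C < n/2` gives Vojta's flat bound `wZⁿ ≤ K·(uvw)^κ`, `κ = (n − C + 2nC)/(n − 2C)`,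
`K = exp(((n − C) log 2 + n·max C' 0)/(n − 2C))`.  The gain over the skeleton's bookkeeping: step (4) uses
`wZⁿ ≤ 2·max(uXⁿ, vYⁿ)` instead of `wZⁿ ≤ 2·uXⁿ·vYⁿ`. -/
theorem flatBound_of_depthIneq_two {n : ℕ} {C C' : ℝ} (hC : 0 ≤ C) (h2 : 2 * C < n)
    (h : DepthIneq n C C') : FlatBound n := by
  have hnpos : (0:ℝ) < n := by linarith
  have hn : 1 ≤ n := by exact_mod_cast (show (0:ℕ) < n by exact_mod_cast hnpos)
  have hg : 0 < (n : ℝ) - 2 * C := by linarith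
  have hnC : 0 < (n : ℝ) - C := by linarith
  set A₀ : ℝ := (((n : ℝ) - C) * Real.log 2 + n * max C' 0) / ((n : ℝ) - 2 * C) with hA₀
  set κ : ℝ := ((n : ℝ) - C + 2 * n * C) / ((n : ℝ) - 2 * C) with hκ
  refine ⟨κ, Real.exp A₀, fun u v w X Y Z hu hv hw hX hY hZ heq hcop => ?_⟩
  have huR : (0:ℝ) < u := by exact_mod_cast hu
  have hvR : (0:ℝ) < v := by exact_mod_cast hv
  have hwR : (0:ℝ) < w := by exact_mod_cast hw
  have hXR : (0:ℝ) < X := by exact_mod_cast hX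
  have hYR : (0:ℝ) < Y := by exact_mod_cast hY
  have hZR : (0:ℝ) < Z := by exact_mod_cast hZ
  set H : ℝ := Real.log ((u * v * w : ℕ) : ℝ) with hH
  set ℓ : ℝ := Real.log ((w * Z ^ n : ℕ) : ℝ) with hℓ
  have hP0 : (0:ℝ) < ((u * v * w : ℕ) : ℝ) := by positivity
  have hH0 : 0 ≤ H := Real.log_nonneg (by exact_mod_cast (show 1 ≤ u * v * w by
    calc 1 ≤ u := hu
      _ ≤ u * v := Nat.le_mul_of_pos_right u hv
      _ ≤ u * v * w := Nat.le_mul_of_pos_right _ hw))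
  -- the two applications of the depth inequality
  have bX := depth_apply_flat hC hn h hu hv hw hX hY hZ heq hcop
  have bY := depth_apply_flat hC hn h hv hu hw hY hX hZ (by rw [← heq]; ring) hcop.symm
  have eH : Real.log ((v * u * w : ℕ) : ℝ) = H := by rw [hH, mul_comm v u]
  rw [eH] at bY
  -- step (4): ℓ ≤ log 2 + H + n log(max coordinate), in two cases
  have hvH : Real.log (v : ℝ) ≤ H := by
    refine Real.log_le_log hvR ?_
    exact_mod_cast (show v ≤ u * v * w from
      (Nat.le_mul_of_pos_left v hu).trans (Nat.le_mul_of_pos_right _ hw))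
  have huH : Real.log (u : ℝ) ≤ H := by
    refine Real.log_le_log huR ?_
    exact_mod_cast (show u ≤ u * v * w from
      (Nat.le_mul_of_pos_right u hv).trans (Nat.le_mul_of_pos_right _ hw))
  have main : ((n : ℝ) - 2 * C) * ℓ ≤ ((n : ℝ) - C) * Real.log 2 + ((n : ℝ) - C + 2 * n * C) * H +
      n * max C' 0 := by
    rcases le_total (u * X ^ n) (v * Y ^ n) with hle | hle
    · -- wZⁿ ≤ 2 v Yⁿ
      have h4 : ℓ ≤ Real.log 2 + H + n * Real.log (Y : ℝ) := by
        have hle2 : ((w * Z ^ n : ℕ) : ℝ) ≤ 2 * ((v : ℝ) * (Y : ℝ) ^ n) := by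
          have : w * Z ^ n ≤ 2 * (v * Y ^ n) := by rw [← heq]; omega
          exact_mod_cast this
        have := Real.log_le_log (by positivity) hle2
        rw [Real.log_mul (by norm_num) (by positivity), Real.log_mul hvR.ne' (by positivity),
          Real.log_pow] at this
        rw [hℓ]; linarith
      have k := mul_le_mul_of_nonneg_left h4 hnC.le
      nlinarith
    · have h4 : ℓ ≤ Real.log 2 + H + n * Real.log (X : ℝ) := by
        have hle2 : ((w * Z ^ n : ℕ) : ℝ) ≤ 2 * ((u : ℝ) * (X : ℝ) ^ n) := by
          have : w * Z ^ n ≤ 2 * (u * X ^ n) := by rw [← heq]; omega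
          exact_mod_cast this
        have := Real.log_le_log (by positivity) hle2
        rw [Real.log_mul (by norm_num) (by positivity), Real.log_mul huR.ne' (by positivity),
          Real.log_pow] at this
        rw [hℓ]; linarith
      have k := mul_le_mul_of_nonneg_left h4 hnC.le
      nlinarith
  -- divide and exponentiate
  have hℓle : ℓ ≤ A₀ + κ * H := by
    rw [hA₀, hκ, div_mul_eq_mul_div, ← add_div, le_div_iff₀ hg]
    linarith
  have hexp : ((w * Z ^ n : ℕ) : ℝ) = Real.exp ℓ := by
    rw [hℓ, Real.exp_log (by positivity)]
  rw [hexp, Real.rpow_def_of_pos hP0, ← hH, ← Real.exp_add]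
  exact Real.exp_le_exp.mpr (by linarith [mul_comm κ H])

/-- Hence the registered stub B verbatim (window `3C < n ⟹ 2C < n`): a CANDIDATE PROOF of
`stub_flatBoundOfDepth` for the lead (positive Lines content: not landed by the refuter, offered as evidence). -/
theorem stub_flatBoundOfDepth_candidate : ∀ n : ℕ, ∀ C C' : ℝ, 0 ≤ C → 3 * C < n → (∀ a₁ a₂ c₁ c₂ : ℕ, 0 < a₁ → 0 < a₂ → 0 < c₁ → 0 < c₂ → Nat.Coprime (a₁ * a₂) (c₁ * c₂) → a₁ * a₂ ^ n ≠ c₁ * c₂ ^ n → ∀ d : ℕ, 0 < d → (d : ℤ) ∣ ((a₁ * a₂ ^ n : ℕ) : ℤ) - ((c₁ * c₂ ^ n : ℕ) : ℤ) → Real.log (d : ℝ) ≤ C * (Real.log ((max a₁ c₁ : ℕ) : ℝ) + Real.log ((max a₂ c₂ : ℕ) : ℝ) + Real.log ((UniqueFactorizationMonoid.radical d : ℕ) : ℝ)) + C') → ∃ κ K : ℝ, ∀ u v w X Y Z : ℕ, 0 < u → 0 < v → 0 < w → 0 < X → 0 < Y → 0 < Z → u * X ^ n + v * Y ^ n = w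 * Z ^ n → Nat.Coprime (u * X ^ n) (v * Y ^ n) → ((w * Z ^ n : ℕ) : ℝ) ≤ K * ((u * v * w : ℕ) : ℝ) ^ κ :=
  fun _n _C _C' hC h3 h => flatBound_of_depthIneq_two hC (by linarith) h

end Summit.ABC.ABC.Cruxes.TowerExponentWindow.Disproof

/-! ## (d‴) The Padé family at every odd level: `C ≥ 2 − 1/n`

General form of the level-`5` computation of section (d): with `f_n(X) = Σ_{k<n} C(2n−1,k)(−X)^k` and
`g_n(X) = Σ_{i<n} C(2n−1,n+i) Xⁱ (−1)^(n−1−i)` one has `Xⁿ g_n(X) − f_n(X) = (X − 1)^(2n−1)`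
(`pade_identity_gen`, the split of the binomial expansion of `(X − 1)^(2n−1)` at `k = n`), `f_n(X) ≥ 1` for
odd `n` and `X ≥ 1` (`one_le_padeF`, pairing consecutive terms), whence the admissible data
`(g_n(t+1), t+1, f_n(t+1), 1; d = t^(2n−1))`, `t = q^(j+1)`, `q` a prime `> f_n(1)`, and the floor
`two_sub_inv_le_of_depthIneq_odd : DepthIneq n C C' → 2 − 1/n ≤ C` for every odd `n`.  For EVEN `n` the same
identity has `g_n(X) > 0 > −f_n(X)`-type sign patterns at every positive point (one of `f_n(ρ), f_n(1/ρ)` is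
negative for `ρ > 0` since the terms of `f_n` alternate with increasing size beyond `(n−1)/(n+1)`), so no
positive specialisation exists — consistent with the floors `2` obtained there from norm forms instead.
-/

namespace Summit.ABC.ABC.Cruxes.TowerExponentWindow.Disproof

open Literature.NumberTheory.DiophantineGeometry (radical_le_of_dvd_pow)
open Finset

/-- `f_n(X) = Σ_{k<n} C(2n−1, k)·(−X)^k` — the truncation of `(1 − X)^(2n−1)` to degree `< n`
(`= Q(1, X)` for the Padé form `Q`). -/
def padeF (n : ℕ) (X : ℤ) : ℤ := ∑ k ∈ range n, (Nat.choose (2 * n - 1) k : ℤ) * (-X) ^ k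

/-- `g_n(X) = Σ_{i<n} C(2n−1, n+i)·X^i·(−1)^(n−1−i)` (`= Q(X, 1)`). -/
def padeG (n : ℕ) (X : ℤ) : ℤ :=
  ∑ i ∈ range n, (Nat.choose (2 * n - 1) (n + i) : ℤ) * X ^ i * (-1) ^ (n - 1 - i)

/-- **The Padé identity** `Xⁿ·g_n(X) − f_n(X) = (X − 1)^(2n−1)` (`n ≥ 1`): split the binomial expansion of
`(X + (−1))^(2n−1)` at `k = n`. -/
theorem pade_identity_gen {n : ℕ} (hn : 1 ≤ n) (X : ℤ) :
    X ^ n * padeG n X - padeF n X = (X - 1) ^ (2 * n - 1) := by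
  have hN : 2 * n - 1 + 1 = n + n := by omega
  rw [sub_eq_add_neg X 1, add_pow, hN, Finset.sum_range_add]
  -- low part = -f, high part = Xⁿ g
  have hlow : ∑ k ∈ range n, X ^ k * (-1) ^ (2 * n - 1 - k) * (Nat.choose (2 * n - 1) k : ℤ)
      = - padeF n X := by
    unfold padeF
    rw [← Finset.sum_neg_distrib]
    refine Finset.sum_congr rfl fun k hk => ?_
    rw [Finset.mem_range] at hk
    have e : 2 * n - 1 - k = 2 * (n - 1 - k) + (k + 1) := by omega
    rw [e, pow_add, pow_mul, neg_one_sq, one_pow, one_mul, neg_pow X k]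
    ring
  have hhigh : ∑ i ∈ range n, X ^ (n + i) * (-1) ^ (2 * n - 1 - (n + i)) * (Nat.choose (2 * n - 1) (n + i) : ℤ)
      = X ^ n * padeG n X := by
    unfold padeG
    rw [Finset.mul_sum]
    refine Finset.sum_congr rfl fun i hi => ?_
    rw [Finset.mem_range] at hi
    have e : 2 * n - 1 - (n + i) = n - 1 - i := by omega
    rw [e, pow_add]
    ring
  rw [hlow, hhigh]; ring

/-- `f_n(0) = 1`-type divisibility: `X ∣ f_n(X) − 1` (`n ≥ 1`). -/
theorem dvd_padeF_sub_one {n : ℕ} (hn : 1 ≤ n) (X : ℤ) : X ∣ padeF n X - 1 := by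
  unfold padeF
  obtain ⟨m, rfl⟩ : ∃ m, n = m + 1 := ⟨n - 1, by omega⟩
  rw [Finset.sum_range_succ']
  simp only [pow_zero, mul_one, Nat.choose_zero_right, Nat.cast_one, add_sub_cancel_right]
  refine Finset.dvd_sum fun k _ => ?_
  exact dvd_mul_of_dvd_right ((dvd_neg.mpr (dvd_refl X)).trans (dvd_pow_self (-X) (Nat.succ_ne_zero k))) _

/-- `(X − 1) ∣ f_n(X) − f_n(1)`. -/
theorem sub_one_dvd_padeF_sub (n : ℕ) (X : ℤ) : X - 1 ∣ padeF n X - padeF n 1 := by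
  unfold padeF
  rw [← Finset.sum_sub_distrib]
  refine Finset.dvd_sum fun k _ => ?_
  have h1 : X - 1 ∣ X ^ k - 1 := by simpa using sub_dvd_pow_sub_pow X 1 k
  have e : (Nat.choose (2 * n - 1) k : ℤ) * (-X) ^ k - (Nat.choose (2 * n - 1) k : ℤ) * (-1) ^ k
      = (Nat.choose (2 * n - 1) k : ℤ) * (-1) ^ k * (X ^ k - 1) := by
    rw [neg_pow]; ring
  rw [e]; exact dvd_mul_of_dvd_right h1 _

/-- Pairing of an even-length tail: `Σ_{k<2m} T(k+1) = Σ_{j<m} (T(2j+1) + T(2j+2))`. -/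
theorem sum_range_pairs (T : ℕ → ℤ) (m : ℕ) :
    ∑ k ∈ range (2 * m), T (k + 1) = ∑ j ∈ range m, (T (2 * j + 1) + T (2 * j + 2)) := by
  induction m with
  | zero => simp
  | succ m ih =>
    rw [show 2 * (m + 1) = 2 * m + 1 + 1 by ring, Finset.sum_range_succ, Finset.sum_range_succ, ih,
      Finset.sum_range_succ]
    ring_nf

/-- **Positivity**: for odd `n` and `X ≥ 1`, `f_n(X) ≥ 1` (pair consecutive terms; the binomial
coefficients `C(2n−1, k)` increase for `k ≤ n − 1`). -/
theorem one_le_padeF {n : ℕ} (hodd : Odd n) {X : ℤ} (hX : 1 ≤ X) : 1 ≤ padeF n X := by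
  obtain ⟨m, rfl⟩ := hodd
  unfold padeF
  rw [show 2 * m + 1 = (2 * m) + 1 by ring, Finset.sum_range_succ']
  simp only [pow_zero, mul_one, Nat.choose_zero_right, Nat.cast_one]
  rw [sum_range_pairs (fun k => (Nat.choose (2 * (2 * m + 1) - 1) k : ℤ) * (-X) ^ k) m]
  have hnonneg : ∀ j ∈ range m, (0:ℤ) ≤ (Nat.choose (2 * (2 * m + 1) - 1) (2 * j + 1) : ℤ) * (-X) ^ (2 * j + 1)
      + (Nat.choose (2 * (2 * m + 1) - 1) (2 * j + 2) : ℤ) * (-X) ^ (2 * j + 2) := by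
    intro j hj
    rw [Finset.mem_range] at hj
    set N := 2 * (2 * m + 1) - 1 with hNdef
    have hN : N = 4 * m + 1 := by omega
    have hchoose : (Nat.choose N (2 * j + 1) : ℤ) ≤ Nat.choose N (2 * j + 2) := by
      exact_mod_cast Nat.choose_le_succ_of_lt_half_left (by omega)
    have hXpow : (0:ℤ) ≤ X ^ (2 * j + 1) := by positivity
    have e1 : (-X) ^ (2 * j + 1) = - X ^ (2 * j + 1) := by
      rw [neg_pow, Odd.neg_one_pow ⟨j, rfl⟩]; ring
    have e2 : (-X) ^ (2 * j + 2) = X ^ (2 * j + 1) * X := by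
      rw [neg_pow, show 2 * j + 2 = 2 * (j + 1) by ring, Even.neg_one_pow ⟨j + 1, by ring⟩, one_mul,
        show 2 * (j + 1) = (2 * j + 1) + 1 by ring, pow_succ]
    rw [e1, e2]
    have h0 : (0:ℤ) ≤ (Nat.choose N (2 * j + 1) : ℤ) := by positivity
    nlinarith [mul_nonneg hXpow (sub_nonneg.mpr hchoose), mul_nonneg (mul_nonneg hXpow h0) (sub_nonneg.mpr hX)]
  have := Finset.sum_nonneg hnonneg
  linarith

/-- Crude size bound: `|f_n(X)| ≤ 2^(2n−1)·X^(n−1)` for `X ≥ 1`. -/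
theorem abs_padeF_le {n : ℕ} (hn : 1 ≤ n) {X : ℤ} (hX : 1 ≤ X) :
    |padeF n X| ≤ 2 ^ (2 * n - 1) * X ^ (n - 1) := by
  unfold padeF
  refine (Finset.abs_sum_le_sum_abs _ _).trans ?_
  have hterm : ∀ k ∈ range n, |(Nat.choose (2 * n - 1) k : ℤ) * (-X) ^ k| ≤
      (Nat.choose (2 * n - 1) k : ℤ) * X ^ (n - 1) := by
    intro k hk
    rw [Finset.mem_range] at hk
    rw [abs_mul, abs_pow, abs_neg, abs_of_nonneg (by positivity : (0:ℤ) ≤ (Nat.choose (2 * n - 1) k : ℤ)),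
      abs_of_nonneg (by linarith : (0:ℤ) ≤ X)]
    exact mul_le_mul_of_nonneg_left (pow_le_pow_right₀ hX (by omega)) (by positivity)
  refine (Finset.sum_le_sum hterm).trans ?_
  rw [← Finset.sum_mul]
  refine mul_le_mul_of_nonneg_right ?_ (by positivity)
  have h := (Nat.sum_range_choose (2 * n - 1))
  have hsub : ∑ k ∈ range n, (Nat.choose (2 * n - 1) k : ℤ) ≤ ∑ k ∈ range (2 * n - 1 + 1), (Nat.choose (2 * n - 1) k : ℤ) := by
    refine Finset.sum_le_sum_of_subset_of_nonneg (Finset.range_mono (by omega)) fun _ _ _ => by positivity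
  calc ∑ k ∈ range n, (Nat.choose (2 * n - 1) k : ℤ) ≤ _ := hsub
    _ = 2 ^ (2 * n - 1) := by exact_mod_cast h

/-- Crude size bound: `|g_n(X)| ≤ 2^(2n−1)·X^(n−1)` for `X ≥ 1`. -/
theorem abs_padeG_le {n : ℕ} (hn : 1 ≤ n) {X : ℤ} (hX : 1 ≤ X) :
    |padeG n X| ≤ 2 ^ (2 * n - 1) * X ^ (n - 1) := by
  unfold padeG
  refine (Finset.abs_sum_le_sum_abs _ _).trans ?_
  have hterm : ∀ i ∈ range n, |(Nat.choose (2 * n - 1) (n + i) : ℤ) * X ^ i * (-1) ^ (n - 1 - i)| ≤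
      (Nat.choose (2 * n - 1) (n + i) : ℤ) * X ^ (n - 1) := by
    intro i hi
    rw [Finset.mem_range] at hi
    rw [abs_mul, abs_mul, abs_pow, abs_pow, abs_neg, abs_one, one_pow, mul_one,
      abs_of_nonneg (by positivity : (0:ℤ) ≤ (Nat.choose (2 * n - 1) (n + i) : ℤ)),
      abs_of_nonneg (by linarith : (0:ℤ) ≤ X)]
    exact mul_le_mul_of_nonneg_left (pow_le_pow_right₀ hX (by omega)) (by positivity)
  refine (Finset.sum_le_sum hterm).trans ?_
  rw [← Finset.sum_mul]
  refine mul_le_mul_of_nonneg_right ?_ (by positivity)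
  have h := (Nat.sum_range_choose (2 * n - 1))
  have hsub : ∑ i ∈ range n, (Nat.choose (2 * n - 1) (n + i) : ℤ) ≤
      ∑ k ∈ range (2 * n - 1 + 1), (Nat.choose (2 * n - 1) k : ℤ) := by
    have e : ∑ i ∈ range n, (Nat.choose (2 * n - 1) (n + i) : ℤ)
        = ∑ k ∈ Ico n (n + n), (Nat.choose (2 * n - 1) k : ℤ) := by
      rw [Finset.sum_Ico_eq_sum_range]; simp
    rw [e]
    refine Finset.sum_le_sum_of_subset_of_nonneg ?_ fun _ _ _ => by positivity
    intro k hk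
    rw [Finset.mem_Ico] at hk; rw [Finset.mem_range]; omega
  calc ∑ i ∈ range n, (Nat.choose (2 * n - 1) (n + i) : ℤ) ≤ _ := hsub
    _ = 2 ^ (2 * n - 1) := by exact_mod_cast h


/-- **Floor `C ≥ 2 − 1/n` at every ODD level** (Padé family: `a₁ = g_n(t+1)`, `a₂ = t + 1`, `c₁ = f_n(t+1)`,
`c₂ = 1`, `d = t^(2n−1)`, `t = q^(j+1)` for a prime `q > f_n(1)`): depth `(2n−1)(j+1) log q` against heights
`≤ n(j+1) log q + O(1)`. -/
theorem two_sub_inv_le_of_depthIneq_odd {n : ℕ} (hodd : Odd n) {C C' : ℝ} (hC : 0 ≤ C)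
    (h : DepthIneq n C C') : 2 - 1 / (n : ℝ) ≤ C := by
  have hn : 1 ≤ n := hodd.pos
  have hf1 : 1 ≤ padeF n 1 := one_le_padeF hodd le_rfl
  obtain ⟨q, hqge, hq⟩ := Nat.exists_infinite_primes ((padeF n 1).toNat + 2)
  have hq2 : 2 ≤ q := hq.two_le
  have hqf : padeF n 1 < q := by
    have : ((padeF n 1).toNat : ℤ) = padeF n 1 := Int.toNat_of_nonneg (by linarith)
    omega
  have hlogq : 0 < Real.log q := Real.log_pos (by exact_mod_cast (by omega : 1 < q))
  have hlog2 : 0 ≤ Real.log 2 := Real.log_nonneg (by norm_num)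
  -- the parameter
  obtain ⟨T, hT⟩ : ∃ T : ℕ → ℕ, ∀ j, T j = q ^ (j + 1) := ⟨_, fun _ => rfl⟩
  have hT1 : ∀ j, 1 ≤ T j := fun j => by rw [hT j]; exact Nat.one_le_pow _ _ (by omega)
  have hT0 : ∀ j, 0 < T j := fun j => hT1 j
  have hXZ : ∀ j, (1 : ℤ) ≤ (T j : ℤ) + 1 := fun j => by have := hT1 j; omega
  -- values
  have hFpos : ∀ j, 1 ≤ padeF n ((T j : ℤ) + 1) := fun j => one_le_padeF hodd (hXZ j)
  have hid : ∀ j, ((T j : ℤ) + 1) ^ n * padeG n ((T j : ℤ) + 1) - padeF n ((T j : ℤ) + 1)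
      = (T j : ℤ) ^ (2 * n - 1) := fun j => by
    have := pade_identity_gen hn ((T j : ℤ) + 1); rwa [add_sub_cancel_right] at this
  have hGpos : ∀ j, 0 < padeG n ((T j : ℤ) + 1) := fun j => by
    have h1 : 0 < ((T j : ℤ) + 1) ^ n * padeG n ((T j : ℤ) + 1) := by
      rw [(sub_eq_iff_eq_add).mp (hid j)]; have := hFpos j; positivity
    exact pos_of_mul_pos_right h1 (by positivity)
  have hGcast : ∀ j, (((padeG n ((T j : ℤ) + 1)).toNat : ℕ) : ℤ) = padeG n ((T j : ℤ) + 1) := fun j =>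
    Int.toNat_of_nonneg (hGpos j).le
  have hFcast : ∀ j, (((padeF n ((T j : ℤ) + 1)).toNat : ℕ) : ℤ) = padeF n ((T j : ℤ) + 1) := fun j =>
    Int.toNat_of_nonneg (by have := hFpos j; linarith)
  have hlogT : ∀ j, Real.log (T j : ℝ) = ((j : ℝ) + 1) * Real.log q := fun j => by
    rw [hT j]; push_cast; rw [Real.log_pow]; push_cast; ring
  have hnR : (1 : ℝ) ≤ n := by exact_mod_cast hn
  have hnpos : (0 : ℝ) < n := by linarith
  have hcastp : ((2 * n - 1 : ℕ) : ℝ) = 2 * n - 1 := by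
    rw [Nat.cast_sub (by omega), Nat.cast_mul]; norm_num
  have key := depthIneq_floor hC h (fun j => (padeG n ((T j : ℤ) + 1)).toNat) (fun j => T j + 1)
    (fun j => (padeF n ((T j : ℤ) + 1)).toNat) (fun _ => 1) (fun j => (T j) ^ (2 * n - 1))
    (fun j => ⟨by have := hGpos j; omega, by omega, by have := hFpos j; omega, one_pos, pow_pos (hT0 j) _⟩)
    (fun j => ?_) (fun j => ?_) (fun j => ?_)
    (p := 2 * n - 1) (q := n) (r := 3 * n * Real.log 2 + Real.log q)
    (fun j => ((j : ℝ) + 1) * Real.log q)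
    (fun j => ?_) (fun j => ?_) (fun K => ?_)
  · -- conclusion: (2n - 1) ≤ C n
    have e : (2:ℝ) - 1 / n = (2 * n - 1) / n := by field_simp
    rw [e, div_le_iff₀ hnpos]
    linarith [key]
  · -- coprimality
    rw [mul_one]
    refine Nat.Coprime.mul_left ?_ ?_
    · refine Nat.coprime_of_dvd fun p hp hpa hpb => ?_
      have hpa' : (p : ℤ) ∣ padeG n ((T j : ℤ) + 1) := by rw [← hGcast j]; exact_mod_cast hpa
      have hpb' : (p : ℤ) ∣ padeF n ((T j : ℤ) + 1) := by rw [← hFcast j]; exact_mod_cast hpb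
      have hpt : (p : ℤ) ∣ (T j : ℤ) ^ (2 * n - 1) := by
        rw [← hid j]; exact dvd_sub (dvd_mul_of_dvd_right hpa' _) hpb'
      have hpt' : p ∣ T j := hp.dvd_of_dvd_pow (by exact_mod_cast hpt : p ∣ T j ^ (2 * n - 1))
      have hpq'' : p ∣ q ^ (j + 1) := hT j ▸ hpt'
      have hpq : p = q := (Nat.prime_dvd_prime_iff_eq hp hq).mp (hp.dvd_of_dvd_pow hpq'')
      subst hpq
      have h1 : (p : ℤ) ∣ padeF n ((T j : ℤ) + 1) - padeF n 1 :=
        (dvd_trans (by rw [add_sub_cancel_right]; exact_mod_cast hpt') (sub_one_dvd_padeF_sub n _))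
      have h2 : (p : ℤ) ∣ padeF n 1 := by
        have := dvd_sub hpb' h1; rwa [sub_sub_cancel] at this
      have h3 := Int.le_of_dvd (by linarith) h2
      linarith
    · refine Nat.coprime_of_dvd fun p hp hpa hpb => ?_
      have hpa' : (p : ℤ) ∣ (T j : ℤ) + 1 := by exact_mod_cast hpa
      have hpb' : (p : ℤ) ∣ padeF n ((T j : ℤ) + 1) := by rw [← hFcast j]; exact_mod_cast hpb
      have h1 : (p : ℤ) ∣ padeF n ((T j : ℤ) + 1) - 1 := hpa'.trans (dvd_padeF_sub_one hn _)
      have h2 : (p : ℤ) ∣ 1 := by have := dvd_sub hpb' h1; rwa [sub_sub_cancel] at this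
      have h3 : p ∣ 1 := by exact_mod_cast h2
      exact hp.one_lt.ne' (Nat.dvd_one.mp h3)
  · -- a₁ a₂ⁿ ≠ c₁
    intro he
    have he' : (((padeG n ((T j : ℤ) + 1)).toNat : ℕ) : ℤ) * ((T j : ℤ) + 1) ^ n
        = (((padeF n ((T j : ℤ) + 1)).toNat : ℕ) : ℤ) * 1 ^ n := by exact_mod_cast he
    rw [hGcast, hFcast, one_pow, mul_one, mul_comm] at he'
    have := hid j
    rw [he', sub_self] at this
    have hpos : (0 : ℤ) < (T j : ℤ) ^ (2 * n - 1) := pow_pos (by exact_mod_cast hT0 j) _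
    rw [← this] at hpos; exact lt_irrefl _ hpos
  · -- divisibility
    have e : ((((padeG n ((T j : ℤ) + 1)).toNat * (T j + 1) ^ n : ℕ)) : ℤ)
        - ((((padeF n ((T j : ℤ) + 1)).toNat * 1 ^ n : ℕ)) : ℤ) = (T j : ℤ) ^ (2 * n - 1) := by
      have e1 : (((T j + 1) ^ n : ℕ) : ℤ) = ((T j : ℤ) + 1) ^ n := by push_cast; ring
      have e2 : ((1 ^ n : ℕ) : ℤ) = 1 := by simp
      rw [Nat.cast_mul, Nat.cast_mul, hGcast, hFcast, e1, e2, mul_one, mul_comm]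
      exact hid j
    rw [e, Nat.cast_pow]
  · -- depth
    have e : Real.log (((T j) ^ (2 * n - 1) : ℕ) : ℝ) = (2 * n - 1) * (((j:ℝ) + 1) * Real.log q) := by
      push_cast; rw [Real.log_pow, hcastp, hlogT]
    exact le_of_eq e.symm
  · -- heights
    have hTj1 : (1 : ℝ) ≤ (T j : ℝ) := by exact_mod_cast hT1 j
    have hXR : (1 : ℝ) ≤ (T j : ℝ) + 1 := by linarith
    -- log max(a₁,c₁) ≤ (2n-1) log 2 + (n-1) log X
    have hbd : ∀ z : ℤ, |z| ≤ 2 ^ (2 * n - 1) * ((T j : ℤ) + 1) ^ (n - 1) → 0 < z →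
        Real.log ((z.toNat : ℕ) : ℝ) ≤ (2 * n - 1) * Real.log 2 + (n - 1) * Real.log ((T j : ℝ) + 1) := by
      intro z hz hz0
      have hzc : ((z.toNat : ℕ) : ℝ) = (z : ℝ) := by
        have : ((z.toNat : ℕ) : ℤ) = z := Int.toNat_of_nonneg hz0.le
        exact_mod_cast this
      rw [abs_of_pos hz0] at hz
      have hzR : (z : ℝ) ≤ (2 : ℝ) ^ (2 * n - 1) * ((T j : ℝ) + 1) ^ (n - 1) := by exact_mod_cast hz
      rw [hzc]
      calc Real.log (z : ℝ) ≤ Real.log ((2 : ℝ) ^ (2 * n - 1) * ((T j : ℝ) + 1) ^ (n - 1)) :=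
            Real.log_le_log (by exact_mod_cast hz0) hzR
        _ = (2 * n - 1) * Real.log 2 + (n - 1) * Real.log ((T j : ℝ) + 1) := by
            rw [Real.log_mul (by positivity) (by positivity), Real.log_pow, Real.log_pow, hcastp,
              Nat.cast_sub hn]; push_cast; ring
    have hA := hbd _ (abs_padeG_le hn (hXZ j)) (hGpos j)
    have hB := hbd _ (abs_padeF_le hn (hXZ j)) (by have := hFpos j; linarith)
    have hmax1 : Real.log ((max (padeG n ((T j : ℤ) + 1)).toNat (padeF n ((T j : ℤ) + 1)).toNat : ℕ) : ℝ)
        ≤ (2 * n - 1) * Real.log 2 + (n - 1) * Real.log ((T j : ℝ) + 1) := by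
      rcases le_total (padeG n ((T j : ℤ) + 1)).toNat (padeF n ((T j : ℤ) + 1)).toNat with hle | hle
      · rw [max_eq_right hle]; exact hB
      · rw [max_eq_left hle]; exact hA
    have hX2 : Real.log ((T j : ℝ) + 1) ≤ Real.log 2 + Real.log (T j : ℝ) := by
      rw [← Real.log_mul (by norm_num) (by positivity)]
      exact Real.log_le_log (by positivity) (by linarith)
    have hmax2 : Real.log ((max (T j + 1) 1 : ℕ) : ℝ) ≤ Real.log 2 + Real.log (T j : ℝ) := by
      rw [max_eq_left (by omega : 1 ≤ T j + 1)]; push_cast; exact hX2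
    have hrad : UniqueFactorizationMonoid.radical (T j ^ (2 * n - 1)) ≤ q := by
      refine radical_le_of_dvd_pow (n := (j + 1) * (2 * n - 1)) (by omega) ?_
      rw [hT j, ← pow_mul]
    have hlog3 : Real.log ((UniqueFactorizationMonoid.radical (T j ^ (2 * n - 1)) : ℕ) : ℝ) ≤ Real.log q :=
      Real.log_le_log (by exact_mod_cast Nat.radical_pos _) (by exact_mod_cast hrad)
    have hX0 : 0 ≤ Real.log ((T j : ℝ) + 1) := Real.log_nonneg hXR
    rw [hlogT] at hmax2 hX2
    have hn1 : (0:ℝ) ≤ (n:ℝ) - 1 := by linarith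
    nlinarith [mul_le_mul_of_nonneg_left hX2 hn1, mul_nonneg hn1 hlog2]
  · obtain ⟨j, hj⟩ := exists_nat_ge (K / Real.log q)
    refine ⟨j, ?_⟩
    have := (div_le_iff₀ hlogq).mp hj
    nlinarith

end Summit.ABC.ABC.Cruxes.TowerExponentWindow.Disproof

/-! ## (a″) Load-bearing hypotheses of the LEVER (stub A)

Mirror of section (a) for the registered stub `stub_binomialDepthWindow`: COPRIMALITY is load-bearing, and it
fails exactly at the window (`not_stubBinomialDepthWindow_without_coprime`: the non-coprime data `(1, p², 1, p)`
force `n ≤ 3C`); the four POSITIVITY hypotheses and `0 < d` are decorative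
(`stubBinomialDepthWindow_iff_noPos`: a zero coordinate forces the other pair to be `(1,1)` and `d = 1`, and
`d = 0` would force `a₁a₂ⁿ = c₁c₂ⁿ`) — unlike the crux, whose positivity is load-bearing through `Π = 0`.
-/

namespace Summit.ABC.ABC.Cruxes.TowerExponentWindow.Disproof

open Literature.NumberTheory.DiophantineGeometry (radical_le_of_dvd_pow)

/-- The lever with COPRIMALITY dropped. -/
def StubBinomialDepthWindowWithoutCoprime : Prop :=
  ∃ n : ℕ, ∃ C C' : ℝ, 0 ≤ C ∧ 3 * C < n ∧ ∀ a₁ a₂ c₁ c₂ : ℕ, 0 < a₁ → 0 < a₂ → 0 < c₁ → 0 < c₂ →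
    a₁ * a₂ ^ n ≠ c₁ * c₂ ^ n → ∀ d : ℕ, 0 < d → (d : ℤ) ∣ ((a₁ * a₂ ^ n : ℕ) : ℤ) - ((c₁ * c₂ ^ n : ℕ) : ℤ) →
    Real.log (d : ℝ) ≤ C * (Real.log ((max a₁ c₁ : ℕ) : ℝ) + Real.log ((max a₂ c₂ : ℕ) : ℝ) +
      Real.log ((UniqueFactorizationMonoid.radical d : ℕ) : ℝ)) + C'

/-- **Coprimality is load-bearing for the lever, exactly at the window** (the skeleton's self-audit, now
kernel-checked): without it the data `(1, p², 1, p; d = pⁿ)` (`pⁿ ∣ p²ⁿ − pⁿ`, `p = 2^(m+1)`) have depth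
`n log p` against `C·(0 + 2 log p + log p) + C'`, i.e. `(n − 3C)·log p ≤ C'` for all `p`: impossible when
`3C < n`. -/
theorem not_stubBinomialDepthWindow_without_coprime : ¬ StubBinomialDepthWindowWithoutCoprime := by
  rintro ⟨n, C, C', hC, h3, h⟩
  have hnR : (0 : ℝ) < n := by linarith
  have hn : 1 ≤ n := Nat.one_le_iff_ne_zero.mpr (by rintro rfl; simp at hnR)
  have hlog2 : 0 < Real.log 2 := Real.log_pos one_lt_two
  have key : ∀ m : ℕ, (n : ℝ) * (((m : ℝ) + 1) * Real.log 2) ≤ 3 * C * (((m : ℝ) + 1) * Real.log 2) + C' := by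
    intro m
    obtain ⟨p, hp⟩ : ∃ p : ℕ, p = 2 ^ (m + 1) := ⟨_, rfl⟩
    have hp1 : 1 < p := by rw [hp]; exact Nat.one_lt_two_pow (by omega)
    have hp0 : 0 < p := by omega
    have hne : 1 * (p ^ 2) ^ n ≠ 1 * p ^ n := by
      rw [one_mul, one_mul, ← pow_mul]
      intro he
      have := Nat.pow_right_injective hp1 he
      omega
    have hdvd : ((p ^ n : ℕ) : ℤ) ∣ ((1 * (p ^ 2) ^ n : ℕ) : ℤ) - ((1 * p ^ n : ℕ) : ℤ) := by
      refine ⟨(p : ℤ) ^ n - 1, ?_⟩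
      push_cast; ring
    have h1 := h 1 (p ^ 2) 1 p one_pos (by positivity) one_pos hp0 hne (p ^ n) (by positivity) hdvd
    have hlogp : Real.log (p : ℝ) = ((m : ℝ) + 1) * Real.log 2 := by
      rw [hp]; push_cast; rw [Real.log_pow]; push_cast; ring
    have e1 : Real.log (((p ^ n : ℕ)) : ℝ) = n * Real.log (p : ℝ) := by push_cast; rw [Real.log_pow]
    have e2 : (max 1 1 : ℕ) = 1 := max_self 1
    have e3 : (max (p ^ 2) p : ℕ) = p ^ 2 := max_eq_left (by nlinarith)
    have e4 : Real.log (((p ^ 2 : ℕ)) : ℝ) = 2 * Real.log (p : ℝ) := by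
      push_cast; rw [Real.log_pow]; push_cast; ring
    have hrad : UniqueFactorizationMonoid.radical (p ^ n) ≤ p := radical_le_of_dvd_pow (n := n) hp0.ne' dvd_rfl
    have hrad' : Real.log ((UniqueFactorizationMonoid.radical (p ^ n) : ℕ) : ℝ) ≤ Real.log (p : ℝ) :=
      Real.log_le_log (by exact_mod_cast Nat.radical_pos _) (by exact_mod_cast hrad)
    rw [e1, e2, e3, e4, Nat.cast_one, Real.log_one, zero_add] at h1
    have hCr := mul_le_mul_of_nonneg_left hrad' hC
    rw [hlogp] at h1 hCr
    linarith
  have hgap : 0 < ((n : ℝ) - 3 * C) * Real.log 2 := by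
    have : 0 < (n : ℝ) - 3 * C := by linarith
    positivity
  obtain ⟨m, hm⟩ := exists_nat_gt (C' / (((n : ℝ) - 3 * C) * Real.log 2))
  have hm' : C' < (m : ℝ) * (((n : ℝ) - 3 * C) * Real.log 2) := (div_lt_iff₀ hgap).mp hm
  have hk := key m
  nlinarith

/-- **The four positivity hypotheses and `0 < d` are DECORATIVE for the lever** (given coprimality and
`a₁a₂ⁿ ≠ c₁c₂ⁿ`): a zero coordinate forces the opposite pair to be `(1, 1)` and `d = 1`; `d = 0` would force
`a₁a₂ⁿ = c₁c₂ⁿ`.  (Contrast the crux itself, where positivity is load-bearing through `Π = 0`.) -/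
theorem stubBinomialDepthWindow_iff_noPos :
    StubBinomialDepthWindow ↔ ∃ n : ℕ, ∃ C C' : ℝ, 0 ≤ C ∧ 3 * C < n ∧ ∀ a₁ a₂ c₁ c₂ d : ℕ,
      Nat.Coprime (a₁ * a₂) (c₁ * c₂) → a₁ * a₂ ^ n ≠ c₁ * c₂ ^ n →
      (d : ℤ) ∣ ((a₁ * a₂ ^ n : ℕ) : ℤ) - ((c₁ * c₂ ^ n : ℕ) : ℤ) →
      Real.log (d : ℝ) ≤ C * (Real.log ((max a₁ c₁ : ℕ) : ℝ) + Real.log ((max a₂ c₂ : ℕ) : ℝ) +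
        Real.log ((UniqueFactorizationMonoid.radical d : ℕ) : ℝ)) + C' := by
  constructor
  · rintro ⟨n, C, C', hC, h3, h⟩
    have hnR : (0 : ℝ) < n := by linarith
    have hn : 1 ≤ n := Nat.one_le_iff_ne_zero.mpr (by rintro rfl; simp at hnR)
    refine ⟨n, C, max C' 0, hC, h3, fun a₁ a₂ c₁ c₂ d hcop hne hdvd => ?_⟩
    -- generic nonnegativity of the right-hand side at `d = 1`
    have hRHS : ∀ x y : ℕ, 0 ≤ C * (Real.log ((max x 1 : ℕ) : ℝ) + Real.log ((max y 1 : ℕ) : ℝ) +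
        Real.log ((UniqueFactorizationMonoid.radical 1 : ℕ) : ℝ)) + max C' 0 := by
      intro x y
      have h1 : 0 ≤ Real.log ((max x 1 : ℕ) : ℝ) := Real.log_nonneg (by exact_mod_cast le_max_right x 1)
      have h2 : 0 ≤ Real.log ((max y 1 : ℕ) : ℝ) := Real.log_nonneg (by exact_mod_cast le_max_right y 1)
      have h3' : Real.log ((UniqueFactorizationMonoid.radical 1 : ℕ) : ℝ) = 0 := by simp
      rw [h3']
      have := mul_nonneg hC (by linarith : 0 ≤ Real.log ((max x 1 : ℕ) : ℝ) + Real.log ((max y 1 : ℕ) : ℝ) + 0)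
      linarith [le_max_right C' 0]
    have hRHS' : ∀ x y : ℕ, 0 ≤ C * (Real.log ((max 1 x : ℕ) : ℝ) + Real.log ((max 1 y : ℕ) : ℝ) +
        Real.log ((UniqueFactorizationMonoid.radical 1 : ℕ) : ℝ)) + max C' 0 := by
      intro x y; rw [max_comm 1 x, max_comm 1 y]; exact hRHS x y
    by_cases hz : a₁ * a₂ = 0 ∨ c₁ * c₂ = 0
    · -- a zero coordinate: the other pair is (1,1) and d = 1
      rcases hz with hz | hz
      · have hc : c₁ * c₂ = 1 := by rw [hz] at hcop; exact (Nat.coprime_zero_left _).mp hcop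
        have hc1 : c₁ = 1 := Nat.eq_one_of_mul_eq_one_right hc
        have hc2 : c₂ = 1 := Nat.eq_one_of_mul_eq_one_left hc
        subst hc1; subst hc2
        have ha0 : a₁ * a₂ ^ n = 0 := by
          rcases Nat.mul_eq_zero.mp hz with h0 | h0
          · rw [h0, zero_mul]
          · rw [h0, zero_pow (by omega), mul_zero]
        have hd1 : d = 1 := by
          rw [ha0] at hdvd
          have : (d : ℤ) ∣ 1 := by
            have h' : (d : ℤ) ∣ -(((0 : ℕ) : ℤ) - ((1 * 1 ^ n : ℕ) : ℤ)) := (dvd_neg).mpr hdvd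
            simpa using h'
          exact_mod_cast Int.eq_one_of_dvd_one (by positivity) this
        subst hd1
        simp only [Nat.cast_one, Real.log_one]
        exact hRHS a₁ a₂
      · have ha : a₁ * a₂ = 1 := by rw [hz] at hcop; exact (Nat.coprime_zero_right _).mp hcop
        have ha1 : a₁ = 1 := Nat.eq_one_of_mul_eq_one_right ha
        have ha2 : a₂ = 1 := Nat.eq_one_of_mul_eq_one_left ha
        subst ha1; subst ha2
        have hc0 : c₁ * c₂ ^ n = 0 := by
          rcases Nat.mul_eq_zero.mp hz with h0 | h0
          · rw [h0, zero_mul]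
          · rw [h0, zero_pow (by omega), mul_zero]
        have hd1 : d = 1 := by
          rw [hc0] at hdvd
          have : (d : ℤ) ∣ 1 := by simpa using hdvd
          exact_mod_cast Int.eq_one_of_dvd_one (by positivity) this
        subst hd1
        simp only [Nat.cast_one, Real.log_one]
        exact hRHS' c₁ c₂
    · have hz1 : a₁ * a₂ ≠ 0 := fun h0 => hz (Or.inl h0)
      have hz2 : c₁ * c₂ ≠ 0 := fun h0 => hz (Or.inr h0)
      have ha : 0 < a₁ ∧ 0 < a₂ :=
        ⟨Nat.pos_of_ne_zero fun h0 => hz1 (by rw [h0, zero_mul]),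
         Nat.pos_of_ne_zero fun h0 => hz1 (by rw [h0, mul_zero])⟩
      have hc : 0 < c₁ ∧ 0 < c₂ :=
        ⟨Nat.pos_of_ne_zero fun h0 => hz2 (by rw [h0, zero_mul]),
         Nat.pos_of_ne_zero fun h0 => hz2 (by rw [h0, mul_zero])⟩
      have hd : 0 < d := by
        rcases Nat.eq_zero_or_pos d with rfl | hd
        · exfalso
          have : ((a₁ * a₂ ^ n : ℕ) : ℤ) - ((c₁ * c₂ ^ n : ℕ) : ℤ) = 0 := by simpa using hdvd
          exact hne (by exact_mod_cast (sub_eq_zero.mp this))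
        · exact hd
      exact (h a₁ a₂ c₁ c₂ ha.1 ha.2 hc.1 hc.2 hcop hne d hd hdvd).trans (by linarith [le_max_left C' 0])
  · rintro ⟨n, C, C', hC, h3, h⟩
    exact ⟨n, C, C', hC, h3, fun a₁ a₂ c₁ c₂ _ _ _ _ hcop hne d _ hdvd => h a₁ a₂ c₁ c₂ d hcop hne hdvd⟩

end Summit.ABC.ABC.Cruxes.TowerExponentWindow.Disproof

/-! ## (d⁗) Candidate proof of stub C (`FlatBound n → PolyABC`)

With (d'') this leaves the LEVER (stub A) as the only unproved input of the line: `polyAbc_of_flatBound` /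
`stub_polyAbcOfFlatBound_candidate` (the registered stub C verbatim) via the single-coordinate canonical lift
`topPowerSplit` (`a = u·Xⁿ`, `u ∣ rad(a)^(n−1)`).  Positive Lines content: offered as evidence for the lead, not
landed by the refuter.
-/

namespace Summit.ABC.ABC.Cruxes.TowerExponentWindow.Disproof

open Finset
open Literature.NumberTheory.DiophantineGeometry

/-- **Single-coordinate canonical lift** (Vojta's lift at the top exponent only): for `n ≥ 1`, `a ≥ 1` there
are `u, X ≥ 1` with `a = u·Xⁿ` and `u ∣ rad(a)^(n−1)` (`X = Π p^⌊v_p(a)/n⌋`, `u = Π p^(v_p(a) mod n)`). -/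
theorem topPowerSplit {n : ℕ} (hn : 1 ≤ n) {a : ℕ} (ha : 0 < a) :
    ∃ u X : ℕ, 0 < u ∧ 0 < X ∧ u * X ^ n = a ∧ u ∣ (UniqueFactorizationMonoid.radical a) ^ (n - 1) := by
  classical
  have ha0 : a ≠ 0 := ha.ne'
  have hprime : ∀ p ∈ a.primeFactors, p.Prime := fun p hp => Nat.prime_of_mem_primeFactors hp
  refine ⟨∏ p ∈ a.primeFactors, p ^ (a.factorization p % n), ∏ p ∈ a.primeFactors, p ^ (a.factorization p / n),
    Finset.prod_pos fun p hp => pow_pos (hprime p hp).pos _,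
    Finset.prod_pos fun p hp => pow_pos (hprime p hp).pos _, ?_, ?_⟩
  · rw [← Finset.prod_pow, ← Finset.prod_mul_distrib]
    conv_rhs => rw [← prod_primeFactors_pow_factorization ha0]
    refine Finset.prod_congr rfl fun p _ => ?_
    rw [← pow_mul, ← pow_add]; congr 1
    rw [Nat.mod_add_div']
  · rw [Nat.radical_eq_prod_primeFactors, ← Finset.prod_pow]
    refine Finset.prod_dvd_prod_of_dvd _ _ fun p hp => pow_dvd_pow p ?_
    have := Nat.mod_lt (a.factorization p) (by omega : 0 < n)
    omega

/-- **Stub C** (`FlatBound n → PolyABC` for `n ≥ 1`): a CANDIDATE PROOF of the registered `stub_polyAbcOfFlatBound`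
for the lead (positive Lines content, offered as evidence).  Split `a = uXⁿ`, `b = vYⁿ`, `c = wZⁿ` at the top
power; the flat bound gives `c ≤ K(uvw)^κ` and `uvw ∣ (rad a·rad b·rad c)^(n−1) = rad(abc)^(n−1)`, whence
`c < (K+1)·rad(abc)^((n−1)·max κ 0)`. -/
theorem polyAbc_of_flatBound {n : ℕ} (hn : 1 ≤ n) (hF : FlatBound n) :
    ∃ κ C : ℝ, 0 < C ∧ ∀ a b c : ℕ, IsABCTriple a b c → (c : ℝ) < C * ((rad a b c : ℕ) : ℝ) ^ κ := by
  obtain ⟨κ, K, hK⟩ := hF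
  -- K > 0 from the flat point (1,1,2,1,1,1)
  have hKpos : 0 < K := by
    have h := hK 1 1 2 1 1 1 one_pos one_pos two_pos one_pos one_pos one_pos (by norm_num) (by norm_num)
    norm_num at h
    have : (0:ℝ) < (2:ℝ) ^ κ := Real.rpow_pos_of_pos two_pos κ
    nlinarith
  refine ⟨(n - 1 : ℝ) * max κ 0, K + 1, by linarith, fun a b c habc => ?_⟩
  obtain ⟨ha, hb, hsum, hcop⟩ := habc
  have hc : 0 < c := by omega
  obtain ⟨u, X, hu, hX, hua, hudvd⟩ := topPowerSplit hn ha
  obtain ⟨v, Y, hv, hY, hvb, hvdvd⟩ := topPowerSplit hn hb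
  obtain ⟨w, Z, hw, hZ, hwc, hwdvd⟩ := topPowerSplit hn hc
  have hflat := hK u v w X Y Z hu hv hw hX hY hZ (by rw [hua, hvb, hwc, hsum]) (by rw [hua, hvb]; exact hcop)
  rw [hwc] at hflat
  -- uvw ≤ rad(abc)^(n-1)
  set R : ℕ := rad a b c with hRdef
  have hR0 : 0 < R := Nat.radical_pos _
  have huvw : u * v * w ≤ R ^ (n - 1) := by
    have hd : u * v * w ∣ (UniqueFactorizationMonoid.radical a * UniqueFactorizationMonoid.radical b *
        UniqueFactorizationMonoid.radical c) ^ (n - 1) := by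
      rw [mul_pow, mul_pow]; exact mul_dvd_mul (mul_dvd_mul hudvd hvdvd) hwdvd
    rw [radical_mul_three_of_triple ⟨ha, hb, hsum, hcop⟩] at hd
    exact Nat.le_of_dvd (by positivity) hd
  have huvw1 : (1 : ℝ) ≤ ((u * v * w : ℕ) : ℝ) := by
    exact_mod_cast Nat.mul_pos (Nat.mul_pos hu hv) hw
  have hR1 : (1 : ℝ) ≤ (R : ℝ) := by exact_mod_cast hR0
  -- (uvw)^κ ≤ (uvw)^(max κ 0) ≤ (R^(n-1))^(max κ 0) = R^((n-1)·max κ 0)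
  have h1 : ((u * v * w : ℕ) : ℝ) ^ κ ≤ ((u * v * w : ℕ) : ℝ) ^ (max κ 0) :=
    Real.rpow_le_rpow_of_exponent_le huvw1 (le_max_left _ _)
  have h2 : ((u * v * w : ℕ) : ℝ) ^ (max κ 0) ≤ ((R : ℝ) ^ ((n : ℝ) - 1)) ^ (max κ 0) := by
    refine Real.rpow_le_rpow (by positivity) ?_ (le_max_right _ _)
    have : ((u * v * w : ℕ) : ℝ) ≤ ((R ^ (n - 1) : ℕ) : ℝ) := by exact_mod_cast huvw
    rw [Nat.cast_pow, ← Real.rpow_natCast, Nat.cast_sub hn, Nat.cast_one] at this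
    exact this
  have h3 : ((R : ℝ) ^ ((n : ℝ) - 1)) ^ (max κ 0) = (R : ℝ) ^ (((n : ℝ) - 1) * max κ 0) := by
    rw [← Real.rpow_mul (by positivity)]
  have hpow : ((u * v * w : ℕ) : ℝ) ^ κ ≤ (R : ℝ) ^ (((n : ℝ) - 1) * max κ 0) := by
    rw [← h3]; exact h1.trans h2
  have hRpow : 0 < (R : ℝ) ^ (((n : ℝ) - 1) * max κ 0) := Real.rpow_pos_of_pos (by positivity) _
  calc (c : ℝ) ≤ K * ((u * v * w : ℕ) : ℝ) ^ κ := hflat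
    _ ≤ K * (R : ℝ) ^ (((n : ℝ) - 1) * max κ 0) := mul_le_mul_of_nonneg_left hpow hKpos.le
    _ < (K + 1) * ((R : ℕ) : ℝ) ^ (((n : ℝ) - 1) * max κ 0) := by nlinarith

/-- The registered stub C verbatim. -/
theorem stub_polyAbcOfFlatBound_candidate : ∀ n : ℕ, 1 ≤ n → (∃ κ K : ℝ, ∀ u v w X Y Z : ℕ, 0 < u → 0 < v → 0 < w → 0 < X → 0 < Y → 0 < Z → u * X ^ n + v * Y ^ n = w * Z ^ n → Nat.Coprime (u * X ^ n) (v * Y ^ n) → ((w * Z ^ n : ℕ) : ℝ) ≤ K * ((u * v * w : ℕ) : ℝ) ^ κ) → ∃ κ C : ℝ, 0 < C ∧ ∀ a b c : ℕ, Literature.NumberTheory.DiophantineGeometry.IsABCTriple a b c → (c : ℝ) < C * ((Literature.NumberTheory.DiophantineGeometry.rad a b c : ℕ) : ℝ) ^ κ :=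
  fun _n hn hF => polyAbc_of_flatBound hn hF

end Summit.ABC.ABC.Cruxes.TowerExponentWindow.Disproof
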